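import Literature.Analysis.FluidPDE.TorusNSSobolevCommutator
import HarnessLib

/-!
# Kato's commutator inequality for the Navier–Stokes nonlinearity, pair form, on the torus:
# `|(B(v,w), Λ^{2s}w)| ≤ c (‖v‖_{Ḣ^s}‖w‖_{F_1} + ‖v‖_{F_1}‖w‖_{Ḣ^s}) ‖w‖_{Ḣ^s}` (`s ≥ 1`),
# and the companion product estimate for `(B(w,v), Λ^{2s}w)`

Analysis/FluidPDE support file (theorems only; no definitions, no named facts), sequel of
`TorusNSSobolevCommutator` (Robinson–Sadowski–Silva 2012 (3.6), the case `v = w`).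
Search for candidate a priori estimates; no regularity claim.

Kato's inequality for the bilinear map `𝒫(v, w) = −𝔏(v·∂w)` of the Euler / Navier–Stokes
equations on `T^d` (Kato 1972; Morosi–Pizzocchero, Commun. Pure Appl. Anal. 11 (2012): "the Kato
inequality `|⟨v·∂w | w⟩_n| ≤ G_n ‖v‖_n ‖w‖²_n`, where `n ∈ (d/2 + 1, +∞)` and `v, w` are in the
Sobolev spaces `H^n_{Σ0}`, `H^{n+1}_{Σ0}` of zero mean, divergence free vector fields") is the
estimate on which every `H^n` energy argument for the DIFFERENCE of two flows runs — in particular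
the a posteriori framework of Morosi–Pizzocchero (Nonlinear Anal. 75 (2012) 2209, Lemma 4.2 /
Prop. 4.3: `d⁺/dt ‖u − u_a‖_n ≤ −ν‖u − u_a‖_n + (G_n‖u_a‖_n + K_n‖u_a‖_{n+1})‖u − u_a‖_n +
G_n‖u − u_a‖_n² + ε_n`). Its proof is the commutator argument of Robinson–Sadowski–Silva 2012,
§III (3.6)–(3.7), written for a PAIR `(v, w)` instead of `(u, u)`: "Since `(B(v, Λ^s w), Λ^s w) = 0`
… `|(B(v,w),Λ^{2s}w)| ≤ ∫∫ |k−j| |v̂(k−j)| ||k|^s − |j|^s| |ŵ(j)| |k|^s |ŵ(k)|`", then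
`||k|^s − |j|^s| ≤ c|k−j|(|k−j|^{s−1} + |j|^{s−1})` and Young. This file proves exactly this
lattice form (the intermediate, Wiener-algebra-flavoured statement; the `H^n` form with a constant
`G_n` follows by `‖·‖_{F_1} ≤ C‖·‖_{Ḣ^n}`, `n > d/2 + 1`, not done here):

* `NSSobolev.abs_tsum_rpow_mul_re_inner_convect_pair_le` — for smooth real fields `v, w` on `T^n`
  with `div v = 0` and `s ≥ 1`,
  `|∑_k |k|^{2s} Re⟪𝓕((v·∇)w)(k), ŵ(k)⟫| ≤ 2π n s 2^s (X_v^{1/2} F₁(w) + F₁(v) X_w^{1/2}) X_w^{1/2}`,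
  `X_f = ∑_k |k|^{2s}‖f̂(k)‖²`, `F₁(f) = ∑_k |k| ‖f̂(k)‖` — for `v = w` this is the tree's (3.6)
  with the same constant `4π n s 2^s`.
* `NSSobolev.abs_tsum_rpow_mul_re_inner_convect_transport_le` — the companion product ('basic')
  estimate for the term in which the difference field advects the reference field (no
  cancellation, no divergence condition): for smooth `w, v` and `s ≥ 1`,
  `|∑_k |k|^{2s} Re⟪𝓕((w·∇)v)(k), ŵ(k)⟫| ≤ 2π n 2^{s−1} (F₀(w) X'_v^{1/2} + F₁(v) X_w^{1/2}) X_w^{1/2}`,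
  `X'_v = ∑_k |k|^{2s+2}‖v̂(k)‖²`, `F₀(w) = ∑_k ‖ŵ(k)‖` (weight splitting
  `|k|^s ≤ 2^{s−1}(|l|^s + |k−l|^s)` and Young twice). With the tree's (3.6) these two bound all
  three nonlinear terms of the `Ḣ^s` balance of `w = u − u_a` (Morosi–Pizzocchero 2012, Lemma 4.2).
* `NSSobolev.norm_sum_mul_le_sqrt_gram_of_orthogonal` — Morosi–Pizzocchero's geometric lemma
  (CPAA 2012, Lemma 4.1): `|∑ k_j z_j| |h| ≤ √(|h|²|k|² − (h·k)²) ‖z‖` when `∑ h_j z_j = 0`;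
* `NSSobolev.abs_tsum_rpow_mul_re_inner_convect_pair_le_of_kernel_le` — **the Kato inequality with
  Morosi–Pizzocchero's sharp-constant functional** (CPAA 2012, Prop. 3.5 and §4): if all finite
  partial sums of `𝒢_s(k) = ∑_h (|h|²|k|² − (h·k)²)(|k|^s − |k−h|^s)²/(|h|^{2s+2}|k−h|^{2s})`
  are `≤ Gsq` for every `k`, then
  `|∑_k |k|^{2s} Re⟪𝓕((v·∇)w)(k), ŵ(k)⟫| ≤ 2π √Gsq ‖v‖_{Ḣ^s} ‖w‖²_{Ḣ^s}` — MP's `G_n⁺` route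
  (their certified `sup 𝒢₃` gives `G₃ ≤ 0.438` on `(ℝ/2πℤ)³`; the evaluation of `sup 𝒢_s` is a
  hypothesis here);
* `NSSobolev.abs_rpow_sub_rpow_le_mul_max_rpow` — Morosi–Pernici–Pizzocchero's Lemma 4.1
  (Appl. Math. Comput. 308 (2017) 54), `|a^p − b^p| ≤ p |a − b| max(a, b)^{p−1}` (`a, b ≥ 0`,
  `p ≥ 1`);
* `NSSobolev.sum_gramKernel_le` — **the elementary evaluation of `sup 𝒢_s`** (MPP 2017, Prop. 4.2,
  written for the functional of §3): every finite partial sum of `𝒢_s(k)` is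
  `≤ s² 2^{2s−2} ζ_{2s−2}`, `ζ_{2s−2} = ∑_{h ≠ 0} |h|^{2−2s}`, whenever `2(s − 1) > card d`
  (`|h ∧ k|² = |h ∧ (k−h)|² ≤ |h|²|k−h|²`, Lemma 4.1, `max(|k|, |k−h|) ≤ |h| + |k−h|`, convexity,
  and the symmetry `h ↦ k − h` of the two resulting zeta tails);
* `NSSobolev.abs_tsum_rpow_mul_re_inner_convect_pair_le_zeta` — hence the HYPOTHESIS-FREE form
  of the sharp-functional Kato inequality (MPP 2017, Thm. 4.4 with Prop. 4.2, i.e. their rough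
  bound `G_{nn} ≤ G^{⟨+⟩}`-route, for the functional of MP 2012):
  `|∑_k |k|^{2s} Re⟪𝓕((v·∇)w)(k), ŵ(k)⟫| ≤ 2π s 2^{s−1} √ζ_{2s−2} ‖v‖_{Ḣ^s} ‖w‖²_{Ḣ^s}`
  (`2(s−1) > card d`) — on `T³` at `s = 3` the constant is `24π C₁`, `C₁² = ζ₄ ≈ 16.5`, against
  the Wiener route's `4πn s2^s C₁ = 288π C₁` of `TorusNSSobolevControlInequality` (a factor `4n`)
  and MP's lattice-optimised `(2π)^{5/2}·0.438 ≈ 43` (a factor `≈ 7` the other way);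
* `NSSobolev.abs_tsum_rpow_mul_re_inner_convect_transport_le_of_kernel_le` — **the transport
  term with Morosi–Pizzocchero's functional `𝒦_n`** (Appl. Math. Lett. 26 (2013) 277, Def. 3.5 /
  Prop. 3.7; MPP 2017 Thm. 3.3 at `p = n`): if all finite partial sums of
  `𝒦_s(k) = |k|^{2s} ∑_h |h ∧ k|² / (|h|^{2s+2}|k−h|^{2s+2})` are `≤ Ksq`, then for `div w = 0`,
  `∫ w = 0`, `|∑_k |k|^{2s} Re⟪𝓕((w·∇)v)(k), ŵ(k)⟫| ≤ 2π √Ksq ‖w‖²_{Ḣ^s} ‖v‖_{Ḣ^{s+1}}` — one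
  term, MP's `K_n‖w‖_n²‖v‖_{n+1}` shape;
* `NSSobolev.sum_wedgeKernel_le` — the elementary evaluation (MPP 2017, Prop. 3.1): partial sums
  of `𝒦_s(k)` are `≤ 2^{2s} ζ_{2s}` (`2s > card d`), and
  `NSSobolev.abs_tsum_rpow_mul_re_inner_convect_transport_le_zeta` — the hypothesis-free form,
  constant `2π 2^s √ζ_{2s}` (on `T³`, `s = 3`: `16π C₀ ≈ 146`, `C₀² = ζ₆ ≈ 8.40`; MP's optimised
  `(2π)^{5/2}·0.323 ≈ 32`);
* `NSSobolev.rpow_mul_gram_le_of_sq_le` — **the constant of MPP's Lemma 5.3 at `p = n` in closed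
  form**: `(A + B + 2P)^s(AB − P²) ≤ 2^{s−1}M_s(A^s + B^s)AB`, `M_s = 2^{s+2}(s+1)^{s+1}/(s+2)^{s+2}`
  (`P² ≤ AB`, `s ≥ 1`), i.e. MPP's conjectured value (5.9) `B_{pp} = 4^{p+1}(p+1)^{p+1}/(p+2)^{p+2}`
  (there checked numerically) PROVED by weighted AM–GM for every real `s ≥ 1`, with equality;
  hence `NSSobolev.sum_wedgeKernel_le_mpp` (partial sums of `𝒦_s` are `≤ B_s ζ_{2s}`,
  `B_s = 2^{2s+2}(s+1)^{s+1}/(s+2)^{s+2}`, `B₃ ≈ 20.97` against `64`) and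
  `NSSobolev.abs_tsum_rpow_mul_re_inner_convect_transport_le_zeta_mpp` (constant `2π√(B_sζ_{2s})`;
  on `T³`, `s = 3`: `≈ 83`);
* `NSSobolev.one_sub_sq_mul_sq_cube_sub_cube_le` — **MP's Lemma 5.3 (CPAA 2012) at `n = 3` with a
  hand constant**: `(1 − t²)(r³ − b³)² ≤ 12(a²b⁴ + a⁶)` for `r² = a² + b² + 2abt` (their
  `C₃ = 14.81…` by MATHEMATICA; here `C₃/2 ≤ 12` by a three-case elementary argument and explicit
  sums of squares); hence `NSSobolev.sum_gramKernel_le_three` (partial sums of `𝒢₃ ≤ 24 ζ₄` on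
  `ℤ^n`, `n ≤ 3`, against `144 ζ₄`) and
  `NSSobolev.abs_tsum_rpow_mul_re_inner_convect_pair_le_zeta_three` (constant `2π(24ζ₄)^{1/2}
  ≈ 125` on `T³`, against `307`; MP's certified `43`).

Scope (faithfulness): Kato / Morosi–Pizzocchero state the inequality in `H^n`, `n > d/2 + 1`,
with (sharp, lattice-sum) constants `G_n`; here the RSS lattice route gives the `F_1`-form with
the explicit constant `2π n s 2^s` for every real `s ≥ 1`; `w` need not be divergence free (only
the advecting field's transversality enters the cancellation).
§3 adds Morosi–Pizzocchero's own route (CPAA 2012, Prop. 3.5): the `Ḣ^s`-form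
`≤ 2π √(sup 𝒢_s) ‖v‖_s ‖w‖_s²` with their lattice functional `𝒢_s` (its supremum a hypothesis).
The `H^n` forms via the Wiener–Sobolev embedding are in `TorusNSSobolevControlInequality`.
§4 adds the elementary evaluation of `sup 𝒢_s` of Morosi–Pernici–Pizzocchero (Appl. Math.
Comput. 308 (2017), Prop. 4.2: "`sup_k 𝒢_{pn}(k) ≤ 2^{2p} p² ζ_{2n−2}`"; for the functional of §3,
whose denominator is exactly `|h|^{2s+2}|k−h|^{2s}`, the same three lines give
`s² 2^{2s−2} ζ_{2s−2}`), and the resulting hypothesis-free inequality; §5 does the same for the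
transport term with MP's functional `𝒦_n` (Appl. Math. Lett. 26 (2013) 277, Prop. 3.7; its
supremum a hypothesis, then MPP Prop. 3.1's elementary `2^{2s} ζ_{2s}`); §6 replaces `2^{2s}` by
MPP's Lemma 5.3 constant in the closed form of their Remark 5.4, proved here by weighted AM–GM; §7
treats the case `n = 3` of MP's Lemma 5.3 (CPAA 2012) by hand (`C₃/2 ≤ 12`), giving
`sup 𝒢₃ ≤ 24 ζ₄`.
-- TODO(general form): the SHARP evaluations `sup_k 𝒢₃(k) ≤ ((2π)^{3/2}·0.438)²`,
-- `sup_k 𝒦₃(k) ≤ ((2π)^{3/2}·0.323)²` on `ℤ³` (MP's Appendices / MPP §6–§8, lattice computations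
-- with rigorous tail control), and the tame (`p ≥ n`) versions of MPP 2017.

## Mathlib / tree search

Tree (reused): `NSSobolev.mFourierCoeff_convect_apply_eq_tsum` (any smooth `u, v`),
`NSSobolev.abs_rpow_sqrt_sub_rpow_sqrt_le` ((3.7) on the lattice),
`NSSobolev.re_tsum_tsum_latticeConvect_eq_zero` (cancellation, any `ŵ`),
`NSGevrey.sum_mul_tsum_mul_le` (Young `ℓ¹ ∗ ℓ² ⊂ ℓ²`), `IsSmooth.summable_freqNormSq_rpow_mul_norm_sq`,
`IsDivFree.sum_mul_mFourierCoeff_eq_zero`, `isConjSymm_mFourierCoeff`; the proof is the tree's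
proof of (3.6) (`TorusNSSobolevCommutator` §4) with two coefficient families. Searched
`lean search 'convect_pair|Kato.*pair|inner_convect.*le'`: same-field version only.
§4–§6: `summable_one_add_freqNormSq_rpow_neg` (`TorusInverseLaplacianSup`), `sqrt_freqNormSq_add_le`,
`freqNormSq_neg`, `Torus.mFourierCoeff_complexify_zero_of_hasZeroMean`; Mathlib
`one_add_mul_self_le_rpow_one_add` (Bernoulli), `NNReal.rpow_add_le_mul_rpow_add_rpow`,
`Real.geom_mean_le_arith_mean2_weighted` (weighted AM–GM), `Finset.sum_image`. Searched
`lean search 'rpow_sub_rpow.*max|gramKernel|zeta.*Kato'`: nothing (the tree's (3.7)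
`abs_rpow_sqrt_sub_rpow_sqrt_le` has `s2^s(|k−l|^{s−1}+|l|^{s−1})` in place of MPP's `max`).

## References

* T. Kato, *Nonstationary flows of viscous and ideal fluids in `ℝ³`*, J. Funct. Anal. 9 (1972)
  296–305 (the commutator estimate). [Kato1972]
* C. Morosi, L. Pizzocchero, *On the constants in a Kato inequality for the Euler and
  Navier–Stokes equations*, Commun. Pure Appl. Anal. 11 (2012) 557–586 (arXiv:1009.2051),
  Abstract / (1.x): the Kato inequality `|⟨v·∂w|w⟩_n| ≤ G_n‖v‖_n‖w‖_n²`. [MorosiPizzocchero2012Kato]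
* C. Morosi, L. Pizzocchero, *On approximate solutions of the incompressible Euler and
  Navier–Stokes equations*, Nonlinear Anal. 75 (2012) 2209–2235 (arXiv:1104.3832), (katineq) and
  Lemma 4.2 / Prop. 4.3. [MorosiPizzocchero2012Approx]
* C. Morosi, L. Pizzocchero, *On the constants in a basic inequality for the Euler and
  Navier–Stokes equations*, Appl. Math. Lett. 26 (2013) 277–284 (extended version
  arXiv:1007.4412), Def. 3.5 (`𝒦_n`), Prop. 3.7 (`K'_n ≤ K_n⁺`), §4 (held: paper:arxiv-1007.4412,
  pp. 5–6, 8). [MorosiPizzocchero2013Basic]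
* C. Morosi, M. Pernici, L. Pizzocchero, *New results on the constants in some inequalities for
  the Navier–Stokes quadratic nonlinearity*, Appl. Math. Comput. 308 (2017) 54–72
  (arXiv:1511.00533), Prop. 3.1 (`sup 𝒦_{pn} ≤ 2^{2p+2}ζ_{2n}`), Thm. 3.3, Cor. 3.4, Lemma 4.1,
  Prop. 4.2 (`sup 𝒢_{pn} ≤ 2^{2p}p²ζ_{2n−2}`), Thm. 4.4, Cor. 4.5, Lemma 5.3, Remark 5.4 (5.9)
  (held: paper:arxiv-1511.00533, pp. 6–11).
  [MorosiPerniciPizzocchero2017]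
* J. C. Robinson, W. Sadowski, R. P. Silva, J. Math. Phys. 53 (2012) 115618, §III (3.6)–(3.7).
  [RobinsonSadowskiSilva2012]
-/

noncomputable section

open MeasureTheory Set Filter UnitAddTorus Function Finset
open scoped Topology BigOperators InnerProductSpace ComplexConjugate

namespace Literature.Analysis.FluidPDE

namespace NSSobolev

open Literature.Analysis.FunctionSpaces Literature.Analysis.FunctionSpaces.Torus NSGevrey

variable {d : Type*} [Fintype d] [DecidableEq d]

variable {v w : UnitAddTorus d → EuclideanSpace ℝ d}

omit [Fintype d] [DecidableEq d] in
/-- Summability over `ℤ^n × ℤ^n` of `(k, l) ↦ α_k β_l δ_{k−l}` for nonnegative `α, β ∈ ℓ¹` and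
bounded `δ` (the private helper of `TorusNSSobolevCommutator`, re-proved). [folklore] -/
private theorem kp_summable_prod_mul_mul_sub {α β δ : (d → ℤ) → ℝ} (hα0 : ∀ k, 0 ≤ α k)
    (hβ0 : ∀ l, 0 ≤ β l) (hδ0 : ∀ m, 0 ≤ δ m) (hα : Summable α) (hβ : Summable β) {D : ℝ}
    (hδ : ∀ m, δ m ≤ D) :
    Summable fun q : (d → ℤ) × (d → ℤ) => α q.1 * (β q.2 * δ (q.1 - q.2)) := by
  have h0 : ∀ q : (d → ℤ) × (d → ℤ), 0 ≤ α q.1 * (β q.2 * δ (q.1 - q.2)) := fun q =>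
    mul_nonneg (hα0 _) (mul_nonneg (hβ0 _) (hδ0 _))
  have hle : ∀ k l, α k * (β l * δ (k - l)) ≤ α k * D * β l := fun k l => by
    calc α k * (β l * δ (k - l)) ≤ α k * (β l * D) :=
          mul_le_mul_of_nonneg_left (mul_le_mul_of_nonneg_left (hδ _) (hβ0 l)) (hα0 k)
      _ = α k * D * β l := by ring
  have hfib : ∀ k, Summable fun l => α k * (β l * δ (k - l)) := fun k =>
    (hβ.mul_left (α k * D)).of_nonneg_of_le (fun l => h0 (k, l)) (hle k)
  refine (summable_prod_of_nonneg fun q => h0 q).2 ⟨hfib, ?_⟩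
  refine (hα.mul_right (D * ∑' l, β l)).of_nonneg_of_le (fun k => tsum_nonneg fun l => h0 (k, l))
    fun k => ?_
  calc ∑' l, α k * (β l * δ (k - l)) ≤ ∑' l, α k * D * β l :=
        (hfib k).tsum_le_tsum (hle k) (hβ.mul_left _)
    _ = α k * (D * ∑' l, β l) := by rw [tsum_mul_left]; ring

/-- Rapid decay gives `∑_m |m|^{2t} ‖f̂(m)‖ < ∞` for every `t ≥ 0` (smooth `f`). [folklore] -/
private theorem kp_summable_rpow_mul_norm {f : UnitAddTorus d → EuclideanSpace ℝ d}
    (hf : IsSmooth f) {t : ℝ} (ht : 0 ≤ t) :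
    Summable fun m : d → ℤ => freqNormSq m ^ t * ‖mFourierCoeff (EuclideanSpace.complexify ∘ f) m‖ := by
  have hRD := hf.complexify_comp.rapidDecay_mFourierCoeff
  obtain ⟨N, hN⟩ := exists_nat_ge t
  refine (hRD N).of_nonneg_of_le (fun m => mul_nonneg (Real.rpow_nonneg (freqNormSq_nonneg m) _)
    (norm_nonneg _)) fun m => ?_
  refine mul_le_mul_of_nonneg_right ?_ (norm_nonneg _)
  calc freqNormSq m ^ t ≤ (1 + freqNormSq m) ^ t :=
        Real.rpow_le_rpow (freqNormSq_nonneg m) (by linarith) ht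
    _ ≤ (1 + freqNormSq m) ^ (N : ℝ) :=
        Real.rpow_le_rpow_of_exponent_le (by linarith [freqNormSq_nonneg m]) hN
    _ = (1 + freqNormSq m) ^ N := Real.rpow_natCast _ _

/-- **Kato's commutator inequality, pair form, on the lattice (Kato 1972; Morosi–Pizzocchero 2012
"Kato inequality" `|⟨v·∂w|w⟩_n| ≤ G_n‖v‖_n‖w‖_n²`; proof = Robinson–Sadowski–Silva 2012 §III
(3.6)–(3.7) for a pair).** For smooth real fields `v, w` on `T^n` with `div v = 0`, and `s ≥ 1`:
`|∑_k |k|^{2s} Re⟪𝓕((v·∇)w)(k), ŵ(k)⟫| ≤ 2π n s 2^s (X_v^{1/2} F₁(w) + F₁(v) X_w^{1/2}) X_w^{1/2}`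
with `X_f = ∑_k |k|^{2s}‖f̂(k)‖²` and `F₁(f) = ∑_k |k|‖f̂(k)‖` (`|k|^{2t} = (freqNormSq k)^t`).
The left-hand side is the `v`-advection term in `½ d/dt ‖w‖²_{Ḣ^s}`. With `ŵ_s(k) = |k|^s ŵ(k)`
the cancellation `NSSobolev.re_tsum_tsum_latticeConvect_eq_zero` (transversality of `v̂` only)
removes `Re ∑∑ (2πi ∑ l_j v̂_j(k−l)) ⟪ŵ_s(k), ŵ_s(l)⟫`, leaving the commutator
`|k|^s(|k|^s − |l|^s)`, bounded by (3.7); the two resulting convolutions are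
`∑_k |k|^s‖ŵ_k‖ (|·|‖ŵ‖ ∗ |·|^s‖v̂‖)(k) ≤ F₁(w) X_v^{1/2} X_w^{1/2}` and
`∑_k |k|^s‖ŵ_k‖ (|·|^s‖ŵ‖ ∗ |·|‖v̂‖)(k) ≤ F₁(v) X_w` (Young `ℓ¹ ∗ ℓ² ⊂ ℓ²`).
[cite: MorosiPizzocchero2012Kato, Abstract (the Kato inequality); RobinsonSadowskiSilva2012, §III (3.6)–(3.7); Kato1972] -/
theorem abs_tsum_rpow_mul_re_inner_convect_pair_le (hv : IsSmooth v) (hdiv : IsDivFree v)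
    (hw : IsSmooth w) {s : ℝ} (hs : 1 ≤ s) :
    |∑' k : d → ℤ, freqNormSq k ^ s *
        (inner ℂ (mFourierCoeff (EuclideanSpace.complexify ∘ Torus.convect v w) k)
          (mFourierCoeff (EuclideanSpace.complexify ∘ w) k)).re| ≤
      2 * Real.pi * (Fintype.card d : ℝ) * (s * (2 : ℝ) ^ s) *
        (Real.sqrt (∑' k : d → ℤ, freqNormSq k ^ s *
            ‖mFourierCoeff (EuclideanSpace.complexify ∘ v) k‖ ^ 2) *
          (∑' k : d → ℤ, Real.sqrt (freqNormSq k) *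
            ‖mFourierCoeff (EuclideanSpace.complexify ∘ w) k‖) +
          (∑' k : d → ℤ, Real.sqrt (freqNormSq k) *
            ‖mFourierCoeff (EuclideanSpace.complexify ∘ v) k‖) *
          Real.sqrt (∑' k : d → ℤ, freqNormSq k ^ s *
            ‖mFourierCoeff (EuclideanSpace.complexify ∘ w) k‖ ^ 2)) *
        Real.sqrt (∑' k : d → ℤ, freqNormSq k ^ s *
            ‖mFourierCoeff (EuclideanSpace.complexify ∘ w) k‖ ^ 2) := by
  classical
  set V : (d → ℤ) → EuclideanSpace ℂ d := fun m => mFourierCoeff (EuclideanSpace.complexify ∘ v) m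
    with hVdef
  set U : (d → ℤ) → EuclideanSpace ℂ d := fun m => mFourierCoeff (EuclideanSpace.complexify ∘ w) m
    with hUdef
  -- ### weights and their summability
  set a : (d → ℤ) → ℝ := fun m => ‖U m‖ with ha
  set aV : (d → ℤ) → ℝ := fun m => ‖V m‖ with haV
  set r : (d → ℤ) → ℝ := fun m => Real.sqrt (freqNormSq m) with hr
  set ρ : (d → ℤ) → ℝ := fun m => freqNormSq m ^ (s / 2) with hρ
  set ρ₁ : (d → ℤ) → ℝ := fun m => freqNormSq m ^ ((s - 1) / 2) with hρ₁
  set b : (d → ℤ) → ℝ := fun m => ρ m * a m with hb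
  set bV : (d → ℤ) → ℝ := fun m => ρ m * aV m with hbV
  set a₁ : (d → ℤ) → ℝ := fun m => r m * a m with ha₁
  set a₁V : (d → ℤ) → ℝ := fun m => r m * aV m with ha₁V
  have ha0 : ∀ m, 0 ≤ a m := fun m => norm_nonneg _
  have haV0 : ∀ m, 0 ≤ aV m := fun m => norm_nonneg _
  have hr0 : ∀ m, 0 ≤ r m := fun m => Real.sqrt_nonneg _
  have hρ0 : ∀ m, 0 ≤ ρ m := fun m => Real.rpow_nonneg (freqNormSq_nonneg m) _
  have hρ₁0 : ∀ m, 0 ≤ ρ₁ m := fun m => Real.rpow_nonneg (freqNormSq_nonneg m) _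
  have hb0 : ∀ m, 0 ≤ b m := fun m => mul_nonneg (hρ0 m) (ha0 m)
  have hbV0 : ∀ m, 0 ≤ bV m := fun m => mul_nonneg (hρ0 m) (haV0 m)
  have ha₁0 : ∀ m, 0 ≤ a₁ m := fun m => mul_nonneg (hr0 m) (ha0 m)
  have ha₁V0 : ∀ m, 0 ≤ a₁V m := fun m => mul_nonneg (hr0 m) (haV0 m)
  have has : Summable a := hw.complexify_comp.rapidDecay_mFourierCoeff.summable_norm
  have haVs : Summable aV := hv.complexify_comp.rapidDecay_mFourierCoeff.summable_norm
  have hpow : ∀ {t : ℝ}, 0 ≤ t → Summable fun m : d → ℤ => freqNormSq m ^ t * a m :=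
    fun ht => kp_summable_rpow_mul_norm hw ht
  have hpowV : ∀ {t : ℝ}, 0 ≤ t → Summable fun m : d → ℤ => freqNormSq m ^ t * aV m :=
    fun ht => kp_summable_rpow_mul_norm hv ht
  have hr_eq : ∀ m, r m = freqNormSq m ^ (1 / 2 : ℝ) := fun m => Real.sqrt_eq_rpow _
  have hrρ₁ : ∀ m, r m * ρ₁ m = ρ m := fun m => by
    rw [hr_eq, hρ₁, hρ]
    simp only
    rw [← Real.rpow_add' (freqNormSq_nonneg m) (by linarith : (1 / 2 : ℝ) + (s - 1) / 2 ≠ 0)]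
    congr 1
    ring
  have hρsq : ∀ m, ρ m * ρ m = freqNormSq m ^ s := fun m => by
    rw [hρ]
    simp only
    rw [← Real.rpow_add' (freqNormSq_nonneg m) (by linarith : s / 2 + s / 2 ≠ 0)]
    congr 1
    ring
  have hbs : Summable b := (hpow (by linarith : (0 : ℝ) ≤ s / 2)).congr fun m => by
    simp only [hb, hρ]
  have hbVs : Summable bV := (hpowV (by linarith : (0 : ℝ) ≤ s / 2)).congr fun m => by
    simp only [hbV, hρ]
  have ha₁s : Summable a₁ := (hpow (by norm_num : (0 : ℝ) ≤ 1 / 2)).congr fun m => by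
    simp only [ha₁, hr_eq]
  have ha₁Vs : Summable a₁V := (hpowV (by norm_num : (0 : ℝ) ≤ 1 / 2)).congr fun m => by
    simp only [ha₁V, hr_eq]
  have hrbs : Summable fun m => r m * b m :=
    (hpow (by linarith : (0 : ℝ) ≤ (s + 1) / 2)).congr fun m => by
      simp only [hb, hr_eq, hρ]
      rw [← mul_assoc, ← Real.rpow_add' (freqNormSq_nonneg m)
        (by linarith : (1 / 2 : ℝ) + s / 2 ≠ 0)]
      congr 2
      ring
  have hb2 : ∀ m, b m ^ 2 = freqNormSq m ^ s * ‖U m‖ ^ 2 := fun m => by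
    simp only [hb, ha]
    rw [mul_pow, sq, hρsq]
  have hbV2 : ∀ m, bV m ^ 2 = freqNormSq m ^ s * ‖V m‖ ^ 2 := fun m => by
    simp only [hbV, haV]
    rw [mul_pow, sq, hρsq]
  have hb2s : Summable fun m => b m ^ 2 :=
    (hw.summable_freqNormSq_rpow_mul_norm_sq (by linarith : (0 : ℝ) ≤ s)).congr
      fun m => (hb2 m).symm
  have hbV2s : Summable fun m => bV m ^ 2 :=
    (hv.summable_freqNormSq_rpow_mul_norm_sq (by linarith : (0 : ℝ) ≤ s)).congr
      fun m => (hbV2 m).symm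
  set X : ℝ := ∑' k, freqNormSq k ^ s * ‖U k‖ ^ 2 with hX
  set XV : ℝ := ∑' k, freqNormSq k ^ s * ‖V k‖ ^ 2 with hXV
  set F₁ : ℝ := ∑' k, r k * a k with hF₁
  set F₁V : ℝ := ∑' k, r k * aV k with hF₁V
  have hXb : ∑' m, b m ^ 2 = X := tsum_congr hb2
  have hXVb : ∑' m, bV m ^ 2 = XV := tsum_congr hbV2
  have hX0 : 0 ≤ X := by rw [← hXb]; exact tsum_nonneg fun m => sq_nonneg _
  have hXV0 : 0 ≤ XV := by rw [← hXVb]; exact tsum_nonneg fun m => sq_nonneg _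
  have hF₁0 : 0 ≤ F₁ := tsum_nonneg fun m => ha₁0 m
  have hF₁V0 : 0 ≤ F₁V := tsum_nonneg fun m => ha₁V0 m
  -- bounds `aV ≤ AV`, `b ≤ B₀`, `bV ≤ BV₀`, `a₁ ≤ F₁`, `a₁V ≤ F₁V`
  have hAVle : ∀ m, aV m ≤ ∑' j, aV j := fun m => haVs.le_tsum m fun j _ => haV0 j
  have hBle : ∀ m, b m ≤ ∑' j, b j := fun m => hbs.le_tsum m fun j _ => hb0 j
  have hBVle : ∀ m, bV m ≤ ∑' j, bV j := fun m => hbVs.le_tsum m fun j _ => hbV0 j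
  have hA₁le : ∀ m, a₁ m ≤ F₁ := fun m => ha₁s.le_tsum m fun j _ => ha₁0 j
  have hA₁Vle : ∀ m, a₁V m ≤ F₁V := fun m => ha₁Vs.le_tsum m fun j _ => ha₁V0 j
  -- ### the pieces on `ℤ^n × ℤ^n`
  set W : (d → ℤ) → EuclideanSpace ℂ d := fun k => (ρ k : ℂ) • U k with hW
  have hWn : ∀ k, ‖W k‖ = b k := fun k => by
    simp only [hW, hb, ha]
    rw [norm_smul, Complex.norm_real, Real.norm_of_nonneg (hρ0 k)]
  set c : (d → ℤ) → (d → ℤ) → ℂ := fun k l =>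
    2 * Real.pi * Complex.I * ∑ j, ((l j : ℤ) : ℂ) * V (k - l) j with hc
  set Φ : (d → ℤ) × (d → ℤ) → ℂ := fun q =>
    (2 * Real.pi * Complex.I * ∑ j, ((q.2 j : ℤ) : ℂ) * V (q.1 - q.2) j) *
      inner ℂ (W q.1) (W q.2) with hΦ
  set E : (d → ℤ) × (d → ℤ) → ℂ := fun q =>
    c q.1 q.2 * (((ρ q.1 * (ρ q.1 - ρ q.2) : ℝ)) : ℂ) * inner ℂ (U q.1) (U q.2) with hE
  set C : ℝ := 2 * Real.pi * (Fintype.card d : ℝ) * (s * (2 : ℝ) ^ s) with hC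
  have hC0 : 0 ≤ C := by positivity
  set G : (d → ℤ) × (d → ℤ) → ℝ := fun q =>
    C * (b q.1 * (a₁ q.2 * bV (q.1 - q.2)) + b q.1 * (b q.2 * a₁V (q.1 - q.2))) with hG
  -- `|c k l| ≤ 2π n |l| ‖v̂(k−l)‖`
  have h2π : ‖(2 * Real.pi * Complex.I : ℂ)‖ = 2 * Real.pi := by simp [abs_of_pos Real.pi_pos]
  have hcle : ∀ k l, ‖c k l‖ ≤ 2 * Real.pi * (Fintype.card d : ℝ) * (r l * aV (k - l)) := by
    intro k l
    simp only [hc]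
    rw [norm_mul, h2π]
    have h1 : ‖∑ j, ((l j : ℤ) : ℂ) * V (k - l) j‖ ≤ (Fintype.card d : ℝ) * (r l * aV (k - l)) := by
      refine (norm_sum_le _ _).trans ?_
      calc ∑ j, ‖((l j : ℤ) : ℂ) * V (k - l) j‖ ≤ ∑ _j : d, r l * aV (k - l) :=
            Finset.sum_le_sum fun j _ => by
              rw [norm_mul, Complex.norm_intCast]
              exact mul_le_mul (abs_apply_le_sqrt_freqNormSq l j)
                (PiLp.norm_apply_le (V (k - l)) j) (norm_nonneg _) (Real.sqrt_nonneg _)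
        _ = (Fintype.card d : ℝ) * (r l * aV (k - l)) := by
            rw [Finset.sum_const, Finset.card_univ, nsmul_eq_mul]
    calc 2 * Real.pi * ‖∑ j, ((l j : ℤ) : ℂ) * V (k - l) j‖
        ≤ 2 * Real.pi * ((Fintype.card d : ℝ) * (r l * aV (k - l))) :=
          mul_le_mul_of_nonneg_left h1 (by positivity)
      _ = 2 * Real.pi * (Fintype.card d : ℝ) * (r l * aV (k - l)) := by ring
  -- `‖E(k,l)‖ ≤ G(k,l)`
  have hEle : ∀ q : (d → ℤ) × (d → ℤ), ‖E q‖ ≤ G q := by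
    rintro ⟨k, l⟩
    simp only [hE, hG]
    rw [norm_mul, norm_mul, Complex.norm_real, Real.norm_eq_abs, abs_mul, abs_of_nonneg (hρ0 k)]
    have h1 := hcle k l
    have h2 : |ρ k - ρ l| ≤ s * (2 : ℝ) ^ s * r (k - l) * (ρ₁ (k - l) + ρ₁ l) :=
      abs_rpow_sqrt_sub_rpow_sqrt_le hs k l
    have h3 : ‖inner ℂ (U k) (U l)‖ ≤ a k * a l := norm_inner_le_norm _ _
    have hn1 : 0 ≤ ρ k * |ρ k - ρ l| := mul_nonneg (hρ0 k) (abs_nonneg _)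
    have hn2 : 0 ≤ 2 * Real.pi * (Fintype.card d : ℝ) * (r l * aV (k - l)) := by
      have := hr0 l; have := haV0 (k - l); positivity
    have hn3 : 0 ≤ (2 * Real.pi * (Fintype.card d : ℝ) * (r l * aV (k - l))) *
        (ρ k * (s * (2 : ℝ) ^ s * r (k - l) * (ρ₁ (k - l) + ρ₁ l))) := by
      have := hr0 (k - l); have := hρ₁0 (k - l); have := hρ₁0 l; have := hρ0 k
      have : (0 : ℝ) ≤ s := by linarith
      positivity
    have h4 : ‖c k l‖ * (ρ k * |ρ k - ρ l|) * ‖inner ℂ (U k) (U l)‖ ≤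
        (2 * Real.pi * (Fintype.card d : ℝ) * (r l * aV (k - l))) *
          (ρ k * (s * (2 : ℝ) ^ s * r (k - l) * (ρ₁ (k - l) + ρ₁ l))) * (a k * a l) :=
      mul_le_mul (mul_le_mul h1 (mul_le_mul_of_nonneg_left h2 (hρ0 k)) hn1 hn2) h3
        (norm_nonneg _) hn3
    refine h4.trans (le_of_eq ?_)
    -- `r·ρ₁ = ρ`, and regrouping into `b`, `bV`, `a₁`, `a₁V`
    have e1 : r (k - l) * ρ₁ (k - l) = ρ (k - l) := hrρ₁ (k - l)
    have e2 : r l * ρ₁ l = ρ l := hrρ₁ l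
    simp only [hb, hbV, ha₁, ha₁V, hC]
    rw [← e1, ← e2]
    ring
  -- summability over pairs
  have hG0 : ∀ q : (d → ℤ) × (d → ℤ), 0 ≤ G q := fun q =>
    mul_nonneg hC0 (add_nonneg (mul_nonneg (hb0 _) (mul_nonneg (ha₁0 _) (hbV0 _)))
      (mul_nonneg (hb0 _) (mul_nonneg (hb0 _) (ha₁V0 _))))
  have hGs : Summable G := by
    have h1 := kp_summable_prod_mul_mul_sub hb0 ha₁0 hbV0 hbs ha₁s hBVle
    have h2 := kp_summable_prod_mul_mul_sub hb0 hb0 ha₁V0 hbs hbs hA₁Vle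
    exact ((h1.add h2).mul_left C).congr fun q => by simp only [hG]
  have hEs : Summable E := Summable.of_norm_bounded hGs hEle
  have hΦsum : Summable fun q : (d → ℤ) × (d → ℤ) =>
      ‖W q.1‖ * ((Real.sqrt (freqNormSq q.2) * ‖W q.2‖) * ‖V (q.1 - q.2)‖) := by
    have h1 := kp_summable_prod_mul_mul_sub hb0 (fun l => mul_nonneg (hr0 l) (hb0 l)) haV0 hbs hrbs
      hAVle
    exact h1.congr fun q => by simp only [hWn, hr, haV]
  have hΦs : Summable Φ := by
    have hΦle : ∀ q : (d → ℤ) × (d → ℤ), ‖Φ q‖ ≤ 2 * Real.pi * (Fintype.card d : ℝ) *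
        (‖W q.1‖ * ((Real.sqrt (freqNormSq q.2) * ‖W q.2‖) * ‖V (q.1 - q.2)‖)) := by
      rintro ⟨k, l⟩
      simp only [hΦ]
      rw [norm_mul]
      have h1 := hcle k l
      have h2 : ‖inner ℂ (W k) (W l)‖ ≤ ‖W k‖ * ‖W l‖ := norm_inner_le_norm _ _
      calc ‖c k l‖ * ‖inner ℂ (W k) (W l)‖
          ≤ (2 * Real.pi * (Fintype.card d : ℝ) * (r l * aV (k - l))) * (‖W k‖ * ‖W l‖) :=
            mul_le_mul h1 h2 (norm_nonneg _) (by positivity)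
        _ = 2 * Real.pi * (Fintype.card d : ℝ) * (‖W k‖ * ((r l * ‖W l‖) * aV (k - l))) := by ring
    exact Summable.of_norm_bounded (hΦsum.mul_left _) hΦle
  -- ### the convective coefficient as a series in `l = k − m`
  have hB : ∀ k p, mFourierCoeff (EuclideanSpace.complexify ∘ Torus.convect v w) k p =
      ∑' l, c k l * U l p := by
    intro k p
    rw [mFourierCoeff_convect_apply_eq_tsum hv hw k p,
      ← (Equiv.subLeft k).tsum_eq (fun m => (2 * Real.pi * Complex.I *
        ∑ j, (((k - m) j : ℤ) : ℂ) * V m j) * U (k - m) p)]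
    refine tsum_congr fun l => ?_
    simp only [Equiv.subLeft_apply, sub_sub_cancel, hc]
  -- the inner product `⟪ŵ(k), 𝓕((v·∇)w)(k)⟫ = ∑_l c(k,l) ⟪ŵ(k), ŵ(l)⟫`
  have hcUs : ∀ k p, Summable fun l => c k l * U l p := by
    intro k p
    refine Summable.of_norm_bounded ((ha₁s.mul_left (2 * Real.pi * (Fintype.card d : ℝ) *
      ∑' j, aV j))) fun l => ?_
    rw [norm_mul]
    calc ‖c k l‖ * ‖U l p‖ ≤ (2 * Real.pi * (Fintype.card d : ℝ) * (r l * aV (k - l))) * a l :=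
          mul_le_mul (hcle k l) (PiLp.norm_apply_le (U l) p) (norm_nonneg _) (by positivity)
      _ ≤ (2 * Real.pi * (Fintype.card d : ℝ) * (r l * ∑' j, aV j)) * a l := by
          gcongr
          exact hAVle (k - l)
      _ = 2 * Real.pi * (Fintype.card d : ℝ) * (∑' j, aV j) * (r l * a l) := by ring
  have hinner : ∀ k, inner ℂ (U k) (mFourierCoeff (EuclideanSpace.complexify ∘ Torus.convect v w) k) =
      ∑' l, c k l * inner ℂ (U k) (U l) := by
    intro k
    rw [PiLp.inner_apply]
    simp_rw [RCLike.inner_apply', hB k]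
    rw [show (∑ p, conj (U k p) * ∑' l, c k l * U l p) = ∑ p, ∑' l, conj (U k p) * (c k l * U l p)
      from Finset.sum_congr rfl fun p _ => (tsum_mul_left).symm]
    rw [← Summable.tsum_finsetSum fun p _ => (hcUs k p).mul_left _]
    refine tsum_congr fun l => ?_
    rw [PiLp.inner_apply, Finset.mul_sum]
    exact Finset.sum_congr rfl fun p _ => by rw [RCLike.inner_apply']; ring
  -- ### the termwise splitting `|k|^{2s} Re⟪B̂(k), ŵ(k)⟫ = Re ∑_l E(k,l) + Re ∑_l Φ(k,l)`
  have hEfib : ∀ k, Summable fun l => E (k, l) := fun k => hEs.prod_factor k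
  have hΦfib : ∀ k, Summable fun l => Φ (k, l) := fun k => hΦs.prod_factor k
  have hsplit : ∀ k, freqNormSq k ^ s *
      (inner ℂ (mFourierCoeff (EuclideanSpace.complexify ∘ Torus.convect v w) k) (U k)).re =
      (∑' l, E (k, l)).re + (∑' l, Φ (k, l)).re := by
    intro k
    have hsym : (inner ℂ (mFourierCoeff (EuclideanSpace.complexify ∘ Torus.convect v w) k)
        (U k)).re = (inner ℂ (U k)
          (mFourierCoeff (EuclideanSpace.complexify ∘ Torus.convect v w) k)).re := by
      rw [← inner_conj_symm, Complex.conj_re]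
    rw [hsym, hinner k, ← Complex.re_ofReal_mul, ← Complex.add_re,
      ← (hEfib k).tsum_add (hΦfib k), ← tsum_mul_left]
    congr 1
    refine tsum_congr fun l => ?_
    simp only [hE, hΦ, hW, hc]
    rw [inner_smul_left, inner_smul_right, Complex.conj_ofReal, ← hρsq k]
    push_cast
    ring
  -- ### summation over `k`
  have hGfib : ∀ k, Summable fun l => G (k, l) := fun k => hGs.prod_factor k
  have hEre_le : ∀ k, ‖(∑' l, E (k, l)).re‖ ≤ ∑' l, G (k, l) := fun k => by
    rw [Real.norm_eq_abs]
    calc |(∑' l, E (k, l)).re| ≤ ‖∑' l, E (k, l)‖ := Complex.abs_re_le_norm _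
      _ ≤ ∑' l, ‖E (k, l)‖ := norm_tsum_le_tsum_norm (hEfib k).norm
      _ ≤ ∑' l, G (k, l) := (hEfib k).norm.tsum_le_tsum (fun l => hEle (k, l)) (hGfib k)
  have hEre_s : Summable fun k => (∑' l, E (k, l)).re :=
    Summable.of_norm_bounded hGs.prod hEre_le
  have hΦre_s : Summable fun k => (∑' l, Φ (k, l)).re := (Complex.hasSum_re hΦs.prod.hasSum).summable
  -- the `Φ` part vanishes (cancellation; only the transversality of `v̂` is used)
  have hΦzero : ∑' k, (∑' l, Φ (k, l)).re = 0 := by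
    rw [← Complex.re_tsum hΦs.prod]
    exact re_tsum_tsum_latticeConvect_eq_zero (W := W)
      (fun m => IsDivFree.sum_mul_mFourierCoeff_eq_zero hv hdiv m)
      (isConjSymm_mFourierCoeff hv.integrable) hΦsum
  -- the `E` part is bounded by `∑ G ≤ C (F₁ √XV √X + F₁V X)`
  have hGsum_le : ∑' k, ∑' l, G (k, l) ≤
      C * (Real.sqrt XV * F₁ + F₁V * Real.sqrt X) * Real.sqrt X := by
    -- `∑_l G(k,l) = C b_k (∑_l a₁(l) bV(k−l) + ∑_l a₁V(l) b(k−l))`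
    have hconv1 : ∀ k, Summable fun l => a₁ l * bV (k - l) := fun k =>
      (ha₁s.mul_right (∑' j, bV j)).of_nonneg_of_le (fun l => mul_nonneg (ha₁0 l) (hbV0 _))
        fun l => mul_le_mul_of_nonneg_left (hBVle _) (ha₁0 l)
    have hconv2 : ∀ k, Summable fun l => a₁V l * b (k - l) := fun k =>
      (ha₁Vs.mul_right (∑' j, b j)).of_nonneg_of_le (fun l => mul_nonneg (ha₁V0 l) (hb0 _))
        fun l => mul_le_mul_of_nonneg_left (hBle _) (ha₁V0 l)
    have hre : ∀ k, ∑' l, b l * a₁V (k - l) = ∑' l, a₁V l * b (k - l) := fun k => by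
      rw [← (Equiv.subLeft k).tsum_eq (fun l => b l * a₁V (k - l))]
      refine tsum_congr fun l => ?_
      simp only [Equiv.subLeft_apply, sub_sub_cancel]
      ring
    have hconv2' : ∀ k, Summable fun l => b l * a₁V (k - l) := fun k =>
      (hbs.mul_right F₁V).of_nonneg_of_le (fun l => mul_nonneg (hb0 l) (ha₁V0 _))
        fun l => mul_le_mul_of_nonneg_left (hA₁Vle _) (hb0 l)
    have hGk : ∀ k, ∑' l, G (k, l) =
        C * (b k * ∑' l, a₁ l * bV (k - l)) + C * (b k * ∑' l, a₁V l * b (k - l)) := by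
      intro k
      simp only [hG]
      rw [tsum_mul_left, ((hconv1 k).mul_left (b k)).tsum_add ((hconv2' k).mul_left (b k)),
        tsum_mul_left, tsum_mul_left, hre k]
      ring
    have hs1 : Summable fun k => C * (b k * ∑' l, a₁ l * bV (k - l)) := by
      refine ((hbs.mul_left (C * (F₁ * ∑' j, bV j)))).of_nonneg_of_le
        (fun k => mul_nonneg hC0 (mul_nonneg (hb0 k) (tsum_nonneg fun l =>
          mul_nonneg (ha₁0 l) (hbV0 _)))) fun k => ?_
      have h1 : ∑' l, a₁ l * bV (k - l) ≤ ∑' l, a₁ l * ∑' j, bV j :=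
        (hconv1 k).tsum_le_tsum (fun l => mul_le_mul_of_nonneg_left (hBVle _) (ha₁0 l))
          (ha₁s.mul_right _)
      rw [tsum_mul_right] at h1
      calc C * (b k * ∑' l, a₁ l * bV (k - l)) ≤ C * (b k * (F₁ * ∑' j, bV j)) :=
            mul_le_mul_of_nonneg_left (mul_le_mul_of_nonneg_left h1 (hb0 k)) hC0
        _ = C * (F₁ * ∑' j, bV j) * b k := by ring
    have hs2 : Summable fun k => C * (b k * ∑' l, a₁V l * b (k - l)) := by
      refine ((hbs.mul_left (C * (F₁V * ∑' j, b j)))).of_nonneg_of_le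
        (fun k => mul_nonneg hC0 (mul_nonneg (hb0 k) (tsum_nonneg fun l =>
          mul_nonneg (ha₁V0 l) (hb0 _)))) fun k => ?_
      have h1 : ∑' l, a₁V l * b (k - l) ≤ ∑' l, a₁V l * ∑' j, b j :=
        (hconv2 k).tsum_le_tsum (fun l => mul_le_mul_of_nonneg_left (hBle _) (ha₁V0 l))
          (ha₁Vs.mul_right _)
      rw [tsum_mul_right] at h1
      calc C * (b k * ∑' l, a₁V l * b (k - l)) ≤ C * (b k * (F₁V * ∑' j, b j)) :=
            mul_le_mul_of_nonneg_left (mul_le_mul_of_nonneg_left h1 (hb0 k)) hC0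
        _ = C * (F₁V * ∑' j, b j) * b k := by ring
    rw [tsum_congr hGk, hs1.tsum_add hs2, tsum_mul_left, tsum_mul_left]
    -- finite partial sums and Young, twice
    have hK1 : ∀ K : Finset (d → ℤ), ∑ k ∈ K, b k * ∑' l, a₁ l * bV (k - l) ≤
        F₁ * Real.sqrt XV * Real.sqrt X := by
      intro K
      have hY := NSGevrey.sum_mul_tsum_mul_le K ha₁0 hbV0 hb0 ha₁s hbV2s
      have h1 : Real.sqrt (∑ k ∈ K, b k ^ 2) ≤ Real.sqrt X :=
        Real.sqrt_le_sqrt (by rw [← hXb]; exact hb2s.sum_le_tsum K fun m _ => sq_nonneg _)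
      calc ∑ k ∈ K, b k * ∑' l, a₁ l * bV (k - l)
          ≤ (∑' j, a₁ j) * Real.sqrt (∑' j, bV j ^ 2) * Real.sqrt (∑ k ∈ K, b k ^ 2) := hY
        _ ≤ F₁ * Real.sqrt XV * Real.sqrt X := by
            rw [hXVb]
            exact mul_le_mul_of_nonneg_left h1 (mul_nonneg hF₁0 (Real.sqrt_nonneg _))
    have hK2 : ∀ K : Finset (d → ℤ), ∑ k ∈ K, b k * ∑' l, a₁V l * b (k - l) ≤ F₁V * X := by
      intro K
      have hY := NSGevrey.sum_mul_tsum_mul_le K ha₁V0 hb0 hb0 ha₁Vs hb2s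
      have h1 : Real.sqrt (∑ k ∈ K, b k ^ 2) ≤ Real.sqrt X :=
        Real.sqrt_le_sqrt (by rw [← hXb]; exact hb2s.sum_le_tsum K fun m _ => sq_nonneg _)
      calc ∑ k ∈ K, b k * ∑' l, a₁V l * b (k - l)
          ≤ (∑' j, a₁V j) * Real.sqrt (∑' j, b j ^ 2) * Real.sqrt (∑ k ∈ K, b k ^ 2) := hY
        _ ≤ F₁V * Real.sqrt X * Real.sqrt X := by
            rw [hXb]
            exact mul_le_mul_of_nonneg_left h1 (mul_nonneg hF₁V0 (Real.sqrt_nonneg _))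
        _ = F₁V * X := by rw [mul_assoc, Real.mul_self_sqrt hX0]
    have htb1 : ∑' k, b k * ∑' l, a₁ l * bV (k - l) ≤ F₁ * Real.sqrt XV * Real.sqrt X :=
      Real.tsum_le_of_sum_le (fun k => mul_nonneg (hb0 k) (tsum_nonneg fun l =>
        mul_nonneg (ha₁0 l) (hbV0 _))) hK1
    have htb2 : ∑' k, b k * ∑' l, a₁V l * b (k - l) ≤ F₁V * X :=
      Real.tsum_le_of_sum_le (fun k => mul_nonneg (hb0 k) (tsum_nonneg fun l =>
        mul_nonneg (ha₁V0 l) (hb0 _))) hK2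
    have hXs : X = Real.sqrt X * Real.sqrt X := (Real.mul_self_sqrt hX0).symm
    calc C * ∑' k, b k * ∑' l, a₁ l * bV (k - l) + C * ∑' k, b k * ∑' l, a₁V l * b (k - l)
        ≤ C * (F₁ * Real.sqrt XV * Real.sqrt X) + C * (F₁V * X) :=
          add_le_add (mul_le_mul_of_nonneg_left htb1 hC0) (mul_le_mul_of_nonneg_left htb2 hC0)
      _ = C * (Real.sqrt XV * F₁ + F₁V * Real.sqrt X) * Real.sqrt X := by
          nth_rewrite 2 [hXs]
          ring
  -- ### conclusion
  rw [tsum_congr hsplit, hEre_s.tsum_add hΦre_s, hΦzero, add_zero]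
  calc |∑' k, (∑' l, E (k, l)).re| ≤ ∑' k, ‖(∑' l, E (k, l)).re‖ := by
        rw [← Real.norm_eq_abs]
        exact norm_tsum_le_tsum_norm hEre_s.norm
    _ ≤ ∑' k, ∑' l, G (k, l) := hEre_s.norm.tsum_le_tsum hEre_le hGs.prod
    _ ≤ C * (Real.sqrt XV * F₁ + F₁V * Real.sqrt X) * Real.sqrt X := hGsum_le
    _ = 2 * Real.pi * (Fintype.card d : ℝ) * (s * (2 : ℝ) ^ s) *
          (Real.sqrt XV * F₁ + F₁V * Real.sqrt X) * Real.sqrt X := by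
        simp only [hC]

/-! ### §2 The companion product estimate `(B(w,v), Λ^{2s}w)` (the difference field advects the
reference field) -/

/-- Convexity of `x ↦ x^s`, `s ≥ 1`: `(x + y)^s ≤ 2^{s−1}(x^s + y^s)` for `x, y ≥ 0`
(Mathlib `NNReal.rpow_add_le_mul_rpow_add_rpow`, transported to `ℝ`). [folklore] -/
private theorem kp_add_rpow_le {x y s : ℝ} (hx : 0 ≤ x) (hy : 0 ≤ y) (hs : 1 ≤ s) :
    (x + y) ^ s ≤ (2 : ℝ) ^ (s - 1) * (x ^ s + y ^ s) := by
  have h := NNReal.rpow_add_le_mul_rpow_add_rpow x.toNNReal y.toNNReal hs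
  have h' := NNReal.coe_le_coe.2 h
  push_cast [NNReal.coe_rpow] at h'
  rw [Real.coe_toNNReal x hx, Real.coe_toNNReal y hy] at h'
  exact h'

omit [DecidableEq d] in
/-- The lattice weight splitting behind every product estimate in `Ḣ^s`, `s ≥ 1`:
`|k|^s ≤ 2^{s−1}(|l|^s + |k − l|^s)` (triangle inequality `|k| ≤ |l| + |k − l|` and convexity),
with `|m|^s = (freqNormSq m)^{s/2}`. [folklore] -/
private theorem kp_rpow_le_two_rpow_mul_add {s : ℝ} (hs : 1 ≤ s) (k l : d → ℤ) :
    freqNormSq k ^ (s / 2) ≤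
      (2 : ℝ) ^ (s - 1) * (freqNormSq l ^ (s / 2) + freqNormSq (k - l) ^ (s / 2)) := by
  have hρ : ∀ m : d → ℤ, freqNormSq m ^ (s / 2) = Real.sqrt (freqNormSq m) ^ s := fun m => by
    rw [Real.sqrt_eq_rpow, ← Real.rpow_mul (freqNormSq_nonneg m)]
    congr 1
    ring
  rw [hρ, hρ, hρ]
  have htri : Real.sqrt (freqNormSq k) ≤ Real.sqrt (freqNormSq l) + Real.sqrt (freqNormSq (k - l)) := by
    have h := sqrt_freqNormSq_add_le l (k - l)
    rwa [add_sub_cancel] at h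
  have h0 : (0 : ℝ) ≤ s := by linarith
  calc Real.sqrt (freqNormSq k) ^ s
      ≤ (Real.sqrt (freqNormSq l) + Real.sqrt (freqNormSq (k - l))) ^ s :=
        Real.rpow_le_rpow (Real.sqrt_nonneg _) htri h0
    _ ≤ (2 : ℝ) ^ (s - 1) * (Real.sqrt (freqNormSq l) ^ s + Real.sqrt (freqNormSq (k - l)) ^ s) :=
        kp_add_rpow_le (Real.sqrt_nonneg _) (Real.sqrt_nonneg _) hs

/-- **The product ('basic') estimate for the transport of the reference field by the difference
field, lattice form (Morosi–Pizzocchero 2012, the 'basic inequality'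
`‖𝒫(w, v)‖_n ≤ K_n‖w‖_n‖v‖_{n+1}` paired with `w`; Kato 1972).** For smooth real fields `w, v` on
`T^n` and `s ≥ 1`:
`|∑_k |k|^{2s} Re⟪𝓕((w·∇)v)(k), ŵ(k)⟫| ≤ 2π n 2^{s−1} (F₀(w) X'_v^{1/2} + F₁(v) X_w^{1/2}) X_w^{1/2}`,
`X_w = ∑|k|^{2s}‖ŵ(k)‖²`, `X'_v = ∑|k|^{2s+2}‖v̂(k)‖²` (`= ‖v‖²_{Ḣ^{s+1}}` up to `(2π)`'s),
`F₀(w) = ∑‖ŵ(k)‖`, `F₁(v) = ∑|k|‖v̂(k)‖`. No divergence condition is needed: there is no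
cancellation here, only `𝓕((w·∇)v)(k) = ∑_l (2πi ∑_j l_j ŵ_j(k−l)) v̂(l)`, the weight splitting
`|k|^s ≤ 2^{s−1}(|l|^s + |k−l|^s)` and Young `ℓ¹ ∗ ℓ² ⊂ ℓ²` twice. Together with
`NSSobolev.abs_tsum_rpow_mul_re_inner_convect_pair_le` and the tree's (3.6) this bounds all three
nonlinear terms of the `Ḣ^s` balance of the difference `w = u − u_a` of a solution and an
approximate solution (Morosi–Pizzocchero, Nonlinear Anal. 75 (2012), Lemma 4.2).
[cite: MorosiPizzocchero2012Approx, (basineq)–(katineq) with Lemma 4.2; MorosiPizzocchero2012Kato, Abstract; Kato1972] -/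
theorem abs_tsum_rpow_mul_re_inner_convect_transport_le (hw : IsSmooth w) (hv : IsSmooth v)
    {s : ℝ} (hs : 1 ≤ s) :
    |∑' k : d → ℤ, freqNormSq k ^ s *
        (inner ℂ (mFourierCoeff (EuclideanSpace.complexify ∘ Torus.convect w v) k)
          (mFourierCoeff (EuclideanSpace.complexify ∘ w) k)).re| ≤
      2 * Real.pi * (Fintype.card d : ℝ) * (2 : ℝ) ^ (s - 1) *
        ((∑' k : d → ℤ, ‖mFourierCoeff (EuclideanSpace.complexify ∘ w) k‖) *
          Real.sqrt (∑' k : d → ℤ, freqNormSq k ^ (s + 1) *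
            ‖mFourierCoeff (EuclideanSpace.complexify ∘ v) k‖ ^ 2) +
          (∑' k : d → ℤ, Real.sqrt (freqNormSq k) *
            ‖mFourierCoeff (EuclideanSpace.complexify ∘ v) k‖) *
          Real.sqrt (∑' k : d → ℤ, freqNormSq k ^ s *
            ‖mFourierCoeff (EuclideanSpace.complexify ∘ w) k‖ ^ 2)) *
        Real.sqrt (∑' k : d → ℤ, freqNormSq k ^ s *
            ‖mFourierCoeff (EuclideanSpace.complexify ∘ w) k‖ ^ 2) := by
  classical
  set V : (d → ℤ) → EuclideanSpace ℂ d := fun m => mFourierCoeff (EuclideanSpace.complexify ∘ v) m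
    with hVdef
  set A : (d → ℤ) → EuclideanSpace ℂ d := fun m => mFourierCoeff (EuclideanSpace.complexify ∘ w) m
    with hAdef
  -- ### weights and their summability
  set a : (d → ℤ) → ℝ := fun m => ‖A m‖ with ha
  set aV : (d → ℤ) → ℝ := fun m => ‖V m‖ with haV
  set r : (d → ℤ) → ℝ := fun m => Real.sqrt (freqNormSq m) with hr
  set ρ : (d → ℤ) → ℝ := fun m => freqNormSq m ^ (s / 2) with hρ
  set b : (d → ℤ) → ℝ := fun m => ρ m * a m with hb
  set bV' : (d → ℤ) → ℝ := fun m => ρ m * (r m * aV m) with hbV'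
  set a₁V : (d → ℤ) → ℝ := fun m => r m * aV m with ha₁V
  have ha0 : ∀ m, 0 ≤ a m := fun m => norm_nonneg _
  have haV0 : ∀ m, 0 ≤ aV m := fun m => norm_nonneg _
  have hr0 : ∀ m, 0 ≤ r m := fun m => Real.sqrt_nonneg _
  have hρ0 : ∀ m, 0 ≤ ρ m := fun m => Real.rpow_nonneg (freqNormSq_nonneg m) _
  have hb0 : ∀ m, 0 ≤ b m := fun m => mul_nonneg (hρ0 m) (ha0 m)
  have ha₁V0 : ∀ m, 0 ≤ a₁V m := fun m => mul_nonneg (hr0 m) (haV0 m)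
  have hbV'0 : ∀ m, 0 ≤ bV' m := fun m => mul_nonneg (hρ0 m) (ha₁V0 m)
  have has : Summable a := hw.complexify_comp.rapidDecay_mFourierCoeff.summable_norm
  have hpow : ∀ {t : ℝ}, 0 ≤ t → Summable fun m : d → ℤ => freqNormSq m ^ t * a m :=
    fun ht => kp_summable_rpow_mul_norm hw ht
  have hpowV : ∀ {t : ℝ}, 0 ≤ t → Summable fun m : d → ℤ => freqNormSq m ^ t * aV m :=
    fun ht => kp_summable_rpow_mul_norm hv ht
  have hr_eq : ∀ m, r m = freqNormSq m ^ (1 / 2 : ℝ) := fun m => Real.sqrt_eq_rpow _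
  have hρsq : ∀ m, ρ m * ρ m = freqNormSq m ^ s := fun m => by
    rw [hρ]
    simp only
    rw [← Real.rpow_add' (freqNormSq_nonneg m) (by linarith : s / 2 + s / 2 ≠ 0)]
    congr 1
    ring
  have hρr : ∀ m, ρ m * r m = freqNormSq m ^ ((s + 1) / 2) := fun m => by
    rw [hρ, hr_eq]
    simp only
    rw [← Real.rpow_add' (freqNormSq_nonneg m) (by linarith : s / 2 + 1 / 2 ≠ 0)]
    congr 1
    ring
  have hbs : Summable b := (hpow (by linarith : (0 : ℝ) ≤ s / 2)).congr fun m => by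
    simp only [hb, hρ]
  have ha₁Vs : Summable a₁V := (hpowV (by norm_num : (0 : ℝ) ≤ 1 / 2)).congr fun m => by
    simp only [ha₁V, hr_eq]
  have hbV's : Summable bV' := (hpowV (by linarith : (0 : ℝ) ≤ (s + 1) / 2)).congr fun m => by
    simp only [hbV']
    rw [← mul_assoc, hρr]
  have hb2 : ∀ m, b m ^ 2 = freqNormSq m ^ s * ‖A m‖ ^ 2 := fun m => by
    simp only [hb, ha]
    rw [mul_pow, sq, hρsq]
  have hbV'2 : ∀ m, bV' m ^ 2 = freqNormSq m ^ (s + 1) * ‖V m‖ ^ 2 := fun m => by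
    simp only [hbV', haV]
    rw [← mul_assoc, mul_pow, sq (ρ m * r m), hρr,
      ← Real.rpow_add' (freqNormSq_nonneg m) (by linarith : (s + 1) / 2 + (s + 1) / 2 ≠ 0)]
    congr 2
    ring
  have hb2s : Summable fun m => b m ^ 2 :=
    (hw.summable_freqNormSq_rpow_mul_norm_sq (by linarith : (0 : ℝ) ≤ s)).congr
      fun m => (hb2 m).symm
  have hbV'2s : Summable fun m => bV' m ^ 2 :=
    (hv.summable_freqNormSq_rpow_mul_norm_sq (by linarith : (0 : ℝ) ≤ s + 1)).congr
      fun m => (hbV'2 m).symm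
  set X : ℝ := ∑' k, freqNormSq k ^ s * ‖A k‖ ^ 2 with hX
  set XV' : ℝ := ∑' k, freqNormSq k ^ (s + 1) * ‖V k‖ ^ 2 with hXV'
  set F₀ : ℝ := ∑' k, a k with hF₀
  set F₁V : ℝ := ∑' k, r k * aV k with hF₁V
  have hXb : ∑' m, b m ^ 2 = X := tsum_congr hb2
  have hXV'b : ∑' m, bV' m ^ 2 = XV' := tsum_congr hbV'2
  have hX0 : 0 ≤ X := by rw [← hXb]; exact tsum_nonneg fun m => sq_nonneg _
  have hF₀0 : 0 ≤ F₀ := tsum_nonneg fun m => ha0 m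
  have hF₁V0 : 0 ≤ F₁V := tsum_nonneg fun m => ha₁V0 m
  have hAle : ∀ m, a m ≤ F₀ := fun m => has.le_tsum m fun j _ => ha0 j
  have hBle : ∀ m, b m ≤ ∑' j, b j := fun m => hbs.le_tsum m fun j _ => hb0 j
  have hBV'le : ∀ m, bV' m ≤ ∑' j, bV' j := fun m => hbV's.le_tsum m fun j _ => hbV'0 j
  -- ### the pieces on `ℤ^n × ℤ^n`
  set c : (d → ℤ) → (d → ℤ) → ℂ := fun k l =>
    2 * Real.pi * Complex.I * ∑ j, ((l j : ℤ) : ℂ) * A (k - l) j with hc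
  set E : (d → ℤ) × (d → ℤ) → ℂ := fun q =>
    c q.1 q.2 * (((ρ q.1 * ρ q.1 : ℝ)) : ℂ) * inner ℂ (A q.1) (V q.2) with hE
  set C : ℝ := 2 * Real.pi * (Fintype.card d : ℝ) * (2 : ℝ) ^ (s - 1) with hC
  have hC0 : 0 ≤ C := by positivity
  set G : (d → ℤ) × (d → ℤ) → ℝ := fun q =>
    C * (b q.1 * (bV' q.2 * a (q.1 - q.2)) + b q.1 * (a₁V q.2 * b (q.1 - q.2))) with hG
  -- `|c k l| ≤ 2π n |l| ‖ŵ(k−l)‖`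
  have h2π : ‖(2 * Real.pi * Complex.I : ℂ)‖ = 2 * Real.pi := by simp [abs_of_pos Real.pi_pos]
  have hcle : ∀ k l, ‖c k l‖ ≤ 2 * Real.pi * (Fintype.card d : ℝ) * (r l * a (k - l)) := by
    intro k l
    simp only [hc]
    rw [norm_mul, h2π]
    have h1 : ‖∑ j, ((l j : ℤ) : ℂ) * A (k - l) j‖ ≤ (Fintype.card d : ℝ) * (r l * a (k - l)) := by
      refine (norm_sum_le _ _).trans ?_
      calc ∑ j, ‖((l j : ℤ) : ℂ) * A (k - l) j‖ ≤ ∑ _j : d, r l * a (k - l) :=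
            Finset.sum_le_sum fun j _ => by
              rw [norm_mul, Complex.norm_intCast]
              exact mul_le_mul (abs_apply_le_sqrt_freqNormSq l j)
                (PiLp.norm_apply_le (A (k - l)) j) (norm_nonneg _) (Real.sqrt_nonneg _)
        _ = (Fintype.card d : ℝ) * (r l * a (k - l)) := by
            rw [Finset.sum_const, Finset.card_univ, nsmul_eq_mul]
    calc 2 * Real.pi * ‖∑ j, ((l j : ℤ) : ℂ) * A (k - l) j‖
        ≤ 2 * Real.pi * ((Fintype.card d : ℝ) * (r l * a (k - l))) :=
          mul_le_mul_of_nonneg_left h1 (by positivity)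
      _ = 2 * Real.pi * (Fintype.card d : ℝ) * (r l * a (k - l)) := by ring
  -- `‖E(k,l)‖ ≤ G(k,l)` by the weight splitting
  have hEle : ∀ q : (d → ℤ) × (d → ℤ), ‖E q‖ ≤ G q := by
    rintro ⟨k, l⟩
    simp only [hE, hG]
    rw [norm_mul, norm_mul, Complex.norm_real, Real.norm_of_nonneg (mul_nonneg (hρ0 k) (hρ0 k))]
    have h1 := hcle k l
    have h2 : ρ k ≤ (2 : ℝ) ^ (s - 1) * (ρ l + ρ (k - l)) := kp_rpow_le_two_rpow_mul_add hs k l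
    have h3 : ‖inner ℂ (A k) (V l)‖ ≤ a k * aV l := norm_inner_le_norm _ _
    have hn : 0 ≤ 2 * Real.pi * (Fintype.card d : ℝ) * (r l * a (k - l)) := by
      have := hr0 l; have := ha0 (k - l); positivity
    have h4 : ‖c k l‖ * (ρ k * ρ k) * ‖inner ℂ (A k) (V l)‖ ≤
        (2 * Real.pi * (Fintype.card d : ℝ) * (r l * a (k - l))) *
          (ρ k * ((2 : ℝ) ^ (s - 1) * (ρ l + ρ (k - l)))) * (a k * aV l) :=
      mul_le_mul (mul_le_mul h1 (mul_le_mul_of_nonneg_left h2 (hρ0 k))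
        (mul_nonneg (hρ0 k) (hρ0 k)) hn) h3 (norm_nonneg _) (by
          have := hρ0 k; have := hρ0 l; have := hρ0 (k - l); positivity)
    refine h4.trans (le_of_eq ?_)
    simp only [hb, hbV', ha₁V, hC]
    ring
  -- summability over pairs
  have hG0 : ∀ q : (d → ℤ) × (d → ℤ), 0 ≤ G q := fun q =>
    mul_nonneg hC0 (add_nonneg (mul_nonneg (hb0 _) (mul_nonneg (hbV'0 _) (ha0 _)))
      (mul_nonneg (hb0 _) (mul_nonneg (ha₁V0 _) (hb0 _))))
  have hGs : Summable G := by
    have h1 := kp_summable_prod_mul_mul_sub hb0 hbV'0 ha0 hbs hbV's hAle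
    have h2 := kp_summable_prod_mul_mul_sub hb0 ha₁V0 hb0 hbs ha₁Vs hBle
    exact ((h1.add h2).mul_left C).congr fun q => by simp only [hG]
  have hEs : Summable E := Summable.of_norm_bounded hGs hEle
  -- ### the convective coefficient as a series in `l = k − m`
  have hB : ∀ k p, mFourierCoeff (EuclideanSpace.complexify ∘ Torus.convect w v) k p =
      ∑' l, c k l * V l p := by
    intro k p
    rw [mFourierCoeff_convect_apply_eq_tsum hw hv k p,
      ← (Equiv.subLeft k).tsum_eq (fun m => (2 * Real.pi * Complex.I *
        ∑ j, (((k - m) j : ℤ) : ℂ) * A m j) * V (k - m) p)]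
    refine tsum_congr fun l => ?_
    simp only [Equiv.subLeft_apply, sub_sub_cancel, hc]
  have hcVs : ∀ k p, Summable fun l => c k l * V l p := by
    intro k p
    refine Summable.of_norm_bounded ((ha₁Vs.mul_left (2 * Real.pi * (Fintype.card d : ℝ) * F₀)))
      fun l => ?_
    rw [norm_mul]
    calc ‖c k l‖ * ‖V l p‖ ≤ (2 * Real.pi * (Fintype.card d : ℝ) * (r l * a (k - l))) * aV l :=
          mul_le_mul (hcle k l) (PiLp.norm_apply_le (V l) p) (norm_nonneg _) (by positivity)
      _ ≤ (2 * Real.pi * (Fintype.card d : ℝ) * (r l * F₀)) * aV l := by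
          gcongr
          exact hAle (k - l)
      _ = 2 * Real.pi * (Fintype.card d : ℝ) * F₀ * (r l * aV l) := by ring
  have hinner : ∀ k, inner ℂ (A k) (mFourierCoeff (EuclideanSpace.complexify ∘ Torus.convect w v) k) =
      ∑' l, c k l * inner ℂ (A k) (V l) := by
    intro k
    rw [PiLp.inner_apply]
    simp_rw [RCLike.inner_apply', hB k]
    rw [show (∑ p, conj (A k p) * ∑' l, c k l * V l p) = ∑ p, ∑' l, conj (A k p) * (c k l * V l p)
      from Finset.sum_congr rfl fun p _ => (tsum_mul_left).symm]
    rw [← Summable.tsum_finsetSum fun p _ => (hcVs k p).mul_left _]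
    refine tsum_congr fun l => ?_
    rw [PiLp.inner_apply, Finset.mul_sum]
    exact Finset.sum_congr rfl fun p _ => by rw [RCLike.inner_apply']; ring
  -- ### termwise: `|k|^{2s} Re⟪B̂(k), ŵ(k)⟫ = Re ∑_l E(k,l)`
  have hEfib : ∀ k, Summable fun l => E (k, l) := fun k => hEs.prod_factor k
  have hsplit : ∀ k, freqNormSq k ^ s *
      (inner ℂ (mFourierCoeff (EuclideanSpace.complexify ∘ Torus.convect w v) k) (A k)).re =
      (∑' l, E (k, l)).re := by
    intro k
    have hsym : (inner ℂ (mFourierCoeff (EuclideanSpace.complexify ∘ Torus.convect w v) k)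
        (A k)).re = (inner ℂ (A k)
          (mFourierCoeff (EuclideanSpace.complexify ∘ Torus.convect w v) k)).re := by
      rw [← inner_conj_symm, Complex.conj_re]
    rw [hsym, hinner k, ← Complex.re_ofReal_mul, ← tsum_mul_left]
    congr 1
    refine tsum_congr fun l => ?_
    simp only [hE, ← hρsq k]
    push_cast
    ring
  -- ### summation over `k`
  have hGfib : ∀ k, Summable fun l => G (k, l) := fun k => hGs.prod_factor k
  have hEre_le : ∀ k, ‖(∑' l, E (k, l)).re‖ ≤ ∑' l, G (k, l) := fun k => by
    rw [Real.norm_eq_abs]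
    calc |(∑' l, E (k, l)).re| ≤ ‖∑' l, E (k, l)‖ := Complex.abs_re_le_norm _
      _ ≤ ∑' l, ‖E (k, l)‖ := norm_tsum_le_tsum_norm (hEfib k).norm
      _ ≤ ∑' l, G (k, l) := (hEfib k).norm.tsum_le_tsum (fun l => hEle (k, l)) (hGfib k)
  have hEre_s : Summable fun k => (∑' l, E (k, l)).re :=
    Summable.of_norm_bounded hGs.prod hEre_le
  have hGsum_le : ∑' k, ∑' l, G (k, l) ≤
      C * (F₀ * Real.sqrt XV' + F₁V * Real.sqrt X) * Real.sqrt X := by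
    have hconv1 : ∀ k, Summable fun l => bV' l * a (k - l) := fun k =>
      (hbV's.mul_right F₀).of_nonneg_of_le (fun l => mul_nonneg (hbV'0 l) (ha0 _))
        fun l => mul_le_mul_of_nonneg_left (hAle _) (hbV'0 l)
    have hconv1' : ∀ k, Summable fun l => a l * bV' (k - l) := fun k =>
      (has.mul_right (∑' j, bV' j)).of_nonneg_of_le (fun l => mul_nonneg (ha0 l) (hbV'0 _))
        fun l => mul_le_mul_of_nonneg_left (hBV'le _) (ha0 l)
    have hconv2 : ∀ k, Summable fun l => a₁V l * b (k - l) := fun k =>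
      (ha₁Vs.mul_right (∑' j, b j)).of_nonneg_of_le (fun l => mul_nonneg (ha₁V0 l) (hb0 _))
        fun l => mul_le_mul_of_nonneg_left (hBle _) (ha₁V0 l)
    have hre : ∀ k, ∑' l, bV' l * a (k - l) = ∑' l, a l * bV' (k - l) := fun k => by
      rw [← (Equiv.subLeft k).tsum_eq (fun l => bV' l * a (k - l))]
      refine tsum_congr fun l => ?_
      simp only [Equiv.subLeft_apply, sub_sub_cancel]
      ring
    have hGk : ∀ k, ∑' l, G (k, l) =
        C * (b k * ∑' l, a l * bV' (k - l)) + C * (b k * ∑' l, a₁V l * b (k - l)) := by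
      intro k
      simp only [hG]
      rw [tsum_mul_left, ((hconv1 k).mul_left (b k)).tsum_add ((hconv2 k).mul_left (b k)),
        tsum_mul_left, tsum_mul_left, hre k]
      ring
    have hs1 : Summable fun k => C * (b k * ∑' l, a l * bV' (k - l)) := by
      refine ((hbs.mul_left (C * (F₀ * ∑' j, bV' j)))).of_nonneg_of_le
        (fun k => mul_nonneg hC0 (mul_nonneg (hb0 k) (tsum_nonneg fun l =>
          mul_nonneg (ha0 l) (hbV'0 _)))) fun k => ?_
      have h1 : ∑' l, a l * bV' (k - l) ≤ ∑' l, a l * ∑' j, bV' j :=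
        (hconv1' k).tsum_le_tsum (fun l => mul_le_mul_of_nonneg_left (hBV'le _) (ha0 l))
          (has.mul_right _)
      rw [tsum_mul_right] at h1
      calc C * (b k * ∑' l, a l * bV' (k - l)) ≤ C * (b k * (F₀ * ∑' j, bV' j)) :=
            mul_le_mul_of_nonneg_left (mul_le_mul_of_nonneg_left h1 (hb0 k)) hC0
        _ = C * (F₀ * ∑' j, bV' j) * b k := by ring
    have hs2 : Summable fun k => C * (b k * ∑' l, a₁V l * b (k - l)) := by
      refine ((hbs.mul_left (C * (F₁V * ∑' j, b j)))).of_nonneg_of_le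
        (fun k => mul_nonneg hC0 (mul_nonneg (hb0 k) (tsum_nonneg fun l =>
          mul_nonneg (ha₁V0 l) (hb0 _)))) fun k => ?_
      have h1 : ∑' l, a₁V l * b (k - l) ≤ ∑' l, a₁V l * ∑' j, b j :=
        (hconv2 k).tsum_le_tsum (fun l => mul_le_mul_of_nonneg_left (hBle _) (ha₁V0 l))
          (ha₁Vs.mul_right _)
      rw [tsum_mul_right] at h1
      calc C * (b k * ∑' l, a₁V l * b (k - l)) ≤ C * (b k * (F₁V * ∑' j, b j)) :=
            mul_le_mul_of_nonneg_left (mul_le_mul_of_nonneg_left h1 (hb0 k)) hC0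
        _ = C * (F₁V * ∑' j, b j) * b k := by ring
    rw [tsum_congr hGk, hs1.tsum_add hs2, tsum_mul_left, tsum_mul_left]
    have hK1 : ∀ K : Finset (d → ℤ), ∑ k ∈ K, b k * ∑' l, a l * bV' (k - l) ≤
        F₀ * Real.sqrt XV' * Real.sqrt X := by
      intro K
      have hY := NSGevrey.sum_mul_tsum_mul_le K ha0 hbV'0 hb0 has hbV'2s
      have h1 : Real.sqrt (∑ k ∈ K, b k ^ 2) ≤ Real.sqrt X :=
        Real.sqrt_le_sqrt (by rw [← hXb]; exact hb2s.sum_le_tsum K fun m _ => sq_nonneg _)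
      calc ∑ k ∈ K, b k * ∑' l, a l * bV' (k - l)
          ≤ (∑' j, a j) * Real.sqrt (∑' j, bV' j ^ 2) * Real.sqrt (∑ k ∈ K, b k ^ 2) := hY
        _ ≤ F₀ * Real.sqrt XV' * Real.sqrt X := by
            rw [hXV'b]
            exact mul_le_mul_of_nonneg_left h1 (mul_nonneg hF₀0 (Real.sqrt_nonneg _))
    have hK2 : ∀ K : Finset (d → ℤ), ∑ k ∈ K, b k * ∑' l, a₁V l * b (k - l) ≤ F₁V * X := by
      intro K
      have hY := NSGevrey.sum_mul_tsum_mul_le K ha₁V0 hb0 hb0 ha₁Vs hb2s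
      have h1 : Real.sqrt (∑ k ∈ K, b k ^ 2) ≤ Real.sqrt X :=
        Real.sqrt_le_sqrt (by rw [← hXb]; exact hb2s.sum_le_tsum K fun m _ => sq_nonneg _)
      calc ∑ k ∈ K, b k * ∑' l, a₁V l * b (k - l)
          ≤ (∑' j, a₁V j) * Real.sqrt (∑' j, b j ^ 2) * Real.sqrt (∑ k ∈ K, b k ^ 2) := hY
        _ ≤ F₁V * Real.sqrt X * Real.sqrt X := by
            rw [hXb]
            exact mul_le_mul_of_nonneg_left h1 (mul_nonneg hF₁V0 (Real.sqrt_nonneg _))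
        _ = F₁V * X := by rw [mul_assoc, Real.mul_self_sqrt hX0]
    have htb1 : ∑' k, b k * ∑' l, a l * bV' (k - l) ≤ F₀ * Real.sqrt XV' * Real.sqrt X :=
      Real.tsum_le_of_sum_le (fun k => mul_nonneg (hb0 k) (tsum_nonneg fun l =>
        mul_nonneg (ha0 l) (hbV'0 _))) hK1
    have htb2 : ∑' k, b k * ∑' l, a₁V l * b (k - l) ≤ F₁V * X :=
      Real.tsum_le_of_sum_le (fun k => mul_nonneg (hb0 k) (tsum_nonneg fun l =>
        mul_nonneg (ha₁V0 l) (hb0 _))) hK2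
    have hXs : X = Real.sqrt X * Real.sqrt X := (Real.mul_self_sqrt hX0).symm
    calc C * ∑' k, b k * ∑' l, a l * bV' (k - l) + C * ∑' k, b k * ∑' l, a₁V l * b (k - l)
        ≤ C * (F₀ * Real.sqrt XV' * Real.sqrt X) + C * (F₁V * X) :=
          add_le_add (mul_le_mul_of_nonneg_left htb1 hC0) (mul_le_mul_of_nonneg_left htb2 hC0)
      _ = C * (F₀ * Real.sqrt XV' + F₁V * Real.sqrt X) * Real.sqrt X := by
          nth_rewrite 2 [hXs]
          ring
  -- ### conclusion
  rw [tsum_congr hsplit]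
  calc |∑' k, (∑' l, E (k, l)).re| ≤ ∑' k, ‖(∑' l, E (k, l)).re‖ := by
        rw [← Real.norm_eq_abs]
        exact norm_tsum_le_tsum_norm hEre_s.norm
    _ ≤ ∑' k, ∑' l, G (k, l) := hEre_s.norm.tsum_le_tsum hEre_le hGs.prod
    _ ≤ C * (F₀ * Real.sqrt XV' + F₁V * Real.sqrt X) * Real.sqrt X := hGsum_le
    _ = 2 * Real.pi * (Fintype.card d : ℝ) * (2 : ℝ) ^ (s - 1) *
          (F₀ * Real.sqrt XV' + F₁V * Real.sqrt X) * Real.sqrt X := by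
        simp only [hC]


/-! ### §3 The sharp-constant form: Morosi–Pizzocchero's lattice functional `𝒢_n` -/

omit [DecidableEq d] in
/-- **The geometric lemma of Morosi–Pizzocchero (CPAA 2012, Lemma 4.1, from [cok]):** if
`p · z = 0` then `|q · z| ≤ (|p ∧ q|/|p|)|z|`; here for lattice vectors `h, k` and `z ∈ ℂ^d` with
`∑ h_j z_j = 0`, in the squared-free form `|∑ k_j z_j| √|h|² ≤ √(|h|²|k|² − (h·k)²) ‖z‖`
(`|p ∧ q|² = |p|²|q|² − (p·q)²`; Cauchy–Schwarz after subtracting the component of `k` along `h`).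
[cite: MorosiPizzocchero2012Kato, Lemma 4.1] -/
theorem norm_sum_mul_le_sqrt_gram_of_orthogonal (h k : d → ℤ) (z : EuclideanSpace ℂ d)
    (hz : ∑ j, ((h j : ℤ) : ℂ) * z j = 0) :
    ‖∑ j, ((k j : ℤ) : ℂ) * z j‖ * Real.sqrt (freqNormSq h) ≤
      Real.sqrt (freqNormSq h * freqNormSq k - (∑ j, (h j : ℝ) * (k j : ℝ)) ^ 2) * ‖z‖ := by
  by_cases hh : h = 0
  · subst hh
    simp [freqNormSq_zero]
  have hH : 0 < freqNormSq h := lt_of_lt_of_le one_pos (one_le_freqNormSq_of_ne_zero hh)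
  set σ : ℝ := ∑ j, (h j : ℝ) * (k j : ℝ) with hσ
  set t : ℝ := σ / freqNormSq h with ht
  set x : d → ℝ := fun j => (k j : ℝ) - t * (h j : ℝ) with hx
  -- `∑ k_j z_j = ∑ x_j z_j`
  have hsum : ∑ j, ((k j : ℤ) : ℂ) * z j = ∑ j, ((x j : ℝ) : ℂ) * z j := by
    have h1 : ∑ j, ((x j : ℝ) : ℂ) * z j =
        ∑ j, ((k j : ℤ) : ℂ) * z j - (t : ℂ) * ∑ j, ((h j : ℤ) : ℂ) * z j := by
      rw [Finset.mul_sum, ← Finset.sum_sub_distrib]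
      refine Finset.sum_congr rfl fun j _ => ?_
      simp only [hx]
      push_cast
      ring
    rw [h1, hz, mul_zero, sub_zero]
  -- Cauchy–Schwarz
  have hCS : ‖∑ j, ((x j : ℝ) : ℂ) * z j‖ ≤ Real.sqrt (∑ j, x j ^ 2) * Real.sqrt (∑ j, ‖z j‖ ^ 2) := by
    refine (norm_sum_le _ _).trans ?_
    have h1 : ∀ j, ‖((x j : ℝ) : ℂ) * z j‖ = |x j| * ‖z j‖ := fun j => by
      rw [norm_mul, Complex.norm_real, Real.norm_eq_abs]
    simp_rw [h1]
    have h2 := Real.sum_mul_le_sqrt_mul_sqrt Finset.univ (fun j => |x j|) (fun j => ‖z j‖)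
    simpa only [sq_abs] using h2
  have hz2 : Real.sqrt (∑ j, ‖z j‖ ^ 2) = ‖z‖ := by
    rw [EuclideanSpace.norm_eq]
  -- `∑ x_j² · |h|² = |h|²|k|² − σ²`
  have hfk : freqNormSq k = ∑ j, (k j : ℝ) ^ 2 := by
    simp [freqNormSq]
  have hfh : freqNormSq h = ∑ j, (h j : ℝ) ^ 2 := by
    simp [freqNormSq]
  have hx2 : (∑ j, x j ^ 2) * freqNormSq h = freqNormSq h * freqNormSq k - σ ^ 2 := by
    have e1 : ∑ j, x j ^ 2 = ∑ j, (k j : ℝ) ^ 2 - 2 * t * ∑ j, (h j : ℝ) * (k j : ℝ) +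
        t ^ 2 * ∑ j, (h j : ℝ) ^ 2 := by
      simp only [hx, Finset.mul_sum, ← Finset.sum_sub_distrib, ← Finset.sum_add_distrib]
      refine Finset.sum_congr rfl fun j _ => ?_
      ring
    rw [e1, ← hfk, ← hfh, ← hσ, ht]
    field_simp
    ring
  have hx0 : 0 ≤ ∑ j, x j ^ 2 := Finset.sum_nonneg fun j _ => sq_nonneg _
  calc ‖∑ j, ((k j : ℤ) : ℂ) * z j‖ * Real.sqrt (freqNormSq h)
      = ‖∑ j, ((x j : ℝ) : ℂ) * z j‖ * Real.sqrt (freqNormSq h) := by rw [hsum]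
    _ ≤ Real.sqrt (∑ j, x j ^ 2) * Real.sqrt (∑ j, ‖z j‖ ^ 2) * Real.sqrt (freqNormSq h) :=
        mul_le_mul_of_nonneg_right hCS (Real.sqrt_nonneg _)
    _ = Real.sqrt ((∑ j, x j ^ 2) * freqNormSq h) * ‖z‖ := by
        rw [hz2, Real.sqrt_mul hx0]; ring
    _ = Real.sqrt (freqNormSq h * freqNormSq k - σ ^ 2) * ‖z‖ := by rw [hx2]

omit [Fintype d] [DecidableEq d] in
/-- Cauchy–Schwarz for nonnegative summable lattice families (as in
`TorusNSSobolevControlInequality`). [folklore] -/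
private theorem kp_tsum_sqrt_mul_sqrt_le {ι : Type*} {p q : ι → ℝ} (hp : ∀ i, 0 ≤ p i)
    (hq : ∀ i, 0 ≤ q i) (hps : Summable p) (hqs : Summable q) :
    (Summable fun i => Real.sqrt (p i) * Real.sqrt (q i)) ∧
      ∑' i, Real.sqrt (p i) * Real.sqrt (q i) ≤ Real.sqrt (∑' i, p i) * Real.sqrt (∑' i, q i) := by
  have hmaj : Summable fun i => Real.sqrt (p i) * Real.sqrt (q i) := by
    refine ((hps.add hqs).div_const 2).of_nonneg_of_le
      (fun i => mul_nonneg (Real.sqrt_nonneg _) (Real.sqrt_nonneg _)) fun i => ?_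
    have h1 := Real.sq_sqrt (hp i)
    have h2 := Real.sq_sqrt (hq i)
    nlinarith [sq_nonneg (Real.sqrt (p i) - Real.sqrt (q i)), Real.sqrt_nonneg (p i),
      Real.sqrt_nonneg (q i)]
  refine ⟨hmaj, Real.tsum_le_of_sum_le (fun i => mul_nonneg (Real.sqrt_nonneg _)
    (Real.sqrt_nonneg _)) fun K => ?_⟩
  calc ∑ i ∈ K, Real.sqrt (p i) * Real.sqrt (q i)
      ≤ Real.sqrt (∑ i ∈ K, p i) * Real.sqrt (∑ i ∈ K, q i) := Real.sum_sqrt_mul_sqrt_le K hp hq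
    _ ≤ Real.sqrt (∑' i, p i) * Real.sqrt (∑' i, q i) :=
        mul_le_mul (Real.sqrt_le_sqrt (hps.sum_le_tsum K fun i _ => hp i))
          (Real.sqrt_le_sqrt (hqs.sum_le_tsum K fun i _ => hq i)) (Real.sqrt_nonneg _)
          (Real.sqrt_nonneg _)

set_option maxHeartbeats 800000 in
-- (one long lattice computation: the pair proof of §1 plus Morosi–Pizzocchero's Steps 3–4)
/-- **The Kato inequality with Morosi–Pizzocchero's sharp-constant functional (CPAA 11 (2012)
557, Prop. 3.5 with Def. 3.3 and the proof of §4, Steps 1–5).** MP: "`G'_n ≤ G_n⁺`,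
`G_n⁺ := (2π)^{−d/2} (sup_{k ∈ ℤ^d₀} 𝒢_n(k))^{1/2}`", where
`𝒢_n(k) = ∑_{h ∈ ℤ^d ∖ {0, k}} |h ∧ k|² (|k|^n − |k − h|^n)² / (|h|^{2n+2}|k − h|^{2n})` and `G'_n`
is the sharp constant of `|⟨v·∂w | w⟩_n| ≤ G'_n ‖v‖_n ‖w‖_n²`. Lattice form on the unit torus
(`|k|² = freqNormSq k`, `|h ∧ k|² = |h|²|k|² − (h·k)²`; MP's `(2π)^{−d/2}` normalisation
factors are absent here and their `∇ ↔ ik` is our `2πik`): for smooth real fields `v, w` with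
`div v = 0`, `s ≥ 1`, and a number `Gsq` bounding all finite partial sums of `𝒢_s(k)`, every `k`,
`|∑_k |k|^{2s} Re⟪𝓕((v·∇)w)(k), ŵ(k)⟫| ≤ 2π √Gsq ‖v‖_s ‖w‖_s²`. Proof = MP's: the
cancellation `⟨v·∂(Λ^s w)|Λ^s w⟩ = 0` (`NSSobolev.re_tsum_tsum_latticeConvect_eq_zero`) leaves
the commutator family `E(k, l) = c(k,l)|k|^s(|k|^s − |l|^s)⟪ŵ(k), ŵ(l)⟫`; with `h = k − l`,
`|l · v̂(h)| = |k · v̂(h)| ≤ (|h ∧ k|/|h|)‖v̂(h)‖` (`h · v̂(h) = 0`, Lemma 4.1), then Cauchy–Schwarz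
in `h` against `𝒢_s(k)` and in `k` (Steps 3–4). With MP's certified value
`sup 𝒢₃ ≤ ((2π)^{3/2}·0.438)²` on `ℤ³` this is their `G₃ ≤ 0.438`; the evaluation of `sup 𝒢_s` is
not done here (hypothesis `hG`).
[cite: MorosiPizzocchero2012Kato, Prop. 3.5, Def. 3.3, §4 Steps 1–5 and Lemma 4.1] -/
theorem abs_tsum_rpow_mul_re_inner_convect_pair_le_of_kernel_le (hv : IsSmooth v)
    (hdiv : IsDivFree v) (hw : IsSmooth w) {s : ℝ} (hs : 1 ≤ s) {Gsq : ℝ}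
    (hGker : ∀ (k : d → ℤ) (H : Finset (d → ℤ)), ∑ h ∈ H,
      (freqNormSq h * freqNormSq k - (∑ j, (h j : ℝ) * (k j : ℝ)) ^ 2) *
        (freqNormSq k ^ (s / 2) - freqNormSq (k - h) ^ (s / 2)) ^ 2 /
        (freqNormSq h ^ (s + 1) * freqNormSq (k - h) ^ s) ≤ Gsq) :
    |∑' k : d → ℤ, freqNormSq k ^ s *
        (inner ℂ (mFourierCoeff (EuclideanSpace.complexify ∘ Torus.convect v w) k)
          (mFourierCoeff (EuclideanSpace.complexify ∘ w) k)).re| ≤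
      2 * Real.pi * Real.sqrt Gsq *
        Real.sqrt (∑' k : d → ℤ, freqNormSq k ^ s *
            ‖mFourierCoeff (EuclideanSpace.complexify ∘ v) k‖ ^ 2) *
        (∑' k : d → ℤ, freqNormSq k ^ s *
            ‖mFourierCoeff (EuclideanSpace.complexify ∘ w) k‖ ^ 2) := by
  classical
  set V : (d → ℤ) → EuclideanSpace ℂ d := fun m => mFourierCoeff (EuclideanSpace.complexify ∘ v) m
    with hVdef
  set U : (d → ℤ) → EuclideanSpace ℂ d := fun m => mFourierCoeff (EuclideanSpace.complexify ∘ w) m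
    with hUdef
  -- ### weights and their summability
  set a : (d → ℤ) → ℝ := fun m => ‖U m‖ with ha
  set aV : (d → ℤ) → ℝ := fun m => ‖V m‖ with haV
  set r : (d → ℤ) → ℝ := fun m => Real.sqrt (freqNormSq m) with hr
  set ρ : (d → ℤ) → ℝ := fun m => freqNormSq m ^ (s / 2) with hρ
  set ρ₁ : (d → ℤ) → ℝ := fun m => freqNormSq m ^ ((s - 1) / 2) with hρ₁
  set b : (d → ℤ) → ℝ := fun m => ρ m * a m with hb
  set bV : (d → ℤ) → ℝ := fun m => ρ m * aV m with hbV
  set a₁ : (d → ℤ) → ℝ := fun m => r m * a m with ha₁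
  set a₁V : (d → ℤ) → ℝ := fun m => r m * aV m with ha₁V
  have ha0 : ∀ m, 0 ≤ a m := fun m => norm_nonneg _
  have haV0 : ∀ m, 0 ≤ aV m := fun m => norm_nonneg _
  have hr0 : ∀ m, 0 ≤ r m := fun m => Real.sqrt_nonneg _
  have hρ0 : ∀ m, 0 ≤ ρ m := fun m => Real.rpow_nonneg (freqNormSq_nonneg m) _
  have hρ₁0 : ∀ m, 0 ≤ ρ₁ m := fun m => Real.rpow_nonneg (freqNormSq_nonneg m) _
  have hb0 : ∀ m, 0 ≤ b m := fun m => mul_nonneg (hρ0 m) (ha0 m)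
  have hbV0 : ∀ m, 0 ≤ bV m := fun m => mul_nonneg (hρ0 m) (haV0 m)
  have ha₁0 : ∀ m, 0 ≤ a₁ m := fun m => mul_nonneg (hr0 m) (ha0 m)
  have ha₁V0 : ∀ m, 0 ≤ a₁V m := fun m => mul_nonneg (hr0 m) (haV0 m)
  have has : Summable a := hw.complexify_comp.rapidDecay_mFourierCoeff.summable_norm
  have haVs : Summable aV := hv.complexify_comp.rapidDecay_mFourierCoeff.summable_norm
  have hpow : ∀ {t : ℝ}, 0 ≤ t → Summable fun m : d → ℤ => freqNormSq m ^ t * a m :=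
    fun ht => kp_summable_rpow_mul_norm hw ht
  have hpowV : ∀ {t : ℝ}, 0 ≤ t → Summable fun m : d → ℤ => freqNormSq m ^ t * aV m :=
    fun ht => kp_summable_rpow_mul_norm hv ht
  have hr_eq : ∀ m, r m = freqNormSq m ^ (1 / 2 : ℝ) := fun m => Real.sqrt_eq_rpow _
  have hrρ₁ : ∀ m, r m * ρ₁ m = ρ m := fun m => by
    rw [hr_eq, hρ₁, hρ]
    simp only
    rw [← Real.rpow_add' (freqNormSq_nonneg m) (by linarith : (1 / 2 : ℝ) + (s - 1) / 2 ≠ 0)]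
    congr 1
    ring
  have hρsq : ∀ m, ρ m * ρ m = freqNormSq m ^ s := fun m => by
    rw [hρ]
    simp only
    rw [← Real.rpow_add' (freqNormSq_nonneg m) (by linarith : s / 2 + s / 2 ≠ 0)]
    congr 1
    ring
  have hbs : Summable b := (hpow (by linarith : (0 : ℝ) ≤ s / 2)).congr fun m => by
    simp only [hb, hρ]
  have hbVs : Summable bV := (hpowV (by linarith : (0 : ℝ) ≤ s / 2)).congr fun m => by
    simp only [hbV, hρ]
  have ha₁s : Summable a₁ := (hpow (by norm_num : (0 : ℝ) ≤ 1 / 2)).congr fun m => by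
    simp only [ha₁, hr_eq]
  have ha₁Vs : Summable a₁V := (hpowV (by norm_num : (0 : ℝ) ≤ 1 / 2)).congr fun m => by
    simp only [ha₁V, hr_eq]
  have hrbs : Summable fun m => r m * b m :=
    (hpow (by linarith : (0 : ℝ) ≤ (s + 1) / 2)).congr fun m => by
      simp only [hb, hr_eq, hρ]
      rw [← mul_assoc, ← Real.rpow_add' (freqNormSq_nonneg m)
        (by linarith : (1 / 2 : ℝ) + s / 2 ≠ 0)]
      congr 2
      ring
  have hb2 : ∀ m, b m ^ 2 = freqNormSq m ^ s * ‖U m‖ ^ 2 := fun m => by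
    simp only [hb, ha]
    rw [mul_pow, sq, hρsq]
  have hbV2 : ∀ m, bV m ^ 2 = freqNormSq m ^ s * ‖V m‖ ^ 2 := fun m => by
    simp only [hbV, haV]
    rw [mul_pow, sq, hρsq]
  have hb2s : Summable fun m => b m ^ 2 :=
    (hw.summable_freqNormSq_rpow_mul_norm_sq (by linarith : (0 : ℝ) ≤ s)).congr
      fun m => (hb2 m).symm
  have hbV2s : Summable fun m => bV m ^ 2 :=
    (hv.summable_freqNormSq_rpow_mul_norm_sq (by linarith : (0 : ℝ) ≤ s)).congr
      fun m => (hbV2 m).symm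
  set X : ℝ := ∑' k, freqNormSq k ^ s * ‖U k‖ ^ 2 with hX
  set XV : ℝ := ∑' k, freqNormSq k ^ s * ‖V k‖ ^ 2 with hXV
  set F₁ : ℝ := ∑' k, r k * a k with hF₁
  set F₁V : ℝ := ∑' k, r k * aV k with hF₁V
  have hXb : ∑' m, b m ^ 2 = X := tsum_congr hb2
  have hXVb : ∑' m, bV m ^ 2 = XV := tsum_congr hbV2
  have hX0 : 0 ≤ X := by rw [← hXb]; exact tsum_nonneg fun m => sq_nonneg _
  have hXV0 : 0 ≤ XV := by rw [← hXVb]; exact tsum_nonneg fun m => sq_nonneg _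
  have hF₁0 : 0 ≤ F₁ := tsum_nonneg fun m => ha₁0 m
  have hF₁V0 : 0 ≤ F₁V := tsum_nonneg fun m => ha₁V0 m
  -- bounds `aV ≤ AV`, `b ≤ B₀`, `bV ≤ BV₀`, `a₁ ≤ F₁`, `a₁V ≤ F₁V`
  have hAVle : ∀ m, aV m ≤ ∑' j, aV j := fun m => haVs.le_tsum m fun j _ => haV0 j
  have hBle : ∀ m, b m ≤ ∑' j, b j := fun m => hbs.le_tsum m fun j _ => hb0 j
  have hBVle : ∀ m, bV m ≤ ∑' j, bV j := fun m => hbVs.le_tsum m fun j _ => hbV0 j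
  have hA₁le : ∀ m, a₁ m ≤ F₁ := fun m => ha₁s.le_tsum m fun j _ => ha₁0 j
  have hA₁Vle : ∀ m, a₁V m ≤ F₁V := fun m => ha₁Vs.le_tsum m fun j _ => ha₁V0 j
  -- ### the pieces on `ℤ^n × ℤ^n`
  set W : (d → ℤ) → EuclideanSpace ℂ d := fun k => (ρ k : ℂ) • U k with hW
  have hWn : ∀ k, ‖W k‖ = b k := fun k => by
    simp only [hW, hb, ha]
    rw [norm_smul, Complex.norm_real, Real.norm_of_nonneg (hρ0 k)]
  set c : (d → ℤ) → (d → ℤ) → ℂ := fun k l =>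
    2 * Real.pi * Complex.I * ∑ j, ((l j : ℤ) : ℂ) * V (k - l) j with hc
  set Φ : (d → ℤ) × (d → ℤ) → ℂ := fun q =>
    (2 * Real.pi * Complex.I * ∑ j, ((q.2 j : ℤ) : ℂ) * V (q.1 - q.2) j) *
      inner ℂ (W q.1) (W q.2) with hΦ
  set E : (d → ℤ) × (d → ℤ) → ℂ := fun q =>
    c q.1 q.2 * (((ρ q.1 * (ρ q.1 - ρ q.2) : ℝ)) : ℂ) * inner ℂ (U q.1) (U q.2) with hE
  set C : ℝ := 2 * Real.pi * (Fintype.card d : ℝ) * (s * (2 : ℝ) ^ s) with hC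
  have hC0 : 0 ≤ C := by positivity
  set G : (d → ℤ) × (d → ℤ) → ℝ := fun q =>
    C * (b q.1 * (a₁ q.2 * bV (q.1 - q.2)) + b q.1 * (b q.2 * a₁V (q.1 - q.2))) with hG
  -- `|c k l| ≤ 2π n |l| ‖v̂(k−l)‖`
  have h2π : ‖(2 * Real.pi * Complex.I : ℂ)‖ = 2 * Real.pi := by simp [abs_of_pos Real.pi_pos]
  have hcle : ∀ k l, ‖c k l‖ ≤ 2 * Real.pi * (Fintype.card d : ℝ) * (r l * aV (k - l)) := by
    intro k l
    simp only [hc]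
    rw [norm_mul, h2π]
    have h1 : ‖∑ j, ((l j : ℤ) : ℂ) * V (k - l) j‖ ≤ (Fintype.card d : ℝ) * (r l * aV (k - l)) := by
      refine (norm_sum_le _ _).trans ?_
      calc ∑ j, ‖((l j : ℤ) : ℂ) * V (k - l) j‖ ≤ ∑ _j : d, r l * aV (k - l) :=
            Finset.sum_le_sum fun j _ => by
              rw [norm_mul, Complex.norm_intCast]
              exact mul_le_mul (abs_apply_le_sqrt_freqNormSq l j)
                (PiLp.norm_apply_le (V (k - l)) j) (norm_nonneg _) (Real.sqrt_nonneg _)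
        _ = (Fintype.card d : ℝ) * (r l * aV (k - l)) := by
            rw [Finset.sum_const, Finset.card_univ, nsmul_eq_mul]
    calc 2 * Real.pi * ‖∑ j, ((l j : ℤ) : ℂ) * V (k - l) j‖
        ≤ 2 * Real.pi * ((Fintype.card d : ℝ) * (r l * aV (k - l))) :=
          mul_le_mul_of_nonneg_left h1 (by positivity)
      _ = 2 * Real.pi * (Fintype.card d : ℝ) * (r l * aV (k - l)) := by ring
  -- `‖E(k,l)‖ ≤ G(k,l)`
  have hEle : ∀ q : (d → ℤ) × (d → ℤ), ‖E q‖ ≤ G q := by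
    rintro ⟨k, l⟩
    simp only [hE, hG]
    rw [norm_mul, norm_mul, Complex.norm_real, Real.norm_eq_abs, abs_mul, abs_of_nonneg (hρ0 k)]
    have h1 := hcle k l
    have h2 : |ρ k - ρ l| ≤ s * (2 : ℝ) ^ s * r (k - l) * (ρ₁ (k - l) + ρ₁ l) :=
      abs_rpow_sqrt_sub_rpow_sqrt_le hs k l
    have h3 : ‖inner ℂ (U k) (U l)‖ ≤ a k * a l := norm_inner_le_norm _ _
    have hn1 : 0 ≤ ρ k * |ρ k - ρ l| := mul_nonneg (hρ0 k) (abs_nonneg _)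
    have hn2 : 0 ≤ 2 * Real.pi * (Fintype.card d : ℝ) * (r l * aV (k - l)) := by
      have := hr0 l; have := haV0 (k - l); positivity
    have hn3 : 0 ≤ (2 * Real.pi * (Fintype.card d : ℝ) * (r l * aV (k - l))) *
        (ρ k * (s * (2 : ℝ) ^ s * r (k - l) * (ρ₁ (k - l) + ρ₁ l))) := by
      have := hr0 (k - l); have := hρ₁0 (k - l); have := hρ₁0 l; have := hρ0 k
      have : (0 : ℝ) ≤ s := by linarith
      positivity
    have h4 : ‖c k l‖ * (ρ k * |ρ k - ρ l|) * ‖inner ℂ (U k) (U l)‖ ≤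
        (2 * Real.pi * (Fintype.card d : ℝ) * (r l * aV (k - l))) *
          (ρ k * (s * (2 : ℝ) ^ s * r (k - l) * (ρ₁ (k - l) + ρ₁ l))) * (a k * a l) :=
      mul_le_mul (mul_le_mul h1 (mul_le_mul_of_nonneg_left h2 (hρ0 k)) hn1 hn2) h3
        (norm_nonneg _) hn3
    refine h4.trans (le_of_eq ?_)
    -- `r·ρ₁ = ρ`, and regrouping into `b`, `bV`, `a₁`, `a₁V`
    have e1 : r (k - l) * ρ₁ (k - l) = ρ (k - l) := hrρ₁ (k - l)
    have e2 : r l * ρ₁ l = ρ l := hrρ₁ l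
    simp only [hb, hbV, ha₁, ha₁V, hC]
    rw [← e1, ← e2]
    ring
  -- summability over pairs
  have hG0 : ∀ q : (d → ℤ) × (d → ℤ), 0 ≤ G q := fun q =>
    mul_nonneg hC0 (add_nonneg (mul_nonneg (hb0 _) (mul_nonneg (ha₁0 _) (hbV0 _)))
      (mul_nonneg (hb0 _) (mul_nonneg (hb0 _) (ha₁V0 _))))
  have hGs : Summable G := by
    have h1 := kp_summable_prod_mul_mul_sub hb0 ha₁0 hbV0 hbs ha₁s hBVle
    have h2 := kp_summable_prod_mul_mul_sub hb0 hb0 ha₁V0 hbs hbs hA₁Vle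
    exact ((h1.add h2).mul_left C).congr fun q => by simp only [hG]
  have hEs : Summable E := Summable.of_norm_bounded hGs hEle
  have hΦsum : Summable fun q : (d → ℤ) × (d → ℤ) =>
      ‖W q.1‖ * ((Real.sqrt (freqNormSq q.2) * ‖W q.2‖) * ‖V (q.1 - q.2)‖) := by
    have h1 := kp_summable_prod_mul_mul_sub hb0 (fun l => mul_nonneg (hr0 l) (hb0 l)) haV0 hbs hrbs
      hAVle
    exact h1.congr fun q => by simp only [hWn, hr, haV]
  have hΦs : Summable Φ := by
    have hΦle : ∀ q : (d → ℤ) × (d → ℤ), ‖Φ q‖ ≤ 2 * Real.pi * (Fintype.card d : ℝ) *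
        (‖W q.1‖ * ((Real.sqrt (freqNormSq q.2) * ‖W q.2‖) * ‖V (q.1 - q.2)‖)) := by
      rintro ⟨k, l⟩
      simp only [hΦ]
      rw [norm_mul]
      have h1 := hcle k l
      have h2 : ‖inner ℂ (W k) (W l)‖ ≤ ‖W k‖ * ‖W l‖ := norm_inner_le_norm _ _
      calc ‖c k l‖ * ‖inner ℂ (W k) (W l)‖
          ≤ (2 * Real.pi * (Fintype.card d : ℝ) * (r l * aV (k - l))) * (‖W k‖ * ‖W l‖) :=
            mul_le_mul h1 h2 (norm_nonneg _) (by positivity)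
        _ = 2 * Real.pi * (Fintype.card d : ℝ) * (‖W k‖ * ((r l * ‖W l‖) * aV (k - l))) := by ring
    exact Summable.of_norm_bounded (hΦsum.mul_left _) hΦle
  -- ### the convective coefficient as a series in `l = k − m`
  have hB : ∀ k p, mFourierCoeff (EuclideanSpace.complexify ∘ Torus.convect v w) k p =
      ∑' l, c k l * U l p := by
    intro k p
    rw [mFourierCoeff_convect_apply_eq_tsum hv hw k p,
      ← (Equiv.subLeft k).tsum_eq (fun m => (2 * Real.pi * Complex.I *
        ∑ j, (((k - m) j : ℤ) : ℂ) * V m j) * U (k - m) p)]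
    refine tsum_congr fun l => ?_
    simp only [Equiv.subLeft_apply, sub_sub_cancel, hc]
  -- the inner product `⟪ŵ(k), 𝓕((v·∇)w)(k)⟫ = ∑_l c(k,l) ⟪ŵ(k), ŵ(l)⟫`
  have hcUs : ∀ k p, Summable fun l => c k l * U l p := by
    intro k p
    refine Summable.of_norm_bounded ((ha₁s.mul_left (2 * Real.pi * (Fintype.card d : ℝ) *
      ∑' j, aV j))) fun l => ?_
    rw [norm_mul]
    calc ‖c k l‖ * ‖U l p‖ ≤ (2 * Real.pi * (Fintype.card d : ℝ) * (r l * aV (k - l))) * a l :=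
          mul_le_mul (hcle k l) (PiLp.norm_apply_le (U l) p) (norm_nonneg _) (by positivity)
      _ ≤ (2 * Real.pi * (Fintype.card d : ℝ) * (r l * ∑' j, aV j)) * a l := by
          gcongr
          exact hAVle (k - l)
      _ = 2 * Real.pi * (Fintype.card d : ℝ) * (∑' j, aV j) * (r l * a l) := by ring
  have hinner : ∀ k, inner ℂ (U k) (mFourierCoeff (EuclideanSpace.complexify ∘ Torus.convect v w) k) =
      ∑' l, c k l * inner ℂ (U k) (U l) := by
    intro k
    rw [PiLp.inner_apply]
    simp_rw [RCLike.inner_apply', hB k]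
    rw [show (∑ p, conj (U k p) * ∑' l, c k l * U l p) = ∑ p, ∑' l, conj (U k p) * (c k l * U l p)
      from Finset.sum_congr rfl fun p _ => (tsum_mul_left).symm]
    rw [← Summable.tsum_finsetSum fun p _ => (hcUs k p).mul_left _]
    refine tsum_congr fun l => ?_
    rw [PiLp.inner_apply, Finset.mul_sum]
    exact Finset.sum_congr rfl fun p _ => by rw [RCLike.inner_apply']; ring
  -- ### the termwise splitting `|k|^{2s} Re⟪B̂(k), ŵ(k)⟫ = Re ∑_l E(k,l) + Re ∑_l Φ(k,l)`
  have hEfib : ∀ k, Summable fun l => E (k, l) := fun k => hEs.prod_factor k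
  have hΦfib : ∀ k, Summable fun l => Φ (k, l) := fun k => hΦs.prod_factor k
  have hsplit : ∀ k, freqNormSq k ^ s *
      (inner ℂ (mFourierCoeff (EuclideanSpace.complexify ∘ Torus.convect v w) k) (U k)).re =
      (∑' l, E (k, l)).re + (∑' l, Φ (k, l)).re := by
    intro k
    have hsym : (inner ℂ (mFourierCoeff (EuclideanSpace.complexify ∘ Torus.convect v w) k)
        (U k)).re = (inner ℂ (U k)
          (mFourierCoeff (EuclideanSpace.complexify ∘ Torus.convect v w) k)).re := by
      rw [← inner_conj_symm, Complex.conj_re]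
    rw [hsym, hinner k, ← Complex.re_ofReal_mul, ← Complex.add_re,
      ← (hEfib k).tsum_add (hΦfib k), ← tsum_mul_left]
    congr 1
    refine tsum_congr fun l => ?_
    simp only [hE, hΦ, hW, hc]
    rw [inner_smul_left, inner_smul_right, Complex.conj_ofReal, ← hρsq k]
    push_cast
    ring
  -- ### summation over `k`
  have hGfib : ∀ k, Summable fun l => G (k, l) := fun k => hGs.prod_factor k
  have hEre_le : ∀ k, ‖(∑' l, E (k, l)).re‖ ≤ ∑' l, G (k, l) := fun k => by
    rw [Real.norm_eq_abs]
    calc |(∑' l, E (k, l)).re| ≤ ‖∑' l, E (k, l)‖ := Complex.abs_re_le_norm _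
      _ ≤ ∑' l, ‖E (k, l)‖ := norm_tsum_le_tsum_norm (hEfib k).norm
      _ ≤ ∑' l, G (k, l) := (hEfib k).norm.tsum_le_tsum (fun l => hEle (k, l)) (hGfib k)
  have hEre_s : Summable fun k => (∑' l, E (k, l)).re :=
    Summable.of_norm_bounded hGs.prod hEre_le
  have hΦre_s : Summable fun k => (∑' l, Φ (k, l)).re := (Complex.hasSum_re hΦs.prod.hasSum).summable
  -- the `Φ` part vanishes (cancellation; only the transversality of `v̂` is used)
  have hΦzero : ∑' k, (∑' l, Φ (k, l)).re = 0 := by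
    rw [← Complex.re_tsum hΦs.prod]
    exact re_tsum_tsum_latticeConvect_eq_zero (W := W)
      (fun m => IsDivFree.sum_mul_mFourierCoeff_eq_zero hv hdiv m)
      (isConjSymm_mFourierCoeff hv.integrable) hΦsum
  -- ### Morosi–Pizzocchero's Steps 3–4: the sharp bound on the commutator family `E`
  set κ : (d → ℤ) → (d → ℤ) → ℝ := fun k h =>
    (freqNormSq h * freqNormSq k - (∑ j, (h j : ℝ) * (k j : ℝ)) ^ 2) *
      (freqNormSq k ^ (s / 2) - freqNormSq (k - h) ^ (s / 2)) ^ 2 /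
      (freqNormSq h ^ (s + 1) * freqNormSq (k - h) ^ s) with hκ
  -- the Gram determinant is nonnegative
  have hD0 : ∀ k h : d → ℤ, 0 ≤ freqNormSq h * freqNormSq k - (∑ j, (h j : ℝ) * (k j : ℝ)) ^ 2 := by
    intro k h
    have h1 := norm_sum_mul_le_sqrt_gram_of_orthogonal h k 0 (by simp)
    -- direct: Cauchy–Schwarz on `ℝ^d`
    have hCS := Real.sum_mul_le_sqrt_mul_sqrt Finset.univ (fun j => (h j : ℝ)) (fun j => (k j : ℝ))
    have hCS' := Real.sum_mul_le_sqrt_mul_sqrt Finset.univ (fun j => -(h j : ℝ)) (fun j => (k j : ℝ))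
    have hfk : freqNormSq k = ∑ j, (k j : ℝ) ^ 2 := by simp [freqNormSq]
    have hfh : freqNormSq h = ∑ j, (h j : ℝ) ^ 2 := by simp [freqNormSq]
    have e : Real.sqrt (∑ j, (h j : ℝ) ^ 2) * Real.sqrt (∑ j, (k j : ℝ) ^ 2) =
        Real.sqrt (freqNormSq h * freqNormSq k) := by
      rw [hfh, hfk, Real.sqrt_mul (Finset.sum_nonneg fun j _ => sq_nonneg _)]
    simp only [neg_sq, neg_mul, Finset.sum_neg_distrib] at hCS'
    rw [e] at hCS hCS'
    have hP : 0 ≤ freqNormSq h * freqNormSq k := mul_nonneg (freqNormSq_nonneg h) (freqNormSq_nonneg k)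
    have hab : |∑ j, (h j : ℝ) * (k j : ℝ)| ≤ Real.sqrt (freqNormSq h * freqNormSq k) :=
      abs_le.2 ⟨by linarith, hCS⟩
    have := Real.sq_sqrt hP
    nlinarith [abs_nonneg (∑ j, (h j : ℝ) * (k j : ℝ)), sq_abs (∑ j, (h j : ℝ) * (k j : ℝ))]
  have hκ0 : ∀ k h, 0 ≤ κ k h := fun k h =>
    div_nonneg (mul_nonneg (hD0 k h) (sq_nonneg _))
      (mul_nonneg (Real.rpow_nonneg (freqNormSq_nonneg h) _) (Real.rpow_nonneg (freqNormSq_nonneg _) _))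
  -- the termwise sharp bound `‖E(k,l)‖ ≤ 2π b_k √κ(k,k−l) bV(k−l) b_l`
  have hEsharp : ∀ k l, ‖E (k, l)‖ ≤
      2 * Real.pi * b k * (Real.sqrt (κ k (k - l)) * (bV (k - l) * b l)) := by
    intro k l
    have hRHS0 : ∀ l', 0 ≤ 2 * Real.pi * b k * (Real.sqrt (κ k (k - l')) * (bV (k - l') * b l')) :=
      fun l' => mul_nonneg (mul_nonneg (by positivity) (hb0 k))
        (mul_nonneg (Real.sqrt_nonneg _) (mul_nonneg (hbV0 _) (hb0 l')))
    simp only [hE]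
    rw [norm_mul, norm_mul, Complex.norm_real, Real.norm_eq_abs, abs_mul, abs_of_nonneg (hρ0 k)]
    by_cases hkl : k - l = 0
    · -- `l = k`: the commutator weight vanishes
      have hl : l = k := (sub_eq_zero.1 hkl).symm
      have h0 : ρ k - ρ l = 0 := by rw [hl, sub_self]
      rw [h0, abs_zero, mul_zero, mul_zero, zero_mul]
      exact hRHS0 l
    by_cases hl0 : l = 0
    · -- `l = 0`: the symbol vanishes
      subst hl0
      have hc0 : c k 0 = 0 := by
        simp only [hc]
        simp
      rw [hc0, norm_zero, zero_mul, zero_mul]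
      exact hRHS0 0
    -- the generic term: `h = k − l ≠ 0`, `l ≠ 0`
    have hH : 0 < freqNormSq (k - l) := lt_of_lt_of_le one_pos (one_le_freqNormSq_of_ne_zero hkl)
    have hL : 0 < freqNormSq l := lt_of_lt_of_le one_pos (one_le_freqNormSq_of_ne_zero hl0)
    have hρl : 0 < ρ l := Real.rpow_pos_of_pos hL _
    have hρh : 0 < ρ (k - l) := Real.rpow_pos_of_pos hH _
    have hrh : 0 < Real.sqrt (freqNormSq (k - l)) := Real.sqrt_pos.2 hH
    -- `|l · v̂(h)| = |k · v̂(h)| ≤ √D ‖v̂(h)‖ / |h|` (`h · v̂(h) = 0`, Lemma 4.1)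
    have hz : ∑ j, (((k - l) j : ℤ) : ℂ) * V (k - l) j = 0 :=
      IsDivFree.sum_mul_mFourierCoeff_eq_zero hv hdiv (k - l)
    have hlk : ∑ j, ((l j : ℤ) : ℂ) * V (k - l) j = ∑ j, ((k j : ℤ) : ℂ) * V (k - l) j := by
      have h0 : ∑ j, ((k j : ℤ) : ℂ) * V (k - l) j - ∑ j, ((l j : ℤ) : ℂ) * V (k - l) j = 0 := by
        rw [← hz, ← Finset.sum_sub_distrib]
        refine Finset.sum_congr rfl fun j _ => ?_
        simp only [Pi.sub_apply, Int.cast_sub]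
        ring
      exact (sub_eq_zero.1 h0).symm
    set Dg : ℝ := freqNormSq (k - l) * freqNormSq k - (∑ j, ((k - l) j : ℝ) * (k j : ℝ)) ^ 2 with hDg
    have hDg0 : 0 ≤ Dg := hD0 k (k - l)
    have hgeo : ‖∑ j, ((k j : ℤ) : ℂ) * V (k - l) j‖ * Real.sqrt (freqNormSq (k - l)) ≤
        Real.sqrt Dg * aV (k - l) :=
      norm_sum_mul_le_sqrt_gram_of_orthogonal (k - l) k (V (k - l)) hz
    have hgeo' : ‖∑ j, ((k j : ℤ) : ℂ) * V (k - l) j‖ ≤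
        Real.sqrt Dg * aV (k - l) / Real.sqrt (freqNormSq (k - l)) := by
      rw [le_div_iff₀ hrh]; exact hgeo
    have hc_le : ‖c k l‖ ≤ 2 * Real.pi * (Real.sqrt Dg * aV (k - l) / Real.sqrt (freqNormSq (k - l))) := by
      simp only [hc]
      rw [norm_mul, h2π, hlk]
      exact mul_le_mul_of_nonneg_left hgeo' (by positivity)
    have h3 : ‖inner ℂ (U k) (U l)‖ ≤ a k * a l := norm_inner_le_norm _ _
    have hq0 : 0 ≤ Real.sqrt Dg * aV (k - l) / Real.sqrt (freqNormSq (k - l)) :=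
      div_nonneg (mul_nonneg (Real.sqrt_nonneg _) (haV0 _)) (Real.sqrt_nonneg _)
    have hmain : ‖c k l‖ * (ρ k * |ρ k - ρ l|) * ‖inner ℂ (U k) (U l)‖ ≤
        2 * Real.pi * (Real.sqrt Dg * aV (k - l) / Real.sqrt (freqNormSq (k - l))) *
          (ρ k * |ρ k - ρ l|) * (a k * a l) :=
      mul_le_mul (mul_le_mul_of_nonneg_right hc_le (mul_nonneg (hρ0 k) (abs_nonneg _))) h3
        (norm_nonneg _) (mul_nonneg (mul_nonneg (by positivity) hq0)
          (mul_nonneg (hρ0 k) (abs_nonneg _)))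
    refine hmain.trans (le_of_eq ?_)
    -- `√κ(k, k−l) = √D |ρ k − ρ l| / (|h| ρ(h) ρ(l))`
    have hkk : k - (k - l) = l := sub_sub_cancel k l
    have hκkl : κ k (k - l) = Dg * (ρ k - ρ l) ^ 2 / (freqNormSq (k - l) ^ (s + 1) * freqNormSq l ^ s) := by
      simp only [hκ, hρ, hkk, hDg]
    have hden : 0 < freqNormSq (k - l) ^ (s + 1) * freqNormSq l ^ s :=
      mul_pos (Real.rpow_pos_of_pos hH _) (Real.rpow_pos_of_pos hL _)
    have e1 : Real.sqrt (freqNormSq (k - l)) * ρ (k - l) * ρ l =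
        Real.sqrt (freqNormSq (k - l) ^ (s + 1) * freqNormSq l ^ s) := by
      rw [hρ]
      simp only
      rw [Real.sqrt_eq_rpow, Real.sqrt_eq_rpow, Real.mul_rpow (Real.rpow_nonneg hH.le _)
        (Real.rpow_nonneg hL.le _), ← Real.rpow_mul hH.le, ← Real.rpow_mul hL.le,
        ← Real.rpow_add hH]
      congr 1
      · congr 1; ring
      · congr 1; ring
    have hpos : 0 < Real.sqrt (freqNormSq (k - l)) * ρ (k - l) * ρ l := by positivity
    have hsqrtκ : Real.sqrt (κ k (k - l)) =
        Real.sqrt Dg * |ρ k - ρ l| / (Real.sqrt (freqNormSq (k - l)) * ρ (k - l) * ρ l) := by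
      rw [eq_div_iff hpos.ne', e1, hκkl, Real.sqrt_div' _ hden.le, Real.sqrt_mul hDg0,
        Real.sqrt_sq_eq_abs, div_mul_cancel₀ _ (Real.sqrt_pos.2 hden).ne']
    rw [hsqrtκ]
    simp only [hb, hbV]
    have hne1 : Real.sqrt (freqNormSq (k - l)) ≠ 0 := hrh.ne'
    have hne2 : ρ (k - l) ≠ 0 := hρh.ne'
    have hne3 : ρ l ≠ 0 := hρl.ne'
    field_simp
  -- ### Step 4: summation, Cauchy–Schwarz in `h` and in `k`
  -- `𝒬_k = ∑_l bV(k−l)² b_l²`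
  have hBV2le : ∀ m, bV m ^ 2 ≤ XV := fun m => by
    rw [← hXVb]; exact hbV2s.le_tsum m fun j _ => sq_nonneg _
  have hQs : ∀ k, Summable fun l => bV (k - l) ^ 2 * b l ^ 2 := fun k =>
    (hb2s.mul_left XV).of_nonneg_of_le (fun l => mul_nonneg (sq_nonneg _) (sq_nonneg _))
      fun l => mul_le_mul_of_nonneg_right (hBV2le _) (sq_nonneg _)
  -- summability of `l ↦ κ(k, k−l)` from the bounded partial sums
  have hκs : ∀ k, Summable fun l => κ k (k - l) := by
    intro k
    refine summable_of_sum_le (fun l => hκ0 k (k - l)) (c := Gsq) fun L => ?_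
    have hinj : Set.InjOn (fun l => k - l) ↑L := fun x _ y _ hxy => by simpa using hxy
    rw [← Finset.sum_image (f := fun h => κ k h) hinj]
    exact hGker k _
  have hκtsum : ∀ k, ∑' l, κ k (k - l) ≤ Gsq := fun k =>
    Real.tsum_le_of_sum_le (fun l => hκ0 k (k - l)) fun L => by
      have hinj : Set.InjOn (fun l => k - l) ↑L := fun x _ y _ hxy => by simpa using hxy
      rw [← Finset.sum_image (f := fun h => κ k h) hinj]
      exact hGker k _
  -- per-`k` bound: `∑_l ‖E(k,l)‖ ≤ 2π √Gsq b_k √𝒬_k`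
  have hTk : ∀ k, ∑' l, ‖E (k, l)‖ ≤
      2 * Real.pi * Real.sqrt Gsq * (b k * Real.sqrt (∑' l, bV (k - l) ^ 2 * b l ^ 2)) := by
    intro k
    have hy0 : ∀ l, 0 ≤ bV (k - l) ^ 2 * b l ^ 2 := fun l => mul_nonneg (sq_nonneg _) (sq_nonneg _)
    obtain ⟨hsum1, hcs1⟩ := kp_tsum_sqrt_mul_sqrt_le (fun l => hκ0 k (k - l)) hy0 (hκs k) (hQs k)
    have hsq : ∀ l, Real.sqrt (bV (k - l) ^ 2 * b l ^ 2) = bV (k - l) * b l := fun l => by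
      rw [Real.sqrt_mul' _ (sq_nonneg _), Real.sqrt_sq (hbV0 _), Real.sqrt_sq (hb0 _)]
    simp_rw [hsq] at hsum1 hcs1
    have h1 : ∑' l, ‖E (k, l)‖ ≤ ∑' l, 2 * Real.pi * b k * (Real.sqrt (κ k (k - l)) * (bV (k - l) * b l)) :=
      (hEs.prod_factor k).norm.tsum_le_tsum (fun l => hEsharp k l) (hsum1.mul_left _)
    rw [tsum_mul_left] at h1
    have h2 : Real.sqrt (∑' l, κ k (k - l)) ≤ Real.sqrt Gsq := Real.sqrt_le_sqrt (hκtsum k)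
    calc ∑' l, ‖E (k, l)‖ ≤ 2 * Real.pi * b k * ∑' l, Real.sqrt (κ k (k - l)) * (bV (k - l) * b l) := h1
      _ ≤ 2 * Real.pi * b k * (Real.sqrt (∑' l, κ k (k - l)) *
            Real.sqrt (∑' l, bV (k - l) ^ 2 * b l ^ 2)) :=
          mul_le_mul_of_nonneg_left hcs1 (by have := hb0 k; positivity)
      _ ≤ 2 * Real.pi * b k * (Real.sqrt Gsq * Real.sqrt (∑' l, bV (k - l) ^ 2 * b l ^ 2)) :=
          mul_le_mul_of_nonneg_left (mul_le_mul_of_nonneg_right h2 (Real.sqrt_nonneg _))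
            (by have := hb0 k; positivity)
      _ = 2 * Real.pi * Real.sqrt Gsq * (b k * Real.sqrt (∑' l, bV (k - l) ^ 2 * b l ^ 2)) := by ring
  -- finite partial sums of `𝒬_k` are at most `XV · X`
  have hQK : ∀ K : Finset (d → ℤ), ∑ k ∈ K, ∑' l, bV (k - l) ^ 2 * b l ^ 2 ≤ XV * X := by
    intro K
    rw [← Summable.tsum_finsetSum (fun k _ => hQs k)]
    have hin : ∀ l, ∑ k ∈ K, bV (k - l) ^ 2 * b l ^ 2 ≤ XV * b l ^ 2 := by
      intro l
      rw [← Finset.sum_mul]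
      refine mul_le_mul_of_nonneg_right ?_ (sq_nonneg _)
      have hinj : Set.InjOn (fun k => k - l) ↑K := fun x _ y _ hxy => by simpa using hxy
      rw [← Finset.sum_image (f := fun m => bV m ^ 2) hinj, ← hXVb]
      exact hbV2s.sum_le_tsum _ fun m _ => sq_nonneg _
    calc ∑' l, ∑ k ∈ K, bV (k - l) ^ 2 * b l ^ 2 ≤ ∑' l, XV * b l ^ 2 :=
          (summable_sum fun k _ => hQs k).tsum_le_tsum hin (hb2s.mul_left XV)
      _ = XV * X := by rw [tsum_mul_left, hXb]
  -- Cauchy–Schwarz in `k` on finite partial sums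
  have hbQ : ∀ K : Finset (d → ℤ), ∑ k ∈ K, b k * Real.sqrt (∑' l, bV (k - l) ^ 2 * b l ^ 2) ≤
      Real.sqrt X * Real.sqrt (XV * X) := by
    intro K
    have h1 := Real.sum_mul_le_sqrt_mul_sqrt K b (fun k => Real.sqrt (∑' l, bV (k - l) ^ 2 * b l ^ 2))
    have h2 : ∑ k ∈ K, Real.sqrt (∑' l, bV (k - l) ^ 2 * b l ^ 2) ^ 2 =
        ∑ k ∈ K, ∑' l, bV (k - l) ^ 2 * b l ^ 2 :=
      Finset.sum_congr rfl fun k _ => Real.sq_sqrt (tsum_nonneg fun l =>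
        mul_nonneg (sq_nonneg _) (sq_nonneg _))
    rw [h2] at h1
    refine h1.trans (mul_le_mul ?_ (Real.sqrt_le_sqrt (hQK K)) (Real.sqrt_nonneg _) (Real.sqrt_nonneg _))
    rw [← hXb]
    exact Real.sqrt_le_sqrt (hb2s.sum_le_tsum K fun m _ => sq_nonneg _)
  have hTsum : ∑' k, ∑' l, ‖E (k, l)‖ ≤ 2 * Real.pi * Real.sqrt Gsq * (Real.sqrt X * Real.sqrt (XV * X)) := by
    refine Real.tsum_le_of_sum_le (fun k => tsum_nonneg fun l => norm_nonneg _) fun K => ?_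
    calc ∑ k ∈ K, ∑' l, ‖E (k, l)‖
        ≤ ∑ k ∈ K, 2 * Real.pi * Real.sqrt Gsq * (b k * Real.sqrt (∑' l, bV (k - l) ^ 2 * b l ^ 2)) :=
          Finset.sum_le_sum fun k _ => hTk k
      _ = 2 * Real.pi * Real.sqrt Gsq * ∑ k ∈ K, b k * Real.sqrt (∑' l, bV (k - l) ^ 2 * b l ^ 2) := by
          rw [Finset.mul_sum]
      _ ≤ 2 * Real.pi * Real.sqrt Gsq * (Real.sqrt X * Real.sqrt (XV * X)) :=
          mul_le_mul_of_nonneg_left (hbQ K) (by positivity)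
  -- ### conclusion
  have hEre_le' : ∀ k, ‖(∑' l, E (k, l)).re‖ ≤ ∑' l, ‖E (k, l)‖ := fun k => by
    rw [Real.norm_eq_abs]
    exact (Complex.abs_re_le_norm _).trans (norm_tsum_le_tsum_norm (hEfib k).norm)
  rw [tsum_congr hsplit, hEre_s.tsum_add hΦre_s, hΦzero, add_zero]
  have hXX : Real.sqrt X * Real.sqrt (XV * X) = Real.sqrt XV * X := by
    rw [Real.sqrt_mul hXV0, ← mul_assoc, mul_comm (Real.sqrt X), mul_assoc, Real.mul_self_sqrt hX0]
  calc |∑' k, (∑' l, E (k, l)).re| ≤ ∑' k, ‖(∑' l, E (k, l)).re‖ := by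
        rw [← Real.norm_eq_abs]
        exact norm_tsum_le_tsum_norm hEre_s.norm
    _ ≤ ∑' k, ∑' l, ‖E (k, l)‖ := hEre_s.norm.tsum_le_tsum hEre_le' hEs.norm.prod
    _ ≤ 2 * Real.pi * Real.sqrt Gsq * (Real.sqrt X * Real.sqrt (XV * X)) := hTsum
    _ = 2 * Real.pi * Real.sqrt Gsq * Real.sqrt XV * X := by rw [hXX]; ring

/-! ### §4 The elementary evaluation `sup 𝒢_s ≤ s² 2^{2s−2} ζ_{2s−2}` (Morosi–Pernici–Pizzocchero
2017) and the hypothesis-free form of the sharp-functional Kato inequality -/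

omit [Fintype d] [DecidableEq d] in
/-- `a^p − b^p ≤ p a^{p−1} (a − b)` for `0 ≤ b ≤ a` and `p ≥ 1` (Bernoulli's inequality; the
private helper of `TorusNSSobolevCommutator`, re-proved). [folklore] -/
private theorem kp_rpow_sub_rpow_le_of_le {a b p : ℝ} (hb : 0 ≤ b) (hab : b ≤ a) (hp : 1 ≤ p) :
    a ^ p - b ^ p ≤ p * a ^ (p - 1) * (a - b) := by
  rcases eq_or_lt_of_le (hb.trans hab) with ha | ha
  · -- `a = 0`, hence `b = 0`
    have hb0 : b = 0 := le_antisymm (ha ▸ hab) hb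
    rw [← ha, hb0]
    simp
  · -- Bernoulli with `x = b/a − 1 ≥ −1`
    have hx : -1 ≤ b / a - 1 := by
      have : 0 ≤ b / a := div_nonneg hb ha.le
      linarith
    have hB := one_add_mul_self_le_rpow_one_add hx hp
    rw [show 1 + (b / a - 1) = b / a by ring, Real.div_rpow hb ha.le] at hB
    have has : 0 < a ^ p := Real.rpow_pos_of_pos ha _
    have h1 : a ^ p * (1 + p * (b / a - 1)) ≤ b ^ p := by
      have := mul_le_mul_of_nonneg_left hB has.le
      rwa [mul_div_cancel₀ _ has.ne'] at this
    have e : a ^ p * (1 + p * (b / a - 1)) = a ^ p - p * a ^ (p - 1) * (a - b) := by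
      rw [Real.rpow_sub ha, Real.rpow_one]
      field_simp
      ring
    linarith [e ▸ h1]

omit [Fintype d] [DecidableEq d] in
/-- **Morosi–Pernici–Pizzocchero's Lemma 4.1** (the elementary inequality behind their proof of
the (tame) Kato inequality, "very similar to some relations presented in [CoFo] [Tem]"):
"`||b|^p − |a|^p| ≤ p |b − a| max(|b|, |a|)^{p−1}`" (`p ≥ 1`, `a, b ∈ ℝ^d`) — here in the scalar
form it is used in, for nonnegative reals `a, b`: `|a^p − b^p| ≤ p |a − b| max(a, b)^{p−1}`.
[cite: MorosiPerniciPizzocchero2017, Lemma 4.1] -/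
theorem abs_rpow_sub_rpow_le_mul_max_rpow {a b p : ℝ} (ha : 0 ≤ a) (hb : 0 ≤ b) (hp : 1 ≤ p) :
    |a ^ p - b ^ p| ≤ p * |a - b| * max a b ^ (p - 1) := by
  rcases le_total b a with hba | hab
  · have h := kp_rpow_sub_rpow_le_of_le hb hba hp
    have h0 : 0 ≤ a ^ p - b ^ p := sub_nonneg.2 (Real.rpow_le_rpow hb hba (by linarith))
    rw [abs_of_nonneg h0, abs_of_nonneg (sub_nonneg.2 hba), max_eq_left hba]
    calc a ^ p - b ^ p ≤ p * a ^ (p - 1) * (a - b) := h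
      _ = p * (a - b) * a ^ (p - 1) := by ring
  · have h := kp_rpow_sub_rpow_le_of_le ha hab hp
    have h0 : 0 ≤ b ^ p - a ^ p := sub_nonneg.2 (Real.rpow_le_rpow ha hab (by linarith))
    rw [abs_sub_comm, abs_of_nonneg h0, abs_sub_comm, abs_of_nonneg (sub_nonneg.2 hab),
      max_eq_right hab]
    calc b ^ p - a ^ p ≤ p * b ^ (p - 1) * (b - a) := h
      _ = p * (b - a) * b ^ (p - 1) := by ring

omit [DecidableEq d] in
/-- Lattice form of Lemma 4.1, squared and split as in MPP's proof of Prop. 4.2 ("with `b = k`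
and `a = k − h`", then `max(|k|, |k−h|) ≤ |k−h| + |h|` and
`(x + y)^{2p−2} ≤ 2^{2p−3}(x^{2p−2} + y^{2p−2})`): for `s ≥ 3/2` and `k, h ∈ ℤ^n`,
`(|k|^s − |k−h|^s)² ≤ s² 2^{2s−3} |h|² (|h|^{2s−2} + |k−h|^{2s−2})`, `|m|^{2t} = (freqNormSq m)^t`.
[cite: MorosiPerniciPizzocchero2017, Lemma 4.1 and the proof of Prop. 4.2] -/
private theorem kp_sq_rpow_sub_rpow_le {s : ℝ} (hs : 3 / 2 ≤ s) (k h : d → ℤ) :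
    (freqNormSq k ^ (s / 2) - freqNormSq (k - h) ^ (s / 2)) ^ 2 ≤
      s ^ 2 * (2 : ℝ) ^ (2 * s - 3) * freqNormSq h *
        (freqNormSq h ^ (s - 1) + freqNormSq (k - h) ^ (s - 1)) := by
  set x : ℝ := Real.sqrt (freqNormSq k) with hx
  set y : ℝ := Real.sqrt (freqNormSq (k - h)) with hy
  set z : ℝ := Real.sqrt (freqNormSq h) with hz
  have hx0 : 0 ≤ x := Real.sqrt_nonneg _
  have hy0 : 0 ≤ y := Real.sqrt_nonneg _
  have hz0 : 0 ≤ z := Real.sqrt_nonneg _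
  have hpow : ∀ (m : d → ℤ) (t : ℝ), freqNormSq m ^ (t / 2) = Real.sqrt (freqNormSq m) ^ t := by
    intro m t
    rw [Real.sqrt_eq_rpow, ← Real.rpow_mul (freqNormSq_nonneg m)]
    congr 1
    ring
  have e1 : freqNormSq k ^ (s / 2) = x ^ s := hpow k s
  have e2 : freqNormSq (k - h) ^ (s / 2) = y ^ s := hpow (k - h) s
  have e3 : freqNormSq h = z ^ 2 := (Real.sq_sqrt (freqNormSq_nonneg h)).symm
  have e4 : freqNormSq h ^ (s - 1) = z ^ (2 * s - 2) := by
    have h1 := hpow h (2 * s - 2)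
    rwa [show (2 * s - 2) / 2 = s - 1 by ring] at h1
  have e5 : freqNormSq (k - h) ^ (s - 1) = y ^ (2 * s - 2) := by
    have h1 := hpow (k - h) (2 * s - 2)
    rwa [show (2 * s - 2) / 2 = s - 1 by ring] at h1
  rw [e1, e2, e4, e5, e3]
  -- the two triangle inequalities `x ≤ z + y`, `y ≤ z + x`
  have htri1 : x ≤ z + y := by
    have h1 := sqrt_freqNormSq_add_le h (k - h)
    rwa [add_sub_cancel] at h1
  have htri2 : y ≤ z + x := by
    have h1 := sqrt_freqNormSq_add_le (-h) k
    rwa [neg_add_eq_sub, freqNormSq_neg] at h1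
  have habs : |x - y| ≤ z := abs_sub_le_iff.2 ⟨by linarith, by linarith⟩
  have hmax : max x y ≤ y + z := max_le (by linarith) (by linarith)
  have hmax0 : 0 ≤ max x y := hx0.trans (le_max_left _ _)
  have hms0 : 0 ≤ max x y ^ (s - 1) := Real.rpow_nonneg hmax0 _
  have hs0 : 0 ≤ s := by linarith
  -- Lemma 4.1
  have h1 : |x ^ s - y ^ s| ≤ s * |x - y| * max x y ^ (s - 1) :=
    abs_rpow_sub_rpow_le_mul_max_rpow hx0 hy0 (by linarith)
  have h2 : |x ^ s - y ^ s| ≤ s * z * max x y ^ (s - 1) :=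
    h1.trans (mul_le_mul_of_nonneg_right (mul_le_mul_of_nonneg_left habs hs0) hms0)
  have h3 : (x ^ s - y ^ s) ^ 2 ≤ (s * z * max x y ^ (s - 1)) ^ 2 := by
    rw [← sq_abs (x ^ s - y ^ s)]
    exact pow_le_pow_left₀ (abs_nonneg _) h2 2
  have h4 : (max x y ^ (s - 1)) ^ 2 = max x y ^ (2 * s - 2) := by
    rw [← Real.rpow_natCast, ← Real.rpow_mul hmax0]
    congr 1
    push_cast
    ring
  -- `max(x, y)^{2s−2} ≤ (y + z)^{2s−2} ≤ 2^{2s−3}(y^{2s−2} + z^{2s−2})`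
  have h5 : max x y ^ (2 * s - 2) ≤ (y + z) ^ (2 * s - 2) :=
    Real.rpow_le_rpow hmax0 hmax (by linarith)
  have h6 : (y + z) ^ (2 * s - 2) ≤ (2 : ℝ) ^ (2 * s - 2 - 1) * (y ^ (2 * s - 2) + z ^ (2 * s - 2)) :=
    kp_add_rpow_le hy0 hz0 (by linarith)
  have e6 : (2 * s - 2 - 1 : ℝ) = 2 * s - 3 := by ring
  rw [e6] at h6
  calc (x ^ s - y ^ s) ^ 2 ≤ (s * z * max x y ^ (s - 1)) ^ 2 := h3
    _ = s ^ 2 * z ^ 2 * max x y ^ (2 * s - 2) := by rw [← h4]; ring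
    _ ≤ s ^ 2 * z ^ 2 * ((2 : ℝ) ^ (2 * s - 3) * (y ^ (2 * s - 2) + z ^ (2 * s - 2))) :=
        mul_le_mul_of_nonneg_left (h5.trans h6) (by positivity)
    _ = s ^ 2 * (2 : ℝ) ^ (2 * s - 3) * z ^ 2 * (z ^ (2 * s - 2) + y ^ (2 * s - 2)) := by ring

omit [DecidableEq d] in
/-- `|h ∧ k|² = |h ∧ (k − h)|² ≤ |h|² |k − h|²` on the lattice (`h ∧ h = 0` and Cauchy–Schwarz),
with `|h ∧ k|² = |h|²|k|² − (h·k)²`. [folklore] -/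
private theorem kp_gram_le (k h : d → ℤ) :
    freqNormSq h * freqNormSq k - (∑ j, (h j : ℝ) * (k j : ℝ)) ^ 2 ≤
      freqNormSq h * freqNormSq (k - h) := by
  have hfk : freqNormSq k = ∑ j, (k j : ℝ) ^ 2 := by simp [freqNormSq]
  have hfh : freqNormSq h = ∑ j, (h j : ℝ) ^ 2 := by simp [freqNormSq]
  have hfkh : freqNormSq (k - h) = (∑ j, (k j : ℝ) ^ 2) - 2 * (∑ j, (h j : ℝ) * (k j : ℝ)) +
      ∑ j, (h j : ℝ) ^ 2 := by
    have e : ∀ j, (((k - h) j : ℤ) : ℝ) ^ 2 =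
        (k j : ℝ) ^ 2 - 2 * ((h j : ℝ) * (k j : ℝ)) + (h j : ℝ) ^ 2 := fun j => by
      simp only [Pi.sub_apply, Int.cast_sub]
      ring
    simp only [freqNormSq, e, Finset.sum_add_distrib, Finset.sum_sub_distrib, ← Finset.mul_sum]
  rw [hfk, hfh, hfkh]
  nlinarith [sq_nonneg ((∑ j, (h j : ℝ) ^ 2) - ∑ j, (h j : ℝ) * (k j : ℝ)),
    Finset.sum_nonneg (fun j (_ : j ∈ Finset.univ) => sq_nonneg (h j : ℝ))]

omit [DecidableEq d] in
/-- The termwise bound of MPP's proof of Prop. 4.2, for the functional `𝒢_s` of §3 (whose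
denominator is exactly `|h|^{2s+2}|k−h|^{2s}`):
`|h ∧ k|² (|k|^s − |k−h|^s)² / (|h|^{2s+2}|k−h|^{2s}) ≤ s² 2^{2s−3} (|h|^{2−2s} + |k−h|^{2−2s})`
for `h ∉ {0, k}`; the left side vanishes at `h = 0` and `h = k`.
[cite: MorosiPerniciPizzocchero2017, proof of Prop. 4.2] -/
private theorem kp_kernel_term_le {s : ℝ} (hs : 3 / 2 ≤ s) (k h : d → ℤ) :
    (freqNormSq h * freqNormSq k - (∑ j, (h j : ℝ) * (k j : ℝ)) ^ 2) *
        (freqNormSq k ^ (s / 2) - freqNormSq (k - h) ^ (s / 2)) ^ 2 /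
        (freqNormSq h ^ (s + 1) * freqNormSq (k - h) ^ s) ≤
      s ^ 2 * (2 : ℝ) ^ (2 * s - 3) *
        ((if h = 0 then (0 : ℝ) else freqNormSq h ^ (-(s - 1))) +
          (if k - h = 0 then (0 : ℝ) else freqNormSq (k - h) ^ (-(s - 1)))) := by
  have hR0 : 0 ≤ s ^ 2 * (2 : ℝ) ^ (2 * s - 3) *
      ((if h = 0 then (0 : ℝ) else freqNormSq h ^ (-(s - 1))) +
        (if k - h = 0 then (0 : ℝ) else freqNormSq (k - h) ^ (-(s - 1)))) := by
    refine mul_nonneg (by positivity) (add_nonneg ?_ ?_)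
    · split_ifs
      · exact le_rfl
      · exact Real.rpow_nonneg (freqNormSq_nonneg _) _
    · split_ifs
      · exact le_rfl
      · exact Real.rpow_nonneg (freqNormSq_nonneg _) _
  by_cases hh : h = 0
  · -- the Gram factor vanishes
    have h0 : freqNormSq h * freqNormSq k - (∑ j, (h j : ℝ) * (k j : ℝ)) ^ 2 = 0 := by
      subst hh
      simp [freqNormSq_zero]
    rw [h0, zero_mul, zero_div]
    exact hR0
  by_cases hkh : k - h = 0
  · -- the denominator vanishes
    have h0 : freqNormSq h ^ (s + 1) * freqNormSq (k - h) ^ s = 0 := by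
      rw [hkh, freqNormSq_zero, Real.zero_rpow (by linarith : s ≠ 0), mul_zero]
    rw [h0, div_zero]
    exact hR0
  -- the generic term
  rw [if_neg hh, if_neg hkh]
  have hH : 0 < freqNormSq h := lt_of_lt_of_le one_pos (one_le_freqNormSq_of_ne_zero hh)
  have hK : 0 < freqNormSq (k - h) := lt_of_lt_of_le one_pos (one_le_freqNormSq_of_ne_zero hkh)
  have hgram := kp_gram_le k h
  have hdiff := kp_sq_rpow_sub_rpow_le hs k h
  set A : ℝ := freqNormSq h ^ (s - 1) with hA
  set B : ℝ := freqNormSq (k - h) ^ (s - 1) with hB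
  have hA0 : 0 < A := Real.rpow_pos_of_pos hH _
  have hB0 : 0 < B := Real.rpow_pos_of_pos hK _
  have eA : freqNormSq h ^ (s + 1) = freqNormSq h ^ 2 * A := by
    have e : freqNormSq h ^ (s + 1) = freqNormSq h ^ ((2 : ℝ) + (s - 1)) := by
      congr 1; ring
    rw [e, Real.rpow_add hH, Real.rpow_two]
  have eB : freqNormSq (k - h) ^ s = freqNormSq (k - h) * B := by
    have e : freqNormSq (k - h) ^ s = freqNormSq (k - h) ^ ((1 : ℝ) + (s - 1)) := by
      congr 1; ring
    rw [e, Real.rpow_add hK, Real.rpow_one]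
  have eA' : freqNormSq h ^ (-(s - 1)) = A⁻¹ := by rw [hA, Real.rpow_neg hH.le]
  have eB' : freqNormSq (k - h) ^ (-(s - 1)) = B⁻¹ := by rw [hB, Real.rpow_neg hK.le]
  have hden : 0 < freqNormSq h ^ 2 * A * (freqNormSq (k - h) * B) := by positivity
  rw [eA, eB, eA', eB', div_le_iff₀ hden]
  have hD0 : 0 ≤ freqNormSq h * freqNormSq k - (∑ j, (h j : ℝ) * (k j : ℝ)) ^ 2 := by
    -- Cauchy–Schwarz on `ℝ^d`
    have hCS := Real.sum_mul_le_sqrt_mul_sqrt Finset.univ (fun j => (h j : ℝ)) (fun j => (k j : ℝ))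
    have hCS' := Real.sum_mul_le_sqrt_mul_sqrt Finset.univ (fun j => -(h j : ℝ)) (fun j => (k j : ℝ))
    have hfk : freqNormSq k = ∑ j, (k j : ℝ) ^ 2 := by simp [freqNormSq]
    have hfh : freqNormSq h = ∑ j, (h j : ℝ) ^ 2 := by simp [freqNormSq]
    have e : Real.sqrt (∑ j, (h j : ℝ) ^ 2) * Real.sqrt (∑ j, (k j : ℝ) ^ 2) =
        Real.sqrt (freqNormSq h * freqNormSq k) := by
      rw [hfh, hfk, Real.sqrt_mul (Finset.sum_nonneg fun j _ => sq_nonneg _)]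
    simp only [neg_sq, neg_mul, Finset.sum_neg_distrib] at hCS'
    rw [e] at hCS hCS'
    have hP : 0 ≤ freqNormSq h * freqNormSq k := mul_nonneg (freqNormSq_nonneg h) (freqNormSq_nonneg k)
    have hab : |∑ j, (h j : ℝ) * (k j : ℝ)| ≤ Real.sqrt (freqNormSq h * freqNormSq k) :=
      abs_le.2 ⟨by linarith, hCS⟩
    have := Real.sq_sqrt hP
    nlinarith [abs_nonneg (∑ j, (h j : ℝ) * (k j : ℝ)), sq_abs (∑ j, (h j : ℝ) * (k j : ℝ))]
  calc (freqNormSq h * freqNormSq k - (∑ j, (h j : ℝ) * (k j : ℝ)) ^ 2) *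
        (freqNormSq k ^ (s / 2) - freqNormSq (k - h) ^ (s / 2)) ^ 2
      ≤ (freqNormSq h * freqNormSq (k - h)) *
          (s ^ 2 * (2 : ℝ) ^ (2 * s - 3) * freqNormSq h * (A + B)) :=
        mul_le_mul hgram hdiff (sq_nonneg _) (by positivity)
    _ = s ^ 2 * (2 : ℝ) ^ (2 * s - 3) * (A⁻¹ + B⁻¹) *
          (freqNormSq h ^ 2 * A * (freqNormSq (k - h) * B)) := by
        field_simp
        ring

omit [DecidableEq d] in
/-- The punctured lattice `p`-series `∑_{k≠0} |k|^{-2t}` converges for `2t > n`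
(`|k|^{-2t} ≤ 2^t (1+|k|²)^{-t}` off the origin; as in `TorusNSSobolevControlInequality`).
[folklore] -/
private theorem kp_summable_ite_freqNormSq_rpow_neg {t : ℝ} (ht : (Fintype.card d : ℝ) < 2 * t) :
    Summable fun k : d → ℤ => if k = 0 then (0 : ℝ) else freqNormSq k ^ (-t) := by
  classical
  have ht0 : 0 ≤ t := by
    have : (0 : ℝ) ≤ Fintype.card d := Nat.cast_nonneg _
    linarith
  rcases isEmpty_or_nonempty d with hd | hd
  · refine summable_of_ne_finset_zero (s := ∅) fun k _ => ?_
    rw [if_pos (Subsingleton.elim k 0)]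
  have hmaj := (summable_one_add_freqNormSq_rpow_neg (d := d) ht).mul_left ((2 : ℝ) ^ t)
  refine Summable.of_nonneg_of_le (fun k => ?_) (fun k => ?_) hmaj
  · split_ifs
    · exact le_rfl
    · exact Real.rpow_nonneg (freqNormSq_nonneg k) _
  · split_ifs with hk
    · exact mul_nonneg (Real.rpow_nonneg (by norm_num) _)
        (Real.rpow_nonneg (by linarith [freqNormSq_nonneg k]) _)
    · have hm : 1 ≤ freqNormSq k := one_le_freqNormSq_of_ne_zero hk
      have hm0 : 0 < freqNormSq k := by linarith
      have h2 : (freqNormSq k)⁻¹ ≤ 2 / (1 + freqNormSq k) := by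
        rw [inv_eq_one_div, div_le_div_iff₀ hm0 (by linarith)]
        linarith
      calc freqNormSq k ^ (-t) = (freqNormSq k)⁻¹ ^ t := by
            rw [Real.rpow_neg hm0.le, Real.inv_rpow hm0.le]
        _ ≤ (2 / (1 + freqNormSq k)) ^ t := Real.rpow_le_rpow (inv_nonneg.2 hm0.le) h2 ht0
        _ = 2 ^ t * (1 + freqNormSq k) ^ (-t) := by
            rw [Real.div_rpow (by norm_num) (by linarith), Real.rpow_neg (by linarith),
              div_eq_mul_inv]

omit [DecidableEq d] in
/-- **The elementary evaluation of `sup 𝒢_s` (Morosi–Pernici–Pizzocchero 2017, Prop. 4.2: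
"`sup_{k ∈ ℤ^d₀} 𝒢_{pn}(k) ≤ 2^{2p} p² ζ_{2n−2}`, `ζ_{2n−2} := ∑_{h ∈ ℤ^d₀} 1/|h|^{2n−2}` (note
that `ζ_{2n−2} < +∞`, since `2n − 2 > d`)"), for Morosi–Pizzocchero's functional `𝒢_s` of
`NSSobolev.abs_tsum_rpow_mul_re_inner_convect_pair_le_of_kernel_le`.** For `2(s − 1) > card d`,
every `k ∈ ℤ^n` and every finite `H ⊂ ℤ^n`,
`∑_{h ∈ H} |h ∧ k|² (|k|^s − |k−h|^s)² / (|h|^{2s+2} |k−h|^{2s}) ≤ s² 2^{2s−2} ζ_{2s−2}`,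
`ζ_{2s−2} = ∑_{m ≠ 0} (freqNormSq m)^{−(s−1)}`. MPP's three lines: `|h ∧ k| = |h ∧ (k−h)| ≤ |h||k−h|`
(their `|P_{h,k−h}| ≤ 1`), Lemma 4.1 with `max(|k|, |k−h|) ≤ |k−h| + |h|` and
`(x+y)^{2s−2} ≤ 2^{2s−3}(x^{2s−2} + y^{2s−2})`, then "the second sum becomes the first one after
a change of variable `h → k − h`". (For MPP's tame functional `𝒢_{pn}` the printed constant is
`2^{2p}p²`; for `p = n` and the present denominator the same lines give `s² 2^{2s−2}`.)
[cite: MorosiPerniciPizzocchero2017, Prop. 4.2 (4.3) with its proof (4.4)–(4.6); MorosiPizzocchero2012Kato, Def. 3.3] -/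
theorem sum_gramKernel_le {s : ℝ} (hsd : (Fintype.card d : ℝ) < 2 * (s - 1)) (k : d → ℤ)
    (H : Finset (d → ℤ)) :
    ∑ h ∈ H, (freqNormSq h * freqNormSq k - (∑ j, (h j : ℝ) * (k j : ℝ)) ^ 2) *
        (freqNormSq k ^ (s / 2) - freqNormSq (k - h) ^ (s / 2)) ^ 2 /
        (freqNormSq h ^ (s + 1) * freqNormSq (k - h) ^ s) ≤
      s ^ 2 * (2 : ℝ) ^ (2 * s - 2) *
        ∑' m : d → ℤ, (if m = 0 then (0 : ℝ) else freqNormSq m ^ (-(s - 1))) := by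
  classical
  set ζt : (d → ℤ) → ℝ := fun m => if m = 0 then (0 : ℝ) else freqNormSq m ^ (-(s - 1)) with hζt
  have hζ0 : ∀ m, 0 ≤ ζt m := fun m => by
    simp only [hζt]
    split_ifs
    · exact le_rfl
    · exact Real.rpow_nonneg (freqNormSq_nonneg m) _
  have hζs : Summable ζt := kp_summable_ite_freqNormSq_rpow_neg (d := d) (by linarith)
  have hZ0 : 0 ≤ ∑' m, ζt m := tsum_nonneg hζ0
  rcases isEmpty_or_nonempty d with hd | hd
  · -- `ℤ^0 = {0}`: every term vanishes
    have hterm : ∀ h ∈ H, (freqNormSq h * freqNormSq k - (∑ j, (h j : ℝ) * (k j : ℝ)) ^ 2) *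
        (freqNormSq k ^ (s / 2) - freqNormSq (k - h) ^ (s / 2)) ^ 2 /
        (freqNormSq h ^ (s + 1) * freqNormSq (k - h) ^ s) = 0 := fun h _ => by
      have h0 : freqNormSq h * freqNormSq k - (∑ j, (h j : ℝ) * (k j : ℝ)) ^ 2 = 0 := by
        simp [freqNormSq]
      rw [h0, zero_mul, zero_div]
    rw [Finset.sum_eq_zero hterm]
    positivity
  · have hcard : (1 : ℝ) ≤ Fintype.card d := by exact_mod_cast Fintype.card_pos
    have hs : 3 / 2 ≤ s := by linarith
    have hterm : ∀ h ∈ H, (freqNormSq h * freqNormSq k - (∑ j, (h j : ℝ) * (k j : ℝ)) ^ 2) *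
        (freqNormSq k ^ (s / 2) - freqNormSq (k - h) ^ (s / 2)) ^ 2 /
        (freqNormSq h ^ (s + 1) * freqNormSq (k - h) ^ s) ≤
        s ^ 2 * (2 : ℝ) ^ (2 * s - 3) * (ζt h + ζt (k - h)) := fun h _ => by
      have h1 := kp_kernel_term_le hs k h
      simpa only [hζt] using h1
    have h1 : ∑ h ∈ H, ζt h ≤ ∑' m, ζt m := hζs.sum_le_tsum H fun m _ => hζ0 m
    have h2 : ∑ h ∈ H, ζt (k - h) ≤ ∑' m, ζt m := by
      have hinj : Set.InjOn (fun h => k - h) ↑H := fun x _ y _ hxy => by simpa using hxy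
      rw [← Finset.sum_image (f := fun m => ζt m) hinj]
      exact hζs.sum_le_tsum _ fun m _ => hζ0 m
    have e2 : (2 : ℝ) ^ (2 * s - 2) = (2 : ℝ) ^ (2 * s - 3) * 2 := by
      rw [show (2 * s - 2 : ℝ) = (2 * s - 3) + 1 by ring, Real.rpow_add_one two_ne_zero]
    calc ∑ h ∈ H, (freqNormSq h * freqNormSq k - (∑ j, (h j : ℝ) * (k j : ℝ)) ^ 2) *
          (freqNormSq k ^ (s / 2) - freqNormSq (k - h) ^ (s / 2)) ^ 2 /
          (freqNormSq h ^ (s + 1) * freqNormSq (k - h) ^ s)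
        ≤ ∑ h ∈ H, s ^ 2 * (2 : ℝ) ^ (2 * s - 3) * (ζt h + ζt (k - h)) := Finset.sum_le_sum hterm
      _ = s ^ 2 * (2 : ℝ) ^ (2 * s - 3) * (∑ h ∈ H, ζt h + ∑ h ∈ H, ζt (k - h)) := by
          rw [← Finset.mul_sum, Finset.sum_add_distrib]
      _ ≤ s ^ 2 * (2 : ℝ) ^ (2 * s - 3) * (∑' m, ζt m + ∑' m, ζt m) :=
          mul_le_mul_of_nonneg_left (add_le_add h1 h2) (by positivity)
      _ = s ^ 2 * (2 : ℝ) ^ (2 * s - 2) * ∑' m, ζt m := by rw [e2]; ring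

/-- **The Kato inequality with Morosi–Pizzocchero's functional, evaluated by the elementary bound
(Morosi–Pernici–Pizzocchero 2017, Thm. 4.4 with Prop. 4.2 — their Cor. 4.5-type 'rough' bound
`G ≤ G^{⟨+⟩}` —, here for MP 2012's `𝒢_n`):** for smooth real fields `v, w` on `T^n` with
`div v = 0` and `2(s − 1) > n`,
`|∑_k |k|^{2s} Re⟪𝓕((v·∇)w)(k), ŵ(k)⟫| ≤ 2π s 2^{s−1} √ζ_{2s−2} ‖v‖_s ‖w‖_s²`,
`ζ_{2s−2} = ∑_{m ≠ 0} (freqNormSq m)^{−(s−1)}`, `‖f‖_s² = ∑_k |k|^{2s}‖f̂(k)‖²` — the theorem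
`NSSobolev.abs_tsum_rpow_mul_re_inner_convect_pair_le_of_kernel_le` with its hypothesis `hGker`
discharged by `NSSobolev.sum_gramKernel_le` (`Gsq = s² 2^{2s−2} ζ_{2s−2}`). On `T³`, `s = 3`:
`2π·3·4·√ζ₄ = 24π C₁` (`C₁² = ∑_{k≠0}|k|^{−4}`), a factor `4n = 12` below the Wiener-route
constant `4πn s2^s C₁` of `NSSobolev.abs_tsum_rpow_mul_re_inner_convect_pair_le` composed with
`F₁ ≤ C₁‖·‖_s`. (MP's lattice-optimised `G₃ ≤ 0.438` on `(ℝ/2πℤ)³` is another factor `≈ 7` lower and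
is not reproduced here.)
[cite: MorosiPerniciPizzocchero2017, Thm. 4.4, Prop. 4.2, Cor. 4.5; MorosiPizzocchero2012Kato, Prop. 3.5] -/
theorem abs_tsum_rpow_mul_re_inner_convect_pair_le_zeta (hv : IsSmooth v) (hdiv : IsDivFree v)
    (hw : IsSmooth w) {s : ℝ} (hsd : (Fintype.card d : ℝ) < 2 * (s - 1)) :
    |∑' k : d → ℤ, freqNormSq k ^ s *
        (inner ℂ (mFourierCoeff (EuclideanSpace.complexify ∘ Torus.convect v w) k)
          (mFourierCoeff (EuclideanSpace.complexify ∘ w) k)).re| ≤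
      2 * Real.pi * (s * (2 : ℝ) ^ (s - 1) *
          Real.sqrt (∑' k : d → ℤ, if k = 0 then (0 : ℝ) else freqNormSq k ^ (-(s - 1)))) *
        Real.sqrt (∑' k : d → ℤ, freqNormSq k ^ s *
            ‖mFourierCoeff (EuclideanSpace.complexify ∘ v) k‖ ^ 2) *
        (∑' k : d → ℤ, freqNormSq k ^ s *
            ‖mFourierCoeff (EuclideanSpace.complexify ∘ w) k‖ ^ 2) := by
  classical
  have hs : 1 ≤ s := by
    have : (0 : ℝ) ≤ Fintype.card d := Nat.cast_nonneg _
    linarith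
  have hZ0 : 0 ≤ ∑' k : d → ℤ, (if k = 0 then (0 : ℝ) else freqNormSq k ^ (-(s - 1))) :=
    tsum_nonneg fun k => by
      split_ifs
      · exact le_rfl
      · exact Real.rpow_nonneg (freqNormSq_nonneg k) _
  have h := abs_tsum_rpow_mul_re_inner_convect_pair_le_of_kernel_le hv hdiv hw hs
    (fun k H => sum_gramKernel_le hsd k H)
  have e2 : (2 : ℝ) ^ (2 * s - 2) = ((2 : ℝ) ^ (s - 1)) ^ 2 := by
    rw [← Real.rpow_natCast, ← Real.rpow_mul zero_le_two]
    congr 1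
    push_cast
    ring
  have e : Real.sqrt (s ^ 2 * (2 : ℝ) ^ (2 * s - 2) *
        ∑' k : d → ℤ, (if k = 0 then (0 : ℝ) else freqNormSq k ^ (-(s - 1)))) =
      s * (2 : ℝ) ^ (s - 1) *
        Real.sqrt (∑' k : d → ℤ, if k = 0 then (0 : ℝ) else freqNormSq k ^ (-(s - 1))) := by
    rw [Real.sqrt_mul (by positivity), Real.sqrt_mul (sq_nonneg _), Real.sqrt_sq (by linarith),
      e2, Real.sqrt_sq (Real.rpow_nonneg zero_le_two _)]
  rw [e] at h
  exact h

/-! ### §5 Morosi–Pizzocchero's functional `𝒦_n` for the transport term, and its elementary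
evaluation `sup 𝒦_s ≤ 2^{2s} ζ_{2s}` -/

set_option maxHeartbeats 800000 in
-- (one long lattice computation: the setup of §2 plus Morosi–Pizzocchero's Cauchy–Schwarz steps)
/-- **The transport ('basic') estimate with Morosi–Pizzocchero's sharp-constant functional `𝒦_n`
(Appl. Math. Lett. 26 (2013) 277 = arXiv:1007.4412, Def. 3.5 and Prop. 3.7: "`K'_n ≤ K_n⁺`,
`K_n⁺ := (2π)^{−d/2} (sup_{k ∈ ℤ^d₀} 𝒦_n(k))^{1/2}`,
`𝒦_n(k) := |k|^{2n} ∑_{h ∈ ℤ^d₀ₖ} |h ∧ k|² / (|h|^{2n+2} |k − h|^{2n+2})`", `K'_n` the sharp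
constant of `‖v·∂w‖_n ≤ K'_n ‖v‖_n ‖w‖_{n+1}` for `v ∈ H^n_{Σ0}` (zero mean, divergence free) and
`w ∈ H^{n+1}_0`; Morosi–Pernici–Pizzocchero 2017, Thm. 3.3, the case `p = n`), paired with the
advecting field.** Lattice form on the unit torus (`|k|² = freqNormSq k`,
`|h ∧ k|² = |h|²|k|² − (h·k)²`): for smooth real fields `w, v` with `div w = 0`, `∫ w = 0`,
`s ≥ 1`, and `Ksq` bounding all finite partial sums of `𝒦_s(k)`, every `k`,
`|∑_k |k|^{2s} Re⟪𝓕((w·∇)v)(k), ŵ(k)⟫| ≤ 2π √Ksq ‖w‖²_s ‖v‖_{s+1}` — ONE term (no `‖v‖_s`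
contribution, unlike the Wiener weight-splitting of
`NSSobolev.abs_tsum_rpow_mul_re_inner_convect_transport_le`). Proof = MP's (arXiv:1007.4412 §4;
MPP 2017, proof of Thm. 3.3): `𝓕((w·∇)v)(k) = ∑_h (2πi (k−h)·ŵ(h)) v̂(k−h)` with
`(k−h)·ŵ(h) = k·ŵ(h)` and `|k·ŵ(h)| ≤ (|h ∧ k|/|h|)‖ŵ(h)‖` (`h·ŵ(h) = 0`,
`NSSobolev.norm_sum_mul_le_sqrt_gram_of_orthogonal`; `ŵ(0) = 0`), Cauchy–Schwarz in `h` against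
`𝒦_s(k)`, then `|∑_k |k|^{2s}Re⟪B̂(k), ŵ(k)⟫| ≤ ∑_k |k|^s‖ŵ(k)‖·|k|^s‖B̂(k)‖` and Cauchy–Schwarz
in `k`. MP's certified `sup 𝒦₃` gives `K₃ ≤ 0.323` on `(ℝ/2πℤ)³`; the evaluation of `sup 𝒦_s`
is a hypothesis here (`hKker`), discharged elementarily in `NSSobolev.sum_wedgeKernel_le`.
[cite: MorosiPizzocchero2013Basic, Def. 3.5, Prop. 3.7 and §4; MorosiPerniciPizzocchero2017, Thm. 3.3 (p = n); MorosiPizzocchero2012Kato, Lemma 4.1] -/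
theorem abs_tsum_rpow_mul_re_inner_convect_transport_le_of_kernel_le (hw : IsSmooth w)
    (hdivw : IsDivFree w) (hw0 : HasZeroMean w) (hv : IsSmooth v) {s : ℝ} (hs : 1 ≤ s)
    {Ksq : ℝ} (hKker : ∀ (k : d → ℤ) (H : Finset (d → ℤ)), ∑ h ∈ H,
      freqNormSq k ^ s * (freqNormSq h * freqNormSq k - (∑ j, (h j : ℝ) * (k j : ℝ)) ^ 2) /
        (freqNormSq h ^ (s + 1) * freqNormSq (k - h) ^ (s + 1)) ≤ Ksq) :
    |∑' k : d → ℤ, freqNormSq k ^ s *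
        (inner ℂ (mFourierCoeff (EuclideanSpace.complexify ∘ Torus.convect w v) k)
          (mFourierCoeff (EuclideanSpace.complexify ∘ w) k)).re| ≤
      2 * Real.pi * Real.sqrt Ksq *
        (∑' k : d → ℤ, freqNormSq k ^ s *
            ‖mFourierCoeff (EuclideanSpace.complexify ∘ w) k‖ ^ 2) *
        Real.sqrt (∑' k : d → ℤ, freqNormSq k ^ (s + 1) *
            ‖mFourierCoeff (EuclideanSpace.complexify ∘ v) k‖ ^ 2) := by
  classical
  set V : (d → ℤ) → EuclideanSpace ℂ d := fun m => mFourierCoeff (EuclideanSpace.complexify ∘ v) m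
    with hVdef
  set A : (d → ℤ) → EuclideanSpace ℂ d := fun m => mFourierCoeff (EuclideanSpace.complexify ∘ w) m
    with hAdef
  -- ### weights and their summability (as in §2)
  set a : (d → ℤ) → ℝ := fun m => ‖A m‖ with ha
  set aV : (d → ℤ) → ℝ := fun m => ‖V m‖ with haV
  set r : (d → ℤ) → ℝ := fun m => Real.sqrt (freqNormSq m) with hr
  set ρ : (d → ℤ) → ℝ := fun m => freqNormSq m ^ (s / 2) with hρ
  set b : (d → ℤ) → ℝ := fun m => ρ m * a m with hb
  set bV' : (d → ℤ) → ℝ := fun m => ρ m * (r m * aV m) with hbV'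
  set a₁V : (d → ℤ) → ℝ := fun m => r m * aV m with ha₁V
  have ha0 : ∀ m, 0 ≤ a m := fun m => norm_nonneg _
  have haV0 : ∀ m, 0 ≤ aV m := fun m => norm_nonneg _
  have hr0 : ∀ m, 0 ≤ r m := fun m => Real.sqrt_nonneg _
  have hρ0 : ∀ m, 0 ≤ ρ m := fun m => Real.rpow_nonneg (freqNormSq_nonneg m) _
  have hb0 : ∀ m, 0 ≤ b m := fun m => mul_nonneg (hρ0 m) (ha0 m)
  have ha₁V0 : ∀ m, 0 ≤ a₁V m := fun m => mul_nonneg (hr0 m) (haV0 m)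
  have hbV'0 : ∀ m, 0 ≤ bV' m := fun m => mul_nonneg (hρ0 m) (ha₁V0 m)
  have has : Summable a := hw.complexify_comp.rapidDecay_mFourierCoeff.summable_norm
  have hpow : ∀ {t : ℝ}, 0 ≤ t → Summable fun m : d → ℤ => freqNormSq m ^ t * a m :=
    fun ht => kp_summable_rpow_mul_norm hw ht
  have hpowV : ∀ {t : ℝ}, 0 ≤ t → Summable fun m : d → ℤ => freqNormSq m ^ t * aV m :=
    fun ht => kp_summable_rpow_mul_norm hv ht
  have hr_eq : ∀ m, r m = freqNormSq m ^ (1 / 2 : ℝ) := fun m => Real.sqrt_eq_rpow _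
  have hρsq : ∀ m, ρ m * ρ m = freqNormSq m ^ s := fun m => by
    rw [hρ]
    simp only
    rw [← Real.rpow_add' (freqNormSq_nonneg m) (by linarith : s / 2 + s / 2 ≠ 0)]
    congr 1
    ring
  have hρr : ∀ m, ρ m * r m = freqNormSq m ^ ((s + 1) / 2) := fun m => by
    rw [hρ, hr_eq]
    simp only
    rw [← Real.rpow_add' (freqNormSq_nonneg m) (by linarith : s / 2 + 1 / 2 ≠ 0)]
    congr 1
    ring
  have hbs : Summable b := (hpow (by linarith : (0 : ℝ) ≤ s / 2)).congr fun m => by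
    simp only [hb, hρ]
  have ha₁Vs : Summable a₁V := (hpowV (by norm_num : (0 : ℝ) ≤ 1 / 2)).congr fun m => by
    simp only [ha₁V, hr_eq]
  have hbV's : Summable bV' := (hpowV (by linarith : (0 : ℝ) ≤ (s + 1) / 2)).congr fun m => by
    simp only [hbV']
    rw [← mul_assoc, hρr]
  have hb2 : ∀ m, b m ^ 2 = freqNormSq m ^ s * ‖A m‖ ^ 2 := fun m => by
    simp only [hb, ha]
    rw [mul_pow, sq, hρsq]
  have hbV'2 : ∀ m, bV' m ^ 2 = freqNormSq m ^ (s + 1) * ‖V m‖ ^ 2 := fun m => by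
    simp only [hbV', haV]
    rw [← mul_assoc, mul_pow, sq (ρ m * r m), hρr,
      ← Real.rpow_add' (freqNormSq_nonneg m) (by linarith : (s + 1) / 2 + (s + 1) / 2 ≠ 0)]
    congr 2
    ring
  have hb2s : Summable fun m => b m ^ 2 :=
    (hw.summable_freqNormSq_rpow_mul_norm_sq (by linarith : (0 : ℝ) ≤ s)).congr
      fun m => (hb2 m).symm
  have hbV'2s : Summable fun m => bV' m ^ 2 :=
    (hv.summable_freqNormSq_rpow_mul_norm_sq (by linarith : (0 : ℝ) ≤ s + 1)).congr
      fun m => (hbV'2 m).symm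
  set X : ℝ := ∑' k, freqNormSq k ^ s * ‖A k‖ ^ 2 with hX
  set XV' : ℝ := ∑' k, freqNormSq k ^ (s + 1) * ‖V k‖ ^ 2 with hXV'
  set F₀ : ℝ := ∑' k, a k with hF₀
  have hXb : ∑' m, b m ^ 2 = X := tsum_congr hb2
  have hXV'b : ∑' m, bV' m ^ 2 = XV' := tsum_congr hbV'2
  have hX0 : 0 ≤ X := by rw [← hXb]; exact tsum_nonneg fun m => sq_nonneg _
  have hXV'0 : 0 ≤ XV' := by rw [← hXV'b]; exact tsum_nonneg fun m => sq_nonneg _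
  have hF₀0 : 0 ≤ F₀ := tsum_nonneg fun m => ha0 m
  have hAle : ∀ m, a m ≤ F₀ := fun m => has.le_tsum m fun j _ => ha0 j
  have hBle : ∀ m, b m ≤ ∑' j, b j := fun m => hbs.le_tsum m fun j _ => hb0 j
  have hBV'le : ∀ m, bV' m ≤ ∑' j, bV' j := fun m => hbV's.le_tsum m fun j _ => hbV'0 j
  -- ### the pieces on `ℤ^n × ℤ^n`
  set c : (d → ℤ) → (d → ℤ) → ℂ := fun k l =>
    2 * Real.pi * Complex.I * ∑ j, ((l j : ℤ) : ℂ) * A (k - l) j with hc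
  set E : (d → ℤ) × (d → ℤ) → ℂ := fun q =>
    c q.1 q.2 * (((ρ q.1 * ρ q.1 : ℝ)) : ℂ) * inner ℂ (A q.1) (V q.2) with hE
  set C : ℝ := 2 * Real.pi * (Fintype.card d : ℝ) * (2 : ℝ) ^ (s - 1) with hC
  have hC0 : 0 ≤ C := by positivity
  set G : (d → ℤ) × (d → ℤ) → ℝ := fun q =>
    C * (b q.1 * (bV' q.2 * a (q.1 - q.2)) + b q.1 * (a₁V q.2 * b (q.1 - q.2))) with hG
  -- `|c k l| ≤ 2π n |l| ‖ŵ(k−l)‖` (crude; used only for summability)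
  have h2π : ‖(2 * Real.pi * Complex.I : ℂ)‖ = 2 * Real.pi := by simp [abs_of_pos Real.pi_pos]
  have hcle : ∀ k l, ‖c k l‖ ≤ 2 * Real.pi * (Fintype.card d : ℝ) * (r l * a (k - l)) := by
    intro k l
    simp only [hc]
    rw [norm_mul, h2π]
    have h1 : ‖∑ j, ((l j : ℤ) : ℂ) * A (k - l) j‖ ≤ (Fintype.card d : ℝ) * (r l * a (k - l)) := by
      refine (norm_sum_le _ _).trans ?_
      calc ∑ j, ‖((l j : ℤ) : ℂ) * A (k - l) j‖ ≤ ∑ _j : d, r l * a (k - l) :=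
            Finset.sum_le_sum fun j _ => by
              rw [norm_mul, Complex.norm_intCast]
              exact mul_le_mul (abs_apply_le_sqrt_freqNormSq l j)
                (PiLp.norm_apply_le (A (k - l)) j) (norm_nonneg _) (Real.sqrt_nonneg _)
        _ = (Fintype.card d : ℝ) * (r l * a (k - l)) := by
            rw [Finset.sum_const, Finset.card_univ, nsmul_eq_mul]
    calc 2 * Real.pi * ‖∑ j, ((l j : ℤ) : ℂ) * A (k - l) j‖
        ≤ 2 * Real.pi * ((Fintype.card d : ℝ) * (r l * a (k - l))) :=
          mul_le_mul_of_nonneg_left h1 (by positivity)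
      _ = 2 * Real.pi * (Fintype.card d : ℝ) * (r l * a (k - l)) := by ring
  -- `‖E(k,l)‖ ≤ G(k,l)` by the weight splitting (summability only)
  have hEle : ∀ q : (d → ℤ) × (d → ℤ), ‖E q‖ ≤ G q := by
    rintro ⟨k, l⟩
    simp only [hE, hG]
    rw [norm_mul, norm_mul, Complex.norm_real, Real.norm_of_nonneg (mul_nonneg (hρ0 k) (hρ0 k))]
    have h1 := hcle k l
    have h2 : ρ k ≤ (2 : ℝ) ^ (s - 1) * (ρ l + ρ (k - l)) := kp_rpow_le_two_rpow_mul_add hs k l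
    have h3 : ‖inner ℂ (A k) (V l)‖ ≤ a k * aV l := norm_inner_le_norm _ _
    have hn : 0 ≤ 2 * Real.pi * (Fintype.card d : ℝ) * (r l * a (k - l)) := by
      have := hr0 l; have := ha0 (k - l); positivity
    have h4 : ‖c k l‖ * (ρ k * ρ k) * ‖inner ℂ (A k) (V l)‖ ≤
        (2 * Real.pi * (Fintype.card d : ℝ) * (r l * a (k - l))) *
          (ρ k * ((2 : ℝ) ^ (s - 1) * (ρ l + ρ (k - l)))) * (a k * aV l) :=
      mul_le_mul (mul_le_mul h1 (mul_le_mul_of_nonneg_left h2 (hρ0 k))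
        (mul_nonneg (hρ0 k) (hρ0 k)) hn) h3 (norm_nonneg _) (by
          have := hρ0 k; have := hρ0 l; have := hρ0 (k - l); positivity)
    refine h4.trans (le_of_eq ?_)
    simp only [hb, hbV', ha₁V, hC]
    ring
  -- summability over pairs
  have hG0 : ∀ q : (d → ℤ) × (d → ℤ), 0 ≤ G q := fun q =>
    mul_nonneg hC0 (add_nonneg (mul_nonneg (hb0 _) (mul_nonneg (hbV'0 _) (ha0 _)))
      (mul_nonneg (hb0 _) (mul_nonneg (ha₁V0 _) (hb0 _))))
  have hGs : Summable G := by
    have h1 := kp_summable_prod_mul_mul_sub hb0 hbV'0 ha0 hbs hbV's hAle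
    have h2 := kp_summable_prod_mul_mul_sub hb0 ha₁V0 hb0 hbs ha₁Vs hBle
    exact ((h1.add h2).mul_left C).congr fun q => by simp only [hG]
  have hEs : Summable E := Summable.of_norm_bounded hGs hEle
  -- ### the convective coefficient as a series in `l = k − m`
  have hB : ∀ k p, mFourierCoeff (EuclideanSpace.complexify ∘ Torus.convect w v) k p =
      ∑' l, c k l * V l p := by
    intro k p
    rw [mFourierCoeff_convect_apply_eq_tsum hw hv k p,
      ← (Equiv.subLeft k).tsum_eq (fun m => (2 * Real.pi * Complex.I *
        ∑ j, (((k - m) j : ℤ) : ℂ) * A m j) * V (k - m) p)]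
    refine tsum_congr fun l => ?_
    simp only [Equiv.subLeft_apply, sub_sub_cancel, hc]
  have hcVs : ∀ k p, Summable fun l => c k l * V l p := by
    intro k p
    refine Summable.of_norm_bounded ((ha₁Vs.mul_left (2 * Real.pi * (Fintype.card d : ℝ) * F₀)))
      fun l => ?_
    rw [norm_mul]
    calc ‖c k l‖ * ‖V l p‖ ≤ (2 * Real.pi * (Fintype.card d : ℝ) * (r l * a (k - l))) * aV l :=
          mul_le_mul (hcle k l) (PiLp.norm_apply_le (V l) p) (norm_nonneg _) (by positivity)
      _ ≤ (2 * Real.pi * (Fintype.card d : ℝ) * (r l * F₀)) * aV l := by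
          gcongr
          exact hAle (k - l)
      _ = 2 * Real.pi * (Fintype.card d : ℝ) * F₀ * (r l * aV l) := by ring
  have hinner : ∀ k, inner ℂ (A k) (mFourierCoeff (EuclideanSpace.complexify ∘ Torus.convect w v) k) =
      ∑' l, c k l * inner ℂ (A k) (V l) := by
    intro k
    rw [PiLp.inner_apply]
    simp_rw [RCLike.inner_apply', hB k]
    rw [show (∑ p, conj (A k p) * ∑' l, c k l * V l p) = ∑ p, ∑' l, conj (A k p) * (c k l * V l p)
      from Finset.sum_congr rfl fun p _ => (tsum_mul_left).symm]
    rw [← Summable.tsum_finsetSum fun p _ => (hcVs k p).mul_left _]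
    refine tsum_congr fun l => ?_
    rw [PiLp.inner_apply, Finset.mul_sum]
    exact Finset.sum_congr rfl fun p _ => by rw [RCLike.inner_apply']; ring
  -- ### termwise: `|k|^{2s} Re⟪B̂(k), ŵ(k)⟫ = Re ∑_l E(k,l)`
  have hEfib : ∀ k, Summable fun l => E (k, l) := fun k => hEs.prod_factor k
  have hsplit : ∀ k, freqNormSq k ^ s *
      (inner ℂ (mFourierCoeff (EuclideanSpace.complexify ∘ Torus.convect w v) k) (A k)).re =
      (∑' l, E (k, l)).re := by
    intro k
    have hsym : (inner ℂ (mFourierCoeff (EuclideanSpace.complexify ∘ Torus.convect w v) k)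
        (A k)).re = (inner ℂ (A k)
          (mFourierCoeff (EuclideanSpace.complexify ∘ Torus.convect w v) k)).re := by
      rw [← inner_conj_symm, Complex.conj_re]
    rw [hsym, hinner k, ← Complex.re_ofReal_mul, ← tsum_mul_left]
    congr 1
    refine tsum_congr fun l => ?_
    simp only [hE, ← hρsq k]
    push_cast
    ring
  have hEre_le0 : ∀ k, ‖(∑' l, E (k, l)).re‖ ≤ ∑' l, G (k, l) := fun k => by
    rw [Real.norm_eq_abs]
    calc |(∑' l, E (k, l)).re| ≤ ‖∑' l, E (k, l)‖ := Complex.abs_re_le_norm _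
      _ ≤ ∑' l, ‖E (k, l)‖ := norm_tsum_le_tsum_norm (hEfib k).norm
      _ ≤ ∑' l, G (k, l) := (hEfib k).norm.tsum_le_tsum (fun l => hEle (k, l)) (hGs.prod_factor k)
  have hEre_s : Summable fun k => (∑' l, E (k, l)).re :=
    Summable.of_norm_bounded hGs.prod hEre_le0
  -- ### Morosi–Pizzocchero's sharp termwise bound through `𝒦_s`
  set κ : (d → ℤ) → (d → ℤ) → ℝ := fun k h =>
    freqNormSq k ^ s * (freqNormSq h * freqNormSq k - (∑ j, (h j : ℝ) * (k j : ℝ)) ^ 2) /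
      (freqNormSq h ^ (s + 1) * freqNormSq (k - h) ^ (s + 1)) with hκ
  -- the Gram determinant is nonnegative (Cauchy–Schwarz on `ℝ^d`)
  have hD0 : ∀ k h : d → ℤ, 0 ≤ freqNormSq h * freqNormSq k - (∑ j, (h j : ℝ) * (k j : ℝ)) ^ 2 := by
    intro k h
    have hCS := Real.sum_mul_le_sqrt_mul_sqrt Finset.univ (fun j => (h j : ℝ)) (fun j => (k j : ℝ))
    have hCS' := Real.sum_mul_le_sqrt_mul_sqrt Finset.univ (fun j => -(h j : ℝ)) (fun j => (k j : ℝ))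
    have hfk : freqNormSq k = ∑ j, (k j : ℝ) ^ 2 := by simp [freqNormSq]
    have hfh : freqNormSq h = ∑ j, (h j : ℝ) ^ 2 := by simp [freqNormSq]
    have e : Real.sqrt (∑ j, (h j : ℝ) ^ 2) * Real.sqrt (∑ j, (k j : ℝ) ^ 2) =
        Real.sqrt (freqNormSq h * freqNormSq k) := by
      rw [hfh, hfk, Real.sqrt_mul (Finset.sum_nonneg fun j _ => sq_nonneg _)]
    simp only [neg_sq, neg_mul, Finset.sum_neg_distrib] at hCS'
    rw [e] at hCS hCS'
    have hP : 0 ≤ freqNormSq h * freqNormSq k := mul_nonneg (freqNormSq_nonneg h) (freqNormSq_nonneg k)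
    have hab : |∑ j, (h j : ℝ) * (k j : ℝ)| ≤ Real.sqrt (freqNormSq h * freqNormSq k) :=
      abs_le.2 ⟨by linarith, hCS⟩
    have := Real.sq_sqrt hP
    nlinarith [abs_nonneg (∑ j, (h j : ℝ) * (k j : ℝ)), sq_abs (∑ j, (h j : ℝ) * (k j : ℝ))]
  have hκ0 : ∀ k h, 0 ≤ κ k h := fun k h =>
    div_nonneg (mul_nonneg (Real.rpow_nonneg (freqNormSq_nonneg k) _) (hD0 k h))
      (mul_nonneg (Real.rpow_nonneg (freqNormSq_nonneg h) _) (Real.rpow_nonneg (freqNormSq_nonneg _) _))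
  have hA0 : A 0 = 0 := Torus.mFourierCoeff_complexify_zero_of_hasZeroMean hw.integrable hw0
  -- `‖E(k,l)‖ ≤ 2π b_k √κ(k,k−l) b(k−l) bV'(l)`
  have hEsharp : ∀ k l, ‖E (k, l)‖ ≤
      2 * Real.pi * b k * (Real.sqrt (κ k (k - l)) * (b (k - l) * bV' l)) := by
    intro k l
    have hRHS0 : ∀ l', 0 ≤ 2 * Real.pi * b k * (Real.sqrt (κ k (k - l')) * (b (k - l') * bV' l')) :=
      fun l' => mul_nonneg (mul_nonneg (by positivity) (hb0 k))
        (mul_nonneg (Real.sqrt_nonneg _) (mul_nonneg (hb0 _) (hbV'0 l')))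
    simp only [hE]
    rw [norm_mul, norm_mul, Complex.norm_real, Real.norm_of_nonneg (mul_nonneg (hρ0 k) (hρ0 k))]
    by_cases hkl : k - l = 0
    · -- `l = k`: the advecting coefficient is `ŵ(0) = 0`
      have hc0 : c k l = 0 := by
        simp only [hc, hkl, hA0]
        simp
      rw [hc0, norm_zero, zero_mul, zero_mul]
      exact hRHS0 l
    by_cases hl0 : l = 0
    · -- `l = 0`: the symbol vanishes
      subst hl0
      have hc0 : c k 0 = 0 := by
        simp only [hc]
        simp
      rw [hc0, norm_zero, zero_mul, zero_mul]
      exact hRHS0 0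
    -- the generic term: `h = k − l ≠ 0`, `l ≠ 0`
    have hH : 0 < freqNormSq (k - l) := lt_of_lt_of_le one_pos (one_le_freqNormSq_of_ne_zero hkl)
    have hL : 0 < freqNormSq l := lt_of_lt_of_le one_pos (one_le_freqNormSq_of_ne_zero hl0)
    have hρl : 0 < ρ l := Real.rpow_pos_of_pos hL _
    have hrl : 0 < r l := Real.sqrt_pos.2 hL
    have hρh : 0 < ρ (k - l) := Real.rpow_pos_of_pos hH _
    have hrh : 0 < Real.sqrt (freqNormSq (k - l)) := Real.sqrt_pos.2 hH
    -- `|l · ŵ(h)| = |k · ŵ(h)| ≤ √D ‖ŵ(h)‖ / |h|` (`h · ŵ(h) = 0`, Lemma 4.1)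
    have hz : ∑ j, (((k - l) j : ℤ) : ℂ) * A (k - l) j = 0 :=
      IsDivFree.sum_mul_mFourierCoeff_eq_zero hw hdivw (k - l)
    have hlk : ∑ j, ((l j : ℤ) : ℂ) * A (k - l) j = ∑ j, ((k j : ℤ) : ℂ) * A (k - l) j := by
      have h0 : ∑ j, ((k j : ℤ) : ℂ) * A (k - l) j - ∑ j, ((l j : ℤ) : ℂ) * A (k - l) j = 0 := by
        rw [← hz, ← Finset.sum_sub_distrib]
        refine Finset.sum_congr rfl fun j _ => ?_
        simp only [Pi.sub_apply, Int.cast_sub]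
        ring
      exact (sub_eq_zero.1 h0).symm
    set Dg : ℝ := freqNormSq (k - l) * freqNormSq k - (∑ j, ((k - l) j : ℝ) * (k j : ℝ)) ^ 2 with hDg
    have hDg0 : 0 ≤ Dg := hD0 k (k - l)
    have hgeo : ‖∑ j, ((k j : ℤ) : ℂ) * A (k - l) j‖ * Real.sqrt (freqNormSq (k - l)) ≤
        Real.sqrt Dg * a (k - l) :=
      norm_sum_mul_le_sqrt_gram_of_orthogonal (k - l) k (A (k - l)) hz
    have hgeo' : ‖∑ j, ((k j : ℤ) : ℂ) * A (k - l) j‖ ≤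
        Real.sqrt Dg * a (k - l) / Real.sqrt (freqNormSq (k - l)) := by
      rw [le_div_iff₀ hrh]; exact hgeo
    have hc_le : ‖c k l‖ ≤ 2 * Real.pi * (Real.sqrt Dg * a (k - l) / Real.sqrt (freqNormSq (k - l))) := by
      simp only [hc]
      rw [norm_mul, h2π, hlk]
      exact mul_le_mul_of_nonneg_left hgeo' (by positivity)
    have h3 : ‖inner ℂ (A k) (V l)‖ ≤ a k * aV l := norm_inner_le_norm _ _
    have hq0 : 0 ≤ Real.sqrt Dg * a (k - l) / Real.sqrt (freqNormSq (k - l)) :=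
      div_nonneg (mul_nonneg (Real.sqrt_nonneg _) (ha0 _)) (Real.sqrt_nonneg _)
    have hmain : ‖c k l‖ * (ρ k * ρ k) * ‖inner ℂ (A k) (V l)‖ ≤
        2 * Real.pi * (Real.sqrt Dg * a (k - l) / Real.sqrt (freqNormSq (k - l))) *
          (ρ k * ρ k) * (a k * aV l) :=
      mul_le_mul (mul_le_mul_of_nonneg_right hc_le (mul_nonneg (hρ0 k) (hρ0 k))) h3
        (norm_nonneg _) (mul_nonneg (mul_nonneg (by positivity) hq0) (mul_nonneg (hρ0 k) (hρ0 k)))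
    refine hmain.trans (le_of_eq ?_)
    -- `√κ(k, k−l) = ρ_k √D / (|h| ρ(h) · ρ(l) r(l))`
    have hkk : k - (k - l) = l := sub_sub_cancel k l
    have hκkl : κ k (k - l) = ρ k * ρ k * Dg /
        (freqNormSq (k - l) ^ (s + 1) * freqNormSq l ^ (s + 1)) := by
      simp only [hκ, hkk, hDg, hρsq k]
    have hden : 0 < freqNormSq (k - l) ^ (s + 1) * freqNormSq l ^ (s + 1) :=
      mul_pos (Real.rpow_pos_of_pos hH _) (Real.rpow_pos_of_pos hL _)
    have e1 : Real.sqrt (freqNormSq (k - l)) * ρ (k - l) * (ρ l * r l) =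
        Real.sqrt (freqNormSq (k - l) ^ (s + 1) * freqNormSq l ^ (s + 1)) := by
      rw [hρ, hr]
      simp only
      rw [Real.sqrt_eq_rpow, Real.sqrt_eq_rpow, Real.sqrt_eq_rpow,
        Real.mul_rpow (Real.rpow_nonneg hH.le _) (Real.rpow_nonneg hL.le _),
        ← Real.rpow_mul hH.le, ← Real.rpow_mul hL.le, ← Real.rpow_add hH, ← Real.rpow_add hL]
      congr 1
      · congr 1; ring
      · congr 1; ring
    have hpos : 0 < Real.sqrt (freqNormSq (k - l)) * ρ (k - l) * (ρ l * r l) := by positivity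
    have hρρ : Real.sqrt (ρ k * ρ k * Dg) = ρ k * Real.sqrt Dg := by
      rw [Real.sqrt_mul (mul_nonneg (hρ0 k) (hρ0 k)), Real.sqrt_mul_self (hρ0 k)]
    have hsqrtκ : Real.sqrt (κ k (k - l)) =
        ρ k * Real.sqrt Dg / (Real.sqrt (freqNormSq (k - l)) * ρ (k - l) * (ρ l * r l)) := by
      rw [eq_div_iff hpos.ne', e1, hκkl, Real.sqrt_div' _ hden.le, hρρ,
        div_mul_cancel₀ _ (Real.sqrt_pos.2 hden).ne']
    rw [hsqrtκ]
    simp only [hb, hbV']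
    have hne1 : Real.sqrt (freqNormSq (k - l)) ≠ 0 := hrh.ne'
    have hne2 : ρ (k - l) ≠ 0 := hρh.ne'
    have hne3 : ρ l ≠ 0 := hρl.ne'
    have hne4 : r l ≠ 0 := hrl.ne'
    field_simp
  -- ### Cauchy–Schwarz in `h` against `𝒦_s(k)`, then in `k`
  have hB2le : ∀ m, b m ^ 2 ≤ X := fun m => by
    rw [← hXb]; exact hb2s.le_tsum m fun j _ => sq_nonneg _
  have hQs : ∀ k, Summable fun l => b (k - l) ^ 2 * bV' l ^ 2 := fun k =>
    (hbV'2s.mul_left X).of_nonneg_of_le (fun l => mul_nonneg (sq_nonneg _) (sq_nonneg _))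
      fun l => mul_le_mul_of_nonneg_right (hB2le _) (sq_nonneg _)
  have hκs : ∀ k, Summable fun l => κ k (k - l) := by
    intro k
    refine summable_of_sum_le (fun l => hκ0 k (k - l)) (c := Ksq) fun L => ?_
    have hinj : Set.InjOn (fun l => k - l) ↑L := fun x _ y _ hxy => by simpa using hxy
    rw [← Finset.sum_image (f := fun h => κ k h) hinj]
    exact hKker k _
  have hκtsum : ∀ k, ∑' l, κ k (k - l) ≤ Ksq := fun k =>
    Real.tsum_le_of_sum_le (fun l => hκ0 k (k - l)) fun L => by
      have hinj : Set.InjOn (fun l => k - l) ↑L := fun x _ y _ hxy => by simpa using hxy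
      rw [← Finset.sum_image (f := fun h => κ k h) hinj]
      exact hKker k _
  have hTk : ∀ k, ∑' l, ‖E (k, l)‖ ≤
      2 * Real.pi * Real.sqrt Ksq * (b k * Real.sqrt (∑' l, b (k - l) ^ 2 * bV' l ^ 2)) := by
    intro k
    have hy0 : ∀ l, 0 ≤ b (k - l) ^ 2 * bV' l ^ 2 := fun l => mul_nonneg (sq_nonneg _) (sq_nonneg _)
    obtain ⟨hsum1, hcs1⟩ := kp_tsum_sqrt_mul_sqrt_le (fun l => hκ0 k (k - l)) hy0 (hκs k) (hQs k)
    have hsq : ∀ l, Real.sqrt (b (k - l) ^ 2 * bV' l ^ 2) = b (k - l) * bV' l := fun l => by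
      rw [Real.sqrt_mul' _ (sq_nonneg _), Real.sqrt_sq (hb0 _), Real.sqrt_sq (hbV'0 _)]
    simp_rw [hsq] at hsum1 hcs1
    have h1 : ∑' l, ‖E (k, l)‖ ≤ ∑' l, 2 * Real.pi * b k * (Real.sqrt (κ k (k - l)) * (b (k - l) * bV' l)) :=
      (hEs.prod_factor k).norm.tsum_le_tsum (fun l => hEsharp k l) (hsum1.mul_left _)
    rw [tsum_mul_left] at h1
    have h2 : Real.sqrt (∑' l, κ k (k - l)) ≤ Real.sqrt Ksq := Real.sqrt_le_sqrt (hκtsum k)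
    calc ∑' l, ‖E (k, l)‖ ≤ 2 * Real.pi * b k * ∑' l, Real.sqrt (κ k (k - l)) * (b (k - l) * bV' l) := h1
      _ ≤ 2 * Real.pi * b k * (Real.sqrt (∑' l, κ k (k - l)) *
            Real.sqrt (∑' l, b (k - l) ^ 2 * bV' l ^ 2)) :=
          mul_le_mul_of_nonneg_left hcs1 (by have := hb0 k; positivity)
      _ ≤ 2 * Real.pi * b k * (Real.sqrt Ksq * Real.sqrt (∑' l, b (k - l) ^ 2 * bV' l ^ 2)) :=
          mul_le_mul_of_nonneg_left (mul_le_mul_of_nonneg_right h2 (Real.sqrt_nonneg _))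
            (by have := hb0 k; positivity)
      _ = 2 * Real.pi * Real.sqrt Ksq * (b k * Real.sqrt (∑' l, b (k - l) ^ 2 * bV' l ^ 2)) := by ring
  have hQK : ∀ K : Finset (d → ℤ), ∑ k ∈ K, ∑' l, b (k - l) ^ 2 * bV' l ^ 2 ≤ X * XV' := by
    intro K
    rw [← Summable.tsum_finsetSum (fun k _ => hQs k)]
    have hin : ∀ l, ∑ k ∈ K, b (k - l) ^ 2 * bV' l ^ 2 ≤ X * bV' l ^ 2 := by
      intro l
      rw [← Finset.sum_mul]
      refine mul_le_mul_of_nonneg_right ?_ (sq_nonneg _)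
      have hinj : Set.InjOn (fun k => k - l) ↑K := fun x _ y _ hxy => by simpa using hxy
      rw [← Finset.sum_image (f := fun m => b m ^ 2) hinj, ← hXb]
      exact hb2s.sum_le_tsum _ fun m _ => sq_nonneg _
    calc ∑' l, ∑ k ∈ K, b (k - l) ^ 2 * bV' l ^ 2 ≤ ∑' l, X * bV' l ^ 2 :=
          (summable_sum fun k _ => hQs k).tsum_le_tsum hin (hbV'2s.mul_left X)
      _ = X * XV' := by rw [tsum_mul_left, hXV'b]
  have hbQ : ∀ K : Finset (d → ℤ), ∑ k ∈ K, b k * Real.sqrt (∑' l, b (k - l) ^ 2 * bV' l ^ 2) ≤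
      Real.sqrt X * Real.sqrt (X * XV') := by
    intro K
    have h1 := Real.sum_mul_le_sqrt_mul_sqrt K b (fun k => Real.sqrt (∑' l, b (k - l) ^ 2 * bV' l ^ 2))
    have h2 : ∑ k ∈ K, Real.sqrt (∑' l, b (k - l) ^ 2 * bV' l ^ 2) ^ 2 =
        ∑ k ∈ K, ∑' l, b (k - l) ^ 2 * bV' l ^ 2 :=
      Finset.sum_congr rfl fun k _ => Real.sq_sqrt (tsum_nonneg fun l =>
        mul_nonneg (sq_nonneg _) (sq_nonneg _))
    rw [h2] at h1
    refine h1.trans (mul_le_mul ?_ (Real.sqrt_le_sqrt (hQK K)) (Real.sqrt_nonneg _) (Real.sqrt_nonneg _))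
    rw [← hXb]
    exact Real.sqrt_le_sqrt (hb2s.sum_le_tsum K fun m _ => sq_nonneg _)
  have hTsum : ∑' k, ∑' l, ‖E (k, l)‖ ≤ 2 * Real.pi * Real.sqrt Ksq * (Real.sqrt X * Real.sqrt (X * XV')) := by
    refine Real.tsum_le_of_sum_le (fun k => tsum_nonneg fun l => norm_nonneg _) fun K => ?_
    calc ∑ k ∈ K, ∑' l, ‖E (k, l)‖
        ≤ ∑ k ∈ K, 2 * Real.pi * Real.sqrt Ksq * (b k * Real.sqrt (∑' l, b (k - l) ^ 2 * bV' l ^ 2)) :=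
          Finset.sum_le_sum fun k _ => hTk k
      _ = 2 * Real.pi * Real.sqrt Ksq * ∑ k ∈ K, b k * Real.sqrt (∑' l, b (k - l) ^ 2 * bV' l ^ 2) := by
          rw [Finset.mul_sum]
      _ ≤ 2 * Real.pi * Real.sqrt Ksq * (Real.sqrt X * Real.sqrt (X * XV')) :=
          mul_le_mul_of_nonneg_left (hbQ K) (by positivity)
  -- ### conclusion
  have hEre_le' : ∀ k, ‖(∑' l, E (k, l)).re‖ ≤ ∑' l, ‖E (k, l)‖ := fun k => by
    rw [Real.norm_eq_abs]
    exact (Complex.abs_re_le_norm _).trans (norm_tsum_le_tsum_norm (hEfib k).norm)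
  rw [tsum_congr hsplit]
  have hXX : Real.sqrt X * Real.sqrt (X * XV') = X * Real.sqrt XV' := by
    rw [Real.sqrt_mul hX0, ← mul_assoc, Real.mul_self_sqrt hX0]
  calc |∑' k, (∑' l, E (k, l)).re| ≤ ∑' k, ‖(∑' l, E (k, l)).re‖ := by
        rw [← Real.norm_eq_abs]
        exact norm_tsum_le_tsum_norm hEre_s.norm
    _ ≤ ∑' k, ∑' l, ‖E (k, l)‖ := hEre_s.norm.tsum_le_tsum hEre_le' hEs.norm.prod
    _ ≤ 2 * Real.pi * Real.sqrt Ksq * (Real.sqrt X * Real.sqrt (X * XV')) := hTsum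
    _ = 2 * Real.pi * Real.sqrt Ksq * X * Real.sqrt XV' := by rw [hXX]; ring

omit [DecidableEq d] in
/-- The termwise bound of MPP's proof of Prop. 3.1, for the functional `𝒦_s` above:
`|k|^{2s} |h ∧ k|² / (|h|^{2s+2}|k−h|^{2s+2}) ≤ 2^{2s−1} (|h|^{−2s} + |k−h|^{−2s})` for `h ∉ {0, k}`
(`|h ∧ k| = |h ∧ (k−h)| ≤ |h||k−h|`, `|k|^{2s} ≤ 2^{2s−1}(|h|^{2s} + |k−h|^{2s})`); the left side
vanishes at `h = 0` and `h = k`. [cite: MorosiPerniciPizzocchero2017, proof of Prop. 3.1] -/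
private theorem kp_wedgeKernel_term_le {s : ℝ} (hs : 1 / 2 ≤ s) (k h : d → ℤ) :
    freqNormSq k ^ s * (freqNormSq h * freqNormSq k - (∑ j, (h j : ℝ) * (k j : ℝ)) ^ 2) /
        (freqNormSq h ^ (s + 1) * freqNormSq (k - h) ^ (s + 1)) ≤
      (2 : ℝ) ^ (2 * s - 1) *
        ((if h = 0 then (0 : ℝ) else freqNormSq h ^ (-s)) +
          (if k - h = 0 then (0 : ℝ) else freqNormSq (k - h) ^ (-s))) := by
  have hR0 : 0 ≤ (2 : ℝ) ^ (2 * s - 1) *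
      ((if h = 0 then (0 : ℝ) else freqNormSq h ^ (-s)) +
        (if k - h = 0 then (0 : ℝ) else freqNormSq (k - h) ^ (-s))) := by
    refine mul_nonneg (by positivity) (add_nonneg ?_ ?_)
    · split_ifs
      · exact le_rfl
      · exact Real.rpow_nonneg (freqNormSq_nonneg _) _
    · split_ifs
      · exact le_rfl
      · exact Real.rpow_nonneg (freqNormSq_nonneg _) _
  by_cases hh : h = 0
  · have h0 : freqNormSq h * freqNormSq k - (∑ j, (h j : ℝ) * (k j : ℝ)) ^ 2 = 0 := by
      subst hh
      simp [freqNormSq_zero]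
    rw [h0, mul_zero, zero_div]
    exact hR0
  by_cases hkh : k - h = 0
  · have h0 : freqNormSq h ^ (s + 1) * freqNormSq (k - h) ^ (s + 1) = 0 := by
      rw [hkh, freqNormSq_zero, Real.zero_rpow (by linarith : s + 1 ≠ 0), mul_zero]
    rw [h0, div_zero]
    exact hR0
  rw [if_neg hh, if_neg hkh]
  have hH : 0 < freqNormSq h := lt_of_lt_of_le one_pos (one_le_freqNormSq_of_ne_zero hh)
  have hK : 0 < freqNormSq (k - h) := lt_of_lt_of_le one_pos (one_le_freqNormSq_of_ne_zero hkh)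
  have hgram := kp_gram_le k h
  -- `|k|^{2s} ≤ 2^{2s−1}(|h|^{2s} + |k−h|^{2s})`
  have hsplit : freqNormSq k ^ s ≤ (2 : ℝ) ^ (2 * s - 1) * (freqNormSq h ^ s + freqNormSq (k - h) ^ s) := by
    have h1 := kp_rpow_le_two_rpow_mul_add (s := 2 * s) (by linarith) k h
    have e : ∀ m : d → ℤ, freqNormSq m ^ (2 * s / 2) = freqNormSq m ^ s := fun m => by
      congr 1; ring
    simp only [e] at h1
    exact h1
  set A : ℝ := freqNormSq h ^ s with hA
  set B : ℝ := freqNormSq (k - h) ^ s with hB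
  have hA0 : 0 < A := Real.rpow_pos_of_pos hH _
  have hB0 : 0 < B := Real.rpow_pos_of_pos hK _
  have eA : freqNormSq h ^ (s + 1) = freqNormSq h * A := by
    rw [hA, Real.rpow_add hH, Real.rpow_one, mul_comm]
  have eB : freqNormSq (k - h) ^ (s + 1) = freqNormSq (k - h) * B := by
    rw [hB, Real.rpow_add hK, Real.rpow_one, mul_comm]
  have eA' : freqNormSq h ^ (-s) = A⁻¹ := by rw [hA, Real.rpow_neg hH.le]
  have eB' : freqNormSq (k - h) ^ (-s) = B⁻¹ := by rw [hB, Real.rpow_neg hK.le]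
  have hden : 0 < freqNormSq h * A * (freqNormSq (k - h) * B) := by positivity
  rw [eA, eB, eA', eB', div_le_iff₀ hden]
  have hfs0 : 0 ≤ freqNormSq k ^ s := Real.rpow_nonneg (freqNormSq_nonneg k) _
  have hD0 : 0 ≤ freqNormSq h * freqNormSq k - (∑ j, (h j : ℝ) * (k j : ℝ)) ^ 2 := by
    have hCS := Real.sum_mul_le_sqrt_mul_sqrt Finset.univ (fun j => (h j : ℝ)) (fun j => (k j : ℝ))
    have hCS' := Real.sum_mul_le_sqrt_mul_sqrt Finset.univ (fun j => -(h j : ℝ)) (fun j => (k j : ℝ))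
    have hfk : freqNormSq k = ∑ j, (k j : ℝ) ^ 2 := by simp [freqNormSq]
    have hfh : freqNormSq h = ∑ j, (h j : ℝ) ^ 2 := by simp [freqNormSq]
    have e : Real.sqrt (∑ j, (h j : ℝ) ^ 2) * Real.sqrt (∑ j, (k j : ℝ) ^ 2) =
        Real.sqrt (freqNormSq h * freqNormSq k) := by
      rw [hfh, hfk, Real.sqrt_mul (Finset.sum_nonneg fun j _ => sq_nonneg _)]
    simp only [neg_sq, neg_mul, Finset.sum_neg_distrib] at hCS'
    rw [e] at hCS hCS'
    have hP : 0 ≤ freqNormSq h * freqNormSq k := mul_nonneg (freqNormSq_nonneg h) (freqNormSq_nonneg k)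
    have hab : |∑ j, (h j : ℝ) * (k j : ℝ)| ≤ Real.sqrt (freqNormSq h * freqNormSq k) :=
      abs_le.2 ⟨by linarith, hCS⟩
    have := Real.sq_sqrt hP
    nlinarith [abs_nonneg (∑ j, (h j : ℝ) * (k j : ℝ)), sq_abs (∑ j, (h j : ℝ) * (k j : ℝ))]
  calc freqNormSq k ^ s * (freqNormSq h * freqNormSq k - (∑ j, (h j : ℝ) * (k j : ℝ)) ^ 2)
      ≤ ((2 : ℝ) ^ (2 * s - 1) * (A + B)) * (freqNormSq h * freqNormSq (k - h)) :=
        mul_le_mul hsplit hgram hD0 (by positivity)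
    _ = (2 : ℝ) ^ (2 * s - 1) * (A⁻¹ + B⁻¹) * (freqNormSq h * A * (freqNormSq (k - h) * B)) := by
        field_simp
        ring

omit [DecidableEq d] in
/-- **The elementary evaluation of `sup 𝒦_s` (Morosi–Pernici–Pizzocchero 2017, Prop. 3.1:
"`sup_{k ∈ ℤ^d₀} 𝒦_{pn}(k) ≤ 2^{2p+2} ζ_{2n}`, `ζ_{2n} := ∑_{h ∈ ℤ^d₀} 1/|h|^{2n}` (note that
`ζ_{2n} < +∞`, since `2n > d`)"), for Morosi–Pizzocchero's functional `𝒦_s` of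
`NSSobolev.abs_tsum_rpow_mul_re_inner_convect_transport_le_of_kernel_le`.** For `2s > card d`,
every `k ∈ ℤ^n` and every finite `H ⊂ ℤ^n`,
`∑_{h ∈ H} |k|^{2s} |h ∧ k|² / (|h|^{2s+2} |k−h|^{2s+2}) ≤ 2^{2s} ζ_{2s}`,
`ζ_{2s} = ∑_{m ≠ 0} (freqNormSq m)^{−s}`. MPP's lines: `|h ∧ k| = |h ∧ (k−h)| ≤ |h||k−h|`
(`|P_{h,k−h}| ≤ 1`), "`|k|^{2p} ≤ (|k−h| + |h|)^{2p} ≤ 2^{2p−1}(|k−h|^{2p} + |h|^{2p})`", and "the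
second sum becomes the first one after a change of variable `h → k − h`". (MPP's tame functional
`𝒦_{pn}` carries the denominator `(|h|^p|k−h|^n + |h|^n|k−h|^p)²`, `= 4|h|^{2n}|k−h|^{2n}` at
`p = n`, and their printed constant `2^{2p+2}` drops this `4`; for MP's `𝒦_n` the same lines give
`2^{2s}`.) [cite: MorosiPerniciPizzocchero2017, Prop. 3.1 (3.3) with its proof (3.4)–(3.5); MorosiPizzocchero2013Basic, Def. 3.5, Remark 3.6 (ii)] -/
theorem sum_wedgeKernel_le {s : ℝ} (hsd : (Fintype.card d : ℝ) < 2 * s) (k : d → ℤ)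
    (H : Finset (d → ℤ)) :
    ∑ h ∈ H, freqNormSq k ^ s * (freqNormSq h * freqNormSq k - (∑ j, (h j : ℝ) * (k j : ℝ)) ^ 2) /
        (freqNormSq h ^ (s + 1) * freqNormSq (k - h) ^ (s + 1)) ≤
      (2 : ℝ) ^ (2 * s) * ∑' m : d → ℤ, (if m = 0 then (0 : ℝ) else freqNormSq m ^ (-s)) := by
  classical
  set ζt : (d → ℤ) → ℝ := fun m => if m = 0 then (0 : ℝ) else freqNormSq m ^ (-s) with hζt
  have hζ0 : ∀ m, 0 ≤ ζt m := fun m => by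
    simp only [hζt]
    split_ifs
    · exact le_rfl
    · exact Real.rpow_nonneg (freqNormSq_nonneg m) _
  have hζs : Summable ζt := kp_summable_ite_freqNormSq_rpow_neg (d := d) hsd
  have hZ0 : 0 ≤ ∑' m, ζt m := tsum_nonneg hζ0
  rcases isEmpty_or_nonempty d with hd | hd
  · have hterm : ∀ h ∈ H, freqNormSq k ^ s *
        (freqNormSq h * freqNormSq k - (∑ j, (h j : ℝ) * (k j : ℝ)) ^ 2) /
        (freqNormSq h ^ (s + 1) * freqNormSq (k - h) ^ (s + 1)) = 0 := fun h _ => by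
      have h0 : freqNormSq h * freqNormSq k - (∑ j, (h j : ℝ) * (k j : ℝ)) ^ 2 = 0 := by
        simp [freqNormSq]
      rw [h0, mul_zero, zero_div]
    rw [Finset.sum_eq_zero hterm]
    positivity
  · have hcard : (1 : ℝ) ≤ Fintype.card d := by exact_mod_cast Fintype.card_pos
    have hs : 1 / 2 ≤ s := by linarith
    have hterm : ∀ h ∈ H, freqNormSq k ^ s *
        (freqNormSq h * freqNormSq k - (∑ j, (h j : ℝ) * (k j : ℝ)) ^ 2) /
        (freqNormSq h ^ (s + 1) * freqNormSq (k - h) ^ (s + 1)) ≤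
        (2 : ℝ) ^ (2 * s - 1) * (ζt h + ζt (k - h)) := fun h _ => by
      have h1 := kp_wedgeKernel_term_le hs k h
      simpa only [hζt] using h1
    have h1 : ∑ h ∈ H, ζt h ≤ ∑' m, ζt m := hζs.sum_le_tsum H fun m _ => hζ0 m
    have h2 : ∑ h ∈ H, ζt (k - h) ≤ ∑' m, ζt m := by
      have hinj : Set.InjOn (fun h => k - h) ↑H := fun x _ y _ hxy => by simpa using hxy
      rw [← Finset.sum_image (f := fun m => ζt m) hinj]
      exact hζs.sum_le_tsum _ fun m _ => hζ0 m
    have e2 : (2 : ℝ) ^ (2 * s) = (2 : ℝ) ^ (2 * s - 1) * 2 := by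
      rw [show (2 * s : ℝ) = (2 * s - 1) + 1 by ring, Real.rpow_add_one two_ne_zero]
      ring_nf
    calc ∑ h ∈ H, freqNormSq k ^ s *
          (freqNormSq h * freqNormSq k - (∑ j, (h j : ℝ) * (k j : ℝ)) ^ 2) /
          (freqNormSq h ^ (s + 1) * freqNormSq (k - h) ^ (s + 1))
        ≤ ∑ h ∈ H, (2 : ℝ) ^ (2 * s - 1) * (ζt h + ζt (k - h)) := Finset.sum_le_sum hterm
      _ = (2 : ℝ) ^ (2 * s - 1) * (∑ h ∈ H, ζt h + ∑ h ∈ H, ζt (k - h)) := by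
          rw [← Finset.mul_sum, Finset.sum_add_distrib]
      _ ≤ (2 : ℝ) ^ (2 * s - 1) * (∑' m, ζt m + ∑' m, ζt m) :=
          mul_le_mul_of_nonneg_left (add_le_add h1 h2) (by positivity)
      _ = (2 : ℝ) ^ (2 * s) * ∑' m, ζt m := by rw [e2]; ring

/-- **The transport estimate with Morosi–Pizzocchero's functional, evaluated by the elementary
bound (MPP 2017, Thm. 3.3 with Prop. 3.1 — their Cor. 3.4-type 'rough' bound `K ≤ K^{⟨+⟩}` —,
here for MP's `𝒦_n`):** for smooth real fields `w, v` on `T^n` with `div w = 0`, `∫ w = 0`,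
and `2s > n`, `s ≥ 1`,
`|∑_k |k|^{2s} Re⟪𝓕((w·∇)v)(k), ŵ(k)⟫| ≤ 2π 2^s √ζ_{2s} ‖w‖²_s ‖v‖_{s+1}`,
`ζ_{2s} = ∑_{m ≠ 0} (freqNormSq m)^{−s}` — the theorem
`NSSobolev.abs_tsum_rpow_mul_re_inner_convect_transport_le_of_kernel_le` with `hKker` discharged by
`NSSobolev.sum_wedgeKernel_le` (`Ksq = 2^{2s} ζ_{2s}`). On `T³`, `s = 3`: `16π C₀`,
`C₀² = ∑_{k≠0}|k|^{−6}` (MP's lattice-optimised `K₃ ≤ 0.323` on `(ℝ/2πℤ)³` is a factor `≈ 4.6`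
lower and is not reproduced here).
[cite: MorosiPerniciPizzocchero2017, Thm. 3.3, Prop. 3.1, Cor. 3.4; MorosiPizzocchero2013Basic, Prop. 3.7] -/
theorem abs_tsum_rpow_mul_re_inner_convect_transport_le_zeta (hw : IsSmooth w)
    (hdivw : IsDivFree w) (hw0 : HasZeroMean w) (hv : IsSmooth v) {s : ℝ} (hs : 1 ≤ s)
    (hsd : (Fintype.card d : ℝ) < 2 * s) :
    |∑' k : d → ℤ, freqNormSq k ^ s *
        (inner ℂ (mFourierCoeff (EuclideanSpace.complexify ∘ Torus.convect w v) k)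
          (mFourierCoeff (EuclideanSpace.complexify ∘ w) k)).re| ≤
      2 * Real.pi * ((2 : ℝ) ^ s *
          Real.sqrt (∑' k : d → ℤ, if k = 0 then (0 : ℝ) else freqNormSq k ^ (-s))) *
        (∑' k : d → ℤ, freqNormSq k ^ s *
            ‖mFourierCoeff (EuclideanSpace.complexify ∘ w) k‖ ^ 2) *
        Real.sqrt (∑' k : d → ℤ, freqNormSq k ^ (s + 1) *
            ‖mFourierCoeff (EuclideanSpace.complexify ∘ v) k‖ ^ 2) := by
  classical
  have hZ0 : 0 ≤ ∑' k : d → ℤ, (if k = 0 then (0 : ℝ) else freqNormSq k ^ (-s)) :=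
    tsum_nonneg fun k => by
      split_ifs
      · exact le_rfl
      · exact Real.rpow_nonneg (freqNormSq_nonneg k) _
  have h := abs_tsum_rpow_mul_re_inner_convect_transport_le_of_kernel_le hw hdivw hw0 hv hs
    (fun k H => sum_wedgeKernel_le hsd k H)
  have e2 : (2 : ℝ) ^ (2 * s) = ((2 : ℝ) ^ s) ^ 2 := by
    rw [← Real.rpow_natCast, ← Real.rpow_mul zero_le_two]
    congr 1
    push_cast
    ring
  have e : Real.sqrt ((2 : ℝ) ^ (2 * s) *
        ∑' k : d → ℤ, (if k = 0 then (0 : ℝ) else freqNormSq k ^ (-s))) =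
      (2 : ℝ) ^ s * Real.sqrt (∑' k : d → ℤ, if k = 0 then (0 : ℝ) else freqNormSq k ^ (-s)) := by
    rw [Real.sqrt_mul (by positivity), e2, Real.sqrt_sq (Real.rpow_nonneg zero_le_two _)]
  rw [e] at h
  exact h

/-! ### §6 The constant of MPP's Lemma 5.3 at `p = n` in closed form (their Remark 5.4 (5.9),
conjectured there and checked numerically): `sup 𝒦_s ≤ B_s ζ_{2s}`,
`B_s = 2^{2s+2}(s+1)^{s+1}/(s+2)^{s+2}`, by weighted AM–GM -/

omit [Fintype d] [DecidableEq d] in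
/-- Weighted AM–GM in the form used for MPP's `b_{pp}`: for `G > 0`, `|P| ≤ G` and `s ≥ 1`,
`(G + P)^{s+1} (G − P) ≤ 2^{s+2} (s+1)^{s+1} (s+2)^{−(s+2)} G^{s+2}` (weights `(s+1)/(s+2)`,
`1/(s+2)` on `(G+P)/(s+1)` and `G − P`; equality at `P = sG/(s+2)`). [folklore] -/
private theorem kp_amgm_core {s G P : ℝ} (hs : 1 ≤ s) (hG : 0 < G) (hPG : |P| ≤ G) :
    (G + P) ^ (s + 1) * (G - P) ≤
      (2 : ℝ) ^ (s + 2) * (s + 1) ^ (s + 1) / (s + 2) ^ (s + 2) * G ^ (s + 2) := by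
  have hP1 : -G ≤ P := (abs_le.1 hPG).1
  have hP2 : P ≤ G := (abs_le.1 hPG).2
  have hs1 : 0 < s + 1 := by linarith
  have hs2 : 0 < s + 2 := by linarith
  set p₁ : ℝ := (G + P) / (s + 1) with hp₁
  set p₂ : ℝ := G - P with hp₂
  have hp₁0 : 0 ≤ p₁ := div_nonneg (by linarith) hs1.le
  have hp₂0 : 0 ≤ p₂ := by rw [hp₂]; linarith
  set w₁ : ℝ := (s + 1) / (s + 2) with hw₁
  set w₂ : ℝ := 1 / (s + 2) with hw₂
  have hw₁0 : 0 ≤ w₁ := div_nonneg hs1.le hs2.le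
  have hw₂0 : 0 ≤ w₂ := div_nonneg zero_le_one hs2.le
  have hw : w₁ + w₂ = 1 := by
    rw [hw₁, hw₂]
    field_simp
    ring
  have hAG := Real.geom_mean_le_arith_mean2_weighted hw₁0 hw₂0 hp₁0 hp₂0 hw
  have hmean : w₁ * p₁ + w₂ * p₂ = 2 * G / (s + 2) := by
    rw [hw₁, hw₂, hp₁, hp₂]
    field_simp
    ring
  rw [hmean] at hAG
  -- raise to the power `s + 2`
  have hL0 : 0 ≤ p₁ ^ w₁ * p₂ ^ w₂ := mul_nonneg (Real.rpow_nonneg hp₁0 _) (Real.rpow_nonneg hp₂0 _)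
  have hpow := Real.rpow_le_rpow hL0 hAG hs2.le
  have e1 : (p₁ ^ w₁ * p₂ ^ w₂) ^ (s + 2) = p₁ ^ (s + 1) * p₂ := by
    rw [Real.mul_rpow (Real.rpow_nonneg hp₁0 _) (Real.rpow_nonneg hp₂0 _),
      ← Real.rpow_mul hp₁0, ← Real.rpow_mul hp₂0]
    have e2 : w₁ * (s + 2) = s + 1 := by rw [hw₁]; field_simp
    have e3 : w₂ * (s + 2) = 1 := by rw [hw₂]; field_simp
    rw [e2, e3, Real.rpow_one]
  rw [e1] at hpow
  -- unfold `p₁` and collect the constants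
  have e4 : p₁ ^ (s + 1) = (G + P) ^ (s + 1) / (s + 1) ^ (s + 1) := by
    rw [hp₁, Real.div_rpow (by linarith) hs1.le]
  have e5 : (2 * G / (s + 2)) ^ (s + 2) = (2 : ℝ) ^ (s + 2) * G ^ (s + 2) / (s + 2) ^ (s + 2) := by
    rw [Real.div_rpow (by positivity) hs2.le, Real.mul_rpow zero_le_two hG.le]
  rw [e4, e5] at hpow
  have hc : 0 < (s + 1) ^ (s + 1) := Real.rpow_pos_of_pos hs1 _
  have hd : 0 < (s + 2) ^ (s + 2) := Real.rpow_pos_of_pos hs2 _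
  rw [div_mul_eq_mul_div, div_le_iff₀ hc] at hpow
  calc (G + P) ^ (s + 1) * (G - P) = (G + P) ^ (s + 1) * p₂ := by rw [hp₂]
    _ ≤ (2 : ℝ) ^ (s + 2) * G ^ (s + 2) / (s + 2) ^ (s + 2) * (s + 1) ^ (s + 1) := hpow
    _ = (2 : ℝ) ^ (s + 2) * (s + 1) ^ (s + 1) / (s + 2) ^ (s + 2) * G ^ (s + 2) := by
        field_simp

omit [Fintype d] [DecidableEq d] in
/-- **The constant of Morosi–Pernici–Pizzocchero's Lemma 5.3 at `p = n`, in closed form.** For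
`A, B > 0`, `P² ≤ AB` and `s ≥ 1`,
`(A + B + 2P)^s (AB − P²) ≤ 2^{s−1} M_s (A^s + B^s) AB`, `M_s = 2^{s+2}(s+1)^{s+1}/(s+2)^{s+2}`;
with `A = |h|²`, `B = |ℓ|²`, `P = h·ℓ` this is MPP's (5.8)
`|h+ℓ|^{2p} sin²θ_{hℓ}/(|h|^p|ℓ|^n + |h|^n|ℓ|^p)² ≤ (B_{pn}/8)(|h|^{−2n} + |ℓ|^{−2n})` at `p = n = s`
with the value `B_{pp} = 4^{p+1}(p+1)^{p+1}/(p+2)^{p+2}` of their Remark 5.4 (5.9) (there: a critical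
point with positive-definite Hessian, "we conjecture that `B_{pn} = b_{pn}(4/(p+2), 1/2)`", checked
numerically for the tabulated cases) — here PROVED for `p = n` and every real `s ≥ 1`: for `P ≤ 0`
by `|k|² ≤ A + B`; for `P > 0` by `A + B + 2P ≤ (A+B)(G+P)/G`, `AB − P² = (G+P)(G−P)`
(`G = √(AB)`, `2G ≤ A + B`) and the weighted AM–GM bound `kp_amgm_core`, then
`(A+B)^s ≤ 2^{s−1}(A^s + B^s)`. Equality at `A = B`, `P = sA/(s+2)`.
[cite: MorosiPerniciPizzocchero2017, Lemma 5.3 (ii) (5.8) and Remark 5.4 (5.9)] -/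
theorem rpow_mul_gram_le_of_sq_le {s A B P : ℝ} (hs : 1 ≤ s) (hA : 0 < A) (hB : 0 < B)
    (hP : P ^ 2 ≤ A * B) :
    (A + B + 2 * P) ^ s * (A * B - P ^ 2) ≤
      (2 : ℝ) ^ (s - 1) * ((2 : ℝ) ^ (s + 2) * (s + 1) ^ (s + 1) / (s + 2) ^ (s + 2)) *
        (A ^ s + B ^ s) * (A * B) := by
  set M : ℝ := (2 : ℝ) ^ (s + 2) * (s + 1) ^ (s + 1) / (s + 2) ^ (s + 2) with hM
  have hs0 : 0 ≤ s := by linarith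
  have hAB : 0 < A * B := mul_pos hA hB
  set G : ℝ := Real.sqrt (A * B) with hG
  have hG0 : 0 < G := Real.sqrt_pos.2 hAB
  have hG2 : G ^ 2 = A * B := Real.sq_sqrt hAB.le
  have hPG : |P| ≤ G := by
    rw [← Real.sqrt_sq_eq_abs, hG]
    exact Real.sqrt_le_sqrt hP
  have hP1 : -G ≤ P := (abs_le.1 hPG).1
  have hP2 : P ≤ G := (abs_le.1 hPG).2
  -- `2G ≤ A + B`
  have h2G : 2 * G ≤ A + B := by
    have hGAB : G = Real.sqrt A * Real.sqrt B := by rw [hG, Real.sqrt_mul hA.le]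
    rw [hGAB]
    nlinarith [sq_nonneg (Real.sqrt A - Real.sqrt B), Real.sq_sqrt hA.le, Real.sq_sqrt hB.le]
  -- `M ≥ 1` (the AM–GM bound at `P = 0`)
  have hM0 : 0 ≤ M := by rw [hM]; positivity
  have hM1 : 1 ≤ M := by
    have h0 := kp_amgm_core hs hG0 (P := 0) (by rw [abs_zero]; exact hG0.le)
    rw [add_zero, sub_zero, ← Real.rpow_add_one hG0.ne', show s + 1 + 1 = s + 2 by ring, ← hM] at h0
    have hGs : 0 < G ^ (s + 2) := Real.rpow_pos_of_pos hG0 _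
    exact le_of_mul_le_mul_right (by linarith : 1 * G ^ (s + 2) ≤ M * G ^ (s + 2)) hGs
  have hsum : (A + B) ^ s ≤ (2 : ℝ) ^ (s - 1) * (A ^ s + B ^ s) := kp_add_rpow_le hA.le hB.le hs
  have hgram0 : 0 ≤ A * B - P ^ 2 := by linarith
  rcases le_or_gt P 0 with hPle | hPgt
  · -- `P ≤ 0`: `|k|² ≤ A + B`
    have hbase0 : 0 ≤ A + B + 2 * P := by linarith
    have h1 : (A + B + 2 * P) ^ s ≤ (A + B) ^ s := Real.rpow_le_rpow hbase0 (by linarith) hs0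
    calc (A + B + 2 * P) ^ s * (A * B - P ^ 2) ≤ (A + B) ^ s * (A * B) :=
          mul_le_mul h1 (by nlinarith) hgram0 (Real.rpow_nonneg (by linarith) _)
      _ ≤ (2 : ℝ) ^ (s - 1) * (A ^ s + B ^ s) * (A * B) :=
          mul_le_mul_of_nonneg_right hsum hAB.le
      _ = (2 : ℝ) ^ (s - 1) * 1 * (A ^ s + B ^ s) * (A * B) := by ring
      _ ≤ (2 : ℝ) ^ (s - 1) * M * (A ^ s + B ^ s) * (A * B) := by
          have h2 : 0 ≤ (2 : ℝ) ^ (s - 1) := Real.rpow_nonneg zero_le_two _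
          have h3 : 0 ≤ A ^ s + B ^ s := add_nonneg (Real.rpow_nonneg hA.le _) (Real.rpow_nonneg hB.le _)
          have h4 := mul_le_mul_of_nonneg_left hM1 h2
          exact mul_le_mul_of_nonneg_right (mul_le_mul_of_nonneg_right h4 h3) hAB.le
  · -- `P > 0`: `A + B + 2P ≤ (A + B)(G + P)/G`, `AB − P² = (G + P)(G − P)`, AM–GM
    have hGP : 0 < G + P := by linarith
    have hk : A + B + 2 * P ≤ (A + B) * (G + P) / G := by
      rw [le_div_iff₀ hG0]
      nlinarith [mul_le_mul_of_nonneg_right h2G hPgt.le]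
    have hbase0 : 0 ≤ A + B + 2 * P := by linarith
    have h1 : (A + B + 2 * P) ^ s ≤ ((A + B) * (G + P) / G) ^ s := Real.rpow_le_rpow hbase0 hk hs0
    have e1 : ((A + B) * (G + P) / G) ^ s = (A + B) ^ s * (G + P) ^ s / G ^ s := by
      rw [Real.div_rpow (by positivity) hG0.le, Real.mul_rpow (by linarith) hGP.le]
    have hgram : A * B - P ^ 2 = (G + P) * (G - P) := by rw [← hG2]; ring
    have hcore := kp_amgm_core hs hG0 hPG
    rw [← hM] at hcore
    have hGs : 0 < G ^ s := Real.rpow_pos_of_pos hG0 _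
    have eG : G ^ (s + 2) = G ^ s * (A * B) := by
      rw [Real.rpow_add hG0, Real.rpow_two, hG2]
    have eGP : (G + P) ^ s * ((G + P) * (G - P)) = (G + P) ^ (s + 1) * (G - P) := by
      rw [Real.rpow_add_one hGP.ne']; ring
    calc (A + B + 2 * P) ^ s * (A * B - P ^ 2)
        ≤ ((A + B) ^ s * (G + P) ^ s / G ^ s) * ((G + P) * (G - P)) := by
          rw [← e1, ← hgram]
          exact mul_le_mul_of_nonneg_right h1 hgram0
      _ = (A + B) ^ s / G ^ s * ((G + P) ^ (s + 1) * (G - P)) := by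
          rw [← eGP]; ring
      _ ≤ (A + B) ^ s / G ^ s * (M * G ^ (s + 2)) :=
          mul_le_mul_of_nonneg_left hcore (div_nonneg (Real.rpow_nonneg (by linarith) _) hGs.le)
      _ = (A + B) ^ s * M * (A * B) := by
          rw [eG]; field_simp
      _ ≤ (2 : ℝ) ^ (s - 1) * (A ^ s + B ^ s) * M * (A * B) :=
          mul_le_mul_of_nonneg_right (mul_le_mul_of_nonneg_right hsum hM0) hAB.le
      _ = (2 : ℝ) ^ (s - 1) * M * (A ^ s + B ^ s) * (A * B) := by ring

omit [DecidableEq d] in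
/-- `|h|²|k|² − (h·k)² = |h|²|k−h|² − (h·(k−h))²` (`h ∧ k = h ∧ (k − h)`) and
`|k|² = |h|² + |k−h|² + 2 h·(k−h)` on the lattice. [folklore] -/
private theorem kp_gram_eq (k h : d → ℤ) :
    freqNormSq h * freqNormSq k - (∑ j, (h j : ℝ) * (k j : ℝ)) ^ 2 =
      freqNormSq h * freqNormSq (k - h) - (∑ j, (h j : ℝ) * ((k - h) j : ℝ)) ^ 2 ∧
    freqNormSq k = freqNormSq h + freqNormSq (k - h) + 2 * ∑ j, (h j : ℝ) * ((k - h) j : ℝ) := by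
  have hfk : freqNormSq k = ∑ j, (k j : ℝ) ^ 2 := by simp [freqNormSq]
  have hfh : freqNormSq h = ∑ j, (h j : ℝ) ^ 2 := by simp [freqNormSq]
  have hfkh : freqNormSq (k - h) = (∑ j, (k j : ℝ) ^ 2) - 2 * (∑ j, (h j : ℝ) * (k j : ℝ)) +
      ∑ j, (h j : ℝ) ^ 2 := by
    have e : ∀ j, (((k - h) j : ℤ) : ℝ) ^ 2 =
        (k j : ℝ) ^ 2 - 2 * ((h j : ℝ) * (k j : ℝ)) + (h j : ℝ) ^ 2 := fun j => by
      simp only [Pi.sub_apply, Int.cast_sub]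
      ring
    simp only [freqNormSq, e, Finset.sum_add_distrib, Finset.sum_sub_distrib, ← Finset.mul_sum]
  have hdot : ∑ j, (h j : ℝ) * (((k - h) j : ℤ) : ℝ) =
      (∑ j, (h j : ℝ) * (k j : ℝ)) - ∑ j, (h j : ℝ) ^ 2 := by
    have e : ∀ j, (h j : ℝ) * (((k - h) j : ℤ) : ℝ) = (h j : ℝ) * (k j : ℝ) - (h j : ℝ) ^ 2 :=
      fun j => by
        simp only [Pi.sub_apply, Int.cast_sub]
        ring
    simp only [e, Finset.sum_sub_distrib]
  refine ⟨?_, ?_⟩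
  · rw [hfk, hfh, hfkh, hdot]; ring
  · rw [hfk, hfh, hfkh, hdot]; ring

omit [DecidableEq d] in
/-- The termwise bound of `𝒦_s` with MPP's constant `B_{ss}/8`-form:
`|k|^{2s}|h ∧ k|²/(|h|^{2s+2}|k−h|^{2s+2}) ≤ 2^{s−1}M_s (|h|^{−2s} + |k−h|^{−2s})`,
`M_s = 2^{s+2}(s+1)^{s+1}/(s+2)^{s+2}` (`NSSobolev.rpow_mul_gram_le_of_sq_le` with `A = |h|²`,
`B = |k−h|²`, `P = h·(k−h)`); zero at `h = 0`, `h = k`.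
[cite: MorosiPerniciPizzocchero2017, Lemma 5.3 (ii), Remark 5.4] -/
private theorem kp_wedgeKernel_term_le_mpp {s : ℝ} (hs : 1 ≤ s) (k h : d → ℤ) :
    freqNormSq k ^ s * (freqNormSq h * freqNormSq k - (∑ j, (h j : ℝ) * (k j : ℝ)) ^ 2) /
        (freqNormSq h ^ (s + 1) * freqNormSq (k - h) ^ (s + 1)) ≤
      (2 : ℝ) ^ (s - 1) * ((2 : ℝ) ^ (s + 2) * (s + 1) ^ (s + 1) / (s + 2) ^ (s + 2)) *
        ((if h = 0 then (0 : ℝ) else freqNormSq h ^ (-s)) +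
          (if k - h = 0 then (0 : ℝ) else freqNormSq (k - h) ^ (-s))) := by
  set M : ℝ := (2 : ℝ) ^ (s + 2) * (s + 1) ^ (s + 1) / (s + 2) ^ (s + 2) with hM
  have hM0 : 0 ≤ M := by
    rw [hM]
    have : 0 < s + 1 := by linarith
    have : 0 < s + 2 := by linarith
    positivity
  have hR0 : 0 ≤ (2 : ℝ) ^ (s - 1) * M *
      ((if h = 0 then (0 : ℝ) else freqNormSq h ^ (-s)) +
        (if k - h = 0 then (0 : ℝ) else freqNormSq (k - h) ^ (-s))) := by
    refine mul_nonneg (mul_nonneg (Real.rpow_nonneg zero_le_two _) hM0) (add_nonneg ?_ ?_)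
    · split_ifs
      · exact le_rfl
      · exact Real.rpow_nonneg (freqNormSq_nonneg _) _
    · split_ifs
      · exact le_rfl
      · exact Real.rpow_nonneg (freqNormSq_nonneg _) _
  by_cases hh : h = 0
  · have h0 : freqNormSq h * freqNormSq k - (∑ j, (h j : ℝ) * (k j : ℝ)) ^ 2 = 0 := by
      subst hh
      simp [freqNormSq_zero]
    rw [h0, mul_zero, zero_div]
    exact hR0
  by_cases hkh : k - h = 0
  · have h0 : freqNormSq h ^ (s + 1) * freqNormSq (k - h) ^ (s + 1) = 0 := by
      rw [hkh, freqNormSq_zero, Real.zero_rpow (by linarith : s + 1 ≠ 0), mul_zero]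
    rw [h0, div_zero]
    exact hR0
  rw [if_neg hh, if_neg hkh]
  have hH : 0 < freqNormSq h := lt_of_lt_of_le one_pos (one_le_freqNormSq_of_ne_zero hh)
  have hK : 0 < freqNormSq (k - h) := lt_of_lt_of_le one_pos (one_le_freqNormSq_of_ne_zero hkh)
  obtain ⟨hgram, hfk⟩ := kp_gram_eq k h
  set A : ℝ := freqNormSq h with hA
  set B : ℝ := freqNormSq (k - h) with hB
  set P : ℝ := ∑ j, (h j : ℝ) * (((k - h) j : ℤ) : ℝ) with hP
  -- Cauchy–Schwarz `P² ≤ AB`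
  have hPAB : P ^ 2 ≤ A * B := by
    have hCS := Real.sum_mul_le_sqrt_mul_sqrt Finset.univ (fun j => (h j : ℝ))
      (fun j => (((k - h) j : ℤ) : ℝ))
    have hCS' := Real.sum_mul_le_sqrt_mul_sqrt Finset.univ (fun j => -(h j : ℝ))
      (fun j => (((k - h) j : ℤ) : ℝ))
    have hfh' : A = ∑ j, (h j : ℝ) ^ 2 := by simp [hA, freqNormSq]
    have hfl' : B = ∑ j, (((k - h) j : ℤ) : ℝ) ^ 2 := by simp [hB, freqNormSq]
    have e : Real.sqrt (∑ j, (h j : ℝ) ^ 2) * Real.sqrt (∑ j, (((k - h) j : ℤ) : ℝ) ^ 2) =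
        Real.sqrt (A * B) := by
      rw [hfh', hfl', Real.sqrt_mul (Finset.sum_nonneg fun j _ => sq_nonneg _)]
    simp only [neg_sq, neg_mul, Finset.sum_neg_distrib] at hCS'
    rw [e] at hCS hCS'
    have hP0 : 0 ≤ A * B := mul_nonneg hH.le hK.le
    have hab : |P| ≤ Real.sqrt (A * B) := abs_le.2 ⟨by rw [hP]; linarith, by rw [hP]; exact hCS⟩
    have := Real.sq_sqrt hP0
    nlinarith [abs_nonneg P, sq_abs P]
  have hcore := rpow_mul_gram_le_of_sq_le hs hH hK hPAB
  rw [← hM] at hcore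
  set As : ℝ := A ^ s with hAs
  set Bs : ℝ := B ^ s with hBs
  have hAs0 : 0 < As := Real.rpow_pos_of_pos hH _
  have hBs0 : 0 < Bs := Real.rpow_pos_of_pos hK _
  have eA : A ^ (s + 1) = A * As := by rw [hAs, Real.rpow_add hH, Real.rpow_one, mul_comm]
  have eB : B ^ (s + 1) = B * Bs := by rw [hBs, Real.rpow_add hK, Real.rpow_one, mul_comm]
  have eA' : A ^ (-s) = As⁻¹ := by rw [hAs, Real.rpow_neg hH.le]
  have eB' : B ^ (-s) = Bs⁻¹ := by rw [hBs, Real.rpow_neg hK.le]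
  have hden : 0 < A * As * (B * Bs) := by positivity
  rw [hgram, hfk, eA, eB, eA', eB', div_le_iff₀ hden]
  calc (A + B + 2 * P) ^ s * (A * B - P ^ 2) ≤ (2 : ℝ) ^ (s - 1) * M * (As + Bs) * (A * B) := hcore
    _ = (2 : ℝ) ^ (s - 1) * M * (As⁻¹ + Bs⁻¹) * (A * As * (B * Bs)) := by
        field_simp
        ring

omit [DecidableEq d] in
/-- **`sup 𝒦_s ≤ B_s ζ_{2s}` with MPP's closed-form constant `B_s = 2^{2s+2}(s+1)^{s+1}/(s+2)^{s+2}`**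
(Morosi–Pernici–Pizzocchero 2017, Lemma 5.3 with the value (5.9) of Remark 5.4 at `p = n`, in the
role of Prop. 3.1's `2^{2p+2}`): for `2s > card d`, `s ≥ 1`, every `k` and every finite `H ⊂ ℤ^n`,
`∑_{h ∈ H} |k|^{2s}|h ∧ k|²/(|h|^{2s+2}|k−h|^{2s+2}) ≤ B_s ζ_{2s}`, `ζ_{2s} = ∑_{m≠0}(freqNormSq m)^{−s}`
(`B₃ = 65536/3125 ≈ 20.97` against `2^{2s} = 64` of `NSSobolev.sum_wedgeKernel_le`).
[cite: MorosiPerniciPizzocchero2017, Prop. 3.1, Lemma 5.3 (ii), Remark 5.4 (5.9)] -/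
theorem sum_wedgeKernel_le_mpp {s : ℝ} (hs : 1 ≤ s) (hsd : (Fintype.card d : ℝ) < 2 * s)
    (k : d → ℤ) (H : Finset (d → ℤ)) :
    ∑ h ∈ H, freqNormSq k ^ s * (freqNormSq h * freqNormSq k - (∑ j, (h j : ℝ) * (k j : ℝ)) ^ 2) /
        (freqNormSq h ^ (s + 1) * freqNormSq (k - h) ^ (s + 1)) ≤
      ((2 : ℝ) ^ (2 * s + 2) * (s + 1) ^ (s + 1) / (s + 2) ^ (s + 2)) *
        ∑' m : d → ℤ, (if m = 0 then (0 : ℝ) else freqNormSq m ^ (-s)) := by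
  classical
  set M : ℝ := (2 : ℝ) ^ (s + 2) * (s + 1) ^ (s + 1) / (s + 2) ^ (s + 2) with hM
  have hM0 : 0 ≤ M := by
    rw [hM]
    have : 0 < s + 1 := by linarith
    have : 0 < s + 2 := by linarith
    positivity
  set ζt : (d → ℤ) → ℝ := fun m => if m = 0 then (0 : ℝ) else freqNormSq m ^ (-s) with hζt
  have hζ0 : ∀ m, 0 ≤ ζt m := fun m => by
    simp only [hζt]
    split_ifs
    · exact le_rfl
    · exact Real.rpow_nonneg (freqNormSq_nonneg m) _
  have hζs : Summable ζt := kp_summable_ite_freqNormSq_rpow_neg (d := d) hsd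
  have hterm : ∀ h ∈ H, freqNormSq k ^ s *
      (freqNormSq h * freqNormSq k - (∑ j, (h j : ℝ) * (k j : ℝ)) ^ 2) /
      (freqNormSq h ^ (s + 1) * freqNormSq (k - h) ^ (s + 1)) ≤
      (2 : ℝ) ^ (s - 1) * M * (ζt h + ζt (k - h)) := fun h _ => by
    have h1 := kp_wedgeKernel_term_le_mpp hs k h
    simpa only [hζt, hM] using h1
  have h1 : ∑ h ∈ H, ζt h ≤ ∑' m, ζt m := hζs.sum_le_tsum H fun m _ => hζ0 m
  have h2 : ∑ h ∈ H, ζt (k - h) ≤ ∑' m, ζt m := by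
    have hinj : Set.InjOn (fun h => k - h) ↑H := fun x _ y _ hxy => by simpa using hxy
    rw [← Finset.sum_image (f := fun m => ζt m) hinj]
    exact hζs.sum_le_tsum _ fun m _ => hζ0 m
  have e2 : (2 : ℝ) ^ (2 * s + 2) * (s + 1) ^ (s + 1) / (s + 2) ^ (s + 2) =
      (2 : ℝ) ^ (s - 1) * M * 2 := by
    rw [hM]
    have e : (2 : ℝ) ^ (2 * s + 2) = (2 : ℝ) ^ (s - 1) * (2 : ℝ) ^ (s + 2) * 2 := by
      rw [← Real.rpow_add two_pos, ← Real.rpow_add_one two_ne_zero]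
      congr 1; ring
    rw [e]
    ring
  calc ∑ h ∈ H, freqNormSq k ^ s *
        (freqNormSq h * freqNormSq k - (∑ j, (h j : ℝ) * (k j : ℝ)) ^ 2) /
        (freqNormSq h ^ (s + 1) * freqNormSq (k - h) ^ (s + 1))
      ≤ ∑ h ∈ H, (2 : ℝ) ^ (s - 1) * M * (ζt h + ζt (k - h)) := Finset.sum_le_sum hterm
    _ = (2 : ℝ) ^ (s - 1) * M * (∑ h ∈ H, ζt h + ∑ h ∈ H, ζt (k - h)) := by
        rw [← Finset.mul_sum, Finset.sum_add_distrib]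
    _ ≤ (2 : ℝ) ^ (s - 1) * M * (∑' m, ζt m + ∑' m, ζt m) :=
        mul_le_mul_of_nonneg_left (add_le_add h1 h2)
          (mul_nonneg (Real.rpow_nonneg zero_le_two _) hM0)
    _ = (2 : ℝ) ^ (2 * s + 2) * (s + 1) ^ (s + 1) / (s + 2) ^ (s + 2) * ∑' m, ζt m := by
        rw [e2]; ring

/-- **The transport estimate with MPP's closed-form constant:** for smooth real fields `w, v` on
`T^n` with `div w = 0`, `∫ w = 0`, `s ≥ 1` and `2s > n`,
`|∑_k |k|^{2s} Re⟪𝓕((w·∇)v)(k), ŵ(k)⟫| ≤ 2π √(B_s ζ_{2s}) ‖w‖²_s ‖v‖_{s+1}`,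
`B_s = 2^{2s+2}(s+1)^{s+1}/(s+2)^{s+2}` — `NSSobolev.abs_tsum_rpow_mul_re_inner_convect_transport_le_of_kernel_le`
with `hKker` discharged by `NSSobolev.sum_wedgeKernel_le_mpp`. On `T³`, `s = 3`:
`2π√(65536/3125)·C₀ ≈ 83` (`C₀² = ζ₆ ≈ 8.40`), against `16π C₀ ≈ 146` of
`NSSobolev.abs_tsum_rpow_mul_re_inner_convect_transport_le_zeta` and MP's lattice-optimised
`(2π)^{5/2}·0.323 ≈ 32`.
[cite: MorosiPerniciPizzocchero2017, Thm. 3.3, Lemma 5.3 (ii), Remark 5.4 (5.9); MorosiPizzocchero2013Basic, Prop. 3.7] -/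
theorem abs_tsum_rpow_mul_re_inner_convect_transport_le_zeta_mpp (hw : IsSmooth w)
    (hdivw : IsDivFree w) (hw0 : HasZeroMean w) (hv : IsSmooth v) {s : ℝ} (hs : 1 ≤ s)
    (hsd : (Fintype.card d : ℝ) < 2 * s) :
    |∑' k : d → ℤ, freqNormSq k ^ s *
        (inner ℂ (mFourierCoeff (EuclideanSpace.complexify ∘ Torus.convect w v) k)
          (mFourierCoeff (EuclideanSpace.complexify ∘ w) k)).re| ≤
      2 * Real.pi * Real.sqrt (((2 : ℝ) ^ (2 * s + 2) * (s + 1) ^ (s + 1) / (s + 2) ^ (s + 2)) *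
          ∑' k : d → ℤ, (if k = 0 then (0 : ℝ) else freqNormSq k ^ (-s))) *
        (∑' k : d → ℤ, freqNormSq k ^ s *
            ‖mFourierCoeff (EuclideanSpace.complexify ∘ w) k‖ ^ 2) *
        Real.sqrt (∑' k : d → ℤ, freqNormSq k ^ (s + 1) *
            ‖mFourierCoeff (EuclideanSpace.complexify ∘ v) k‖ ^ 2) :=
  abs_tsum_rpow_mul_re_inner_convect_transport_le_of_kernel_le hw hdivw hw0 hv hs
    (fun k H => sum_wedgeKernel_le_mpp hs hsd k H)

/-! ### §7 The case `n = 3`: MP's Lemma 5.3 (CPAA 2012) with the constant `C₃ ≤ 24` by hand,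
`sup 𝒢₃ ≤ 24 ζ₄` -/

omit [Fintype d] [DecidableEq d] in
/-- `(1 + t)³ (1 − t) ≤ 27/16` (`= (t − 1/2)² ((t + 3/2)² + 1/2) ≥ 0`). [folklore] -/
private theorem kp_cube_mul_le (t : ℝ) : (1 + t) ^ 3 * (1 - t) ≤ 27 / 16 := by
  have key : 27 / 16 - (1 + t) ^ 3 * (1 - t) = (t - 1 / 2) ^ 2 * ((t + 3 / 2) ^ 2 + 1 / 2) := by
    ring
  nlinarith [key, mul_nonneg (sq_nonneg (t - 1 / 2)) (by positivity : (0 : ℝ) ≤ (t + 3 / 2) ^ 2 + 1 / 2)]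

omit [Fintype d] [DecidableEq d] in
/-- **Morosi–Pizzocchero's Lemma 5.3 (CPAA 2012) at `n = 3` with an explicit constant:**
"`|p ∧ q|² (|p+q|ⁿ − |q|ⁿ)² ≤ (C_n/2) |p|⁴|q|² (|p|^{2n−2} + |q|^{2n−2})`", `C₃ = max c₃ = 14.81…`
(computed there by MATHEMATICA); here, with `a = |p|`, `b = |q|`, `p·q = abt`, `r = |p + q|`
(`r² = a² + b² + 2abt`), the bound `(1 − t²)(r³ − b³)² ≤ 12 (a²b⁴ + a⁶)`, i.e. `C₃/2 ≤ 12`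
(the optimum is `7.41`), proved by hand: `r³ − b³ = a(a + 2bt)(r² + rb + b²)/(r + b)`,
`(r² + rb + b²)/(r + b) ≤ (a² + 3ab + 3b²)/(a + 2b)` (monotone in `r ≤ a + b`), and for
`F = (a + 2bt)²(1 − t²)`: `F ≤ a² + b²` if `t ≤ 0`; `F ≤ (27/64)(a + 2b)²` if `t ≥ 0`, `a ≤ 2b`
(`a + 2bt ≤ (a+2b)(1+t)/2`, `(1+t)³(1−t) ≤ 27/16`); `F ≤ (a + 2b)²` if `t ≥ 0`, `a ≥ 2b`; each
case then closes by an explicit polynomial inequality (sums of squares).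
[cite: MorosiPizzocchero2012Kato, Lemma 5.3 (ii) and Example (C₃ = 14.814)] -/
theorem one_sub_sq_mul_sq_cube_sub_cube_le {a b t r : ℝ} (ha : 0 < a) (hb : 0 < b)
    (ht1 : -1 ≤ t) (ht2 : t ≤ 1) (hr0 : 0 ≤ r) (hr2 : r ^ 2 = a ^ 2 + b ^ 2 + 2 * a * b * t) :
    (1 - t ^ 2) * (r ^ 3 - b ^ 3) ^ 2 ≤ 12 * (a ^ 2 * b ^ 4 + a ^ 6) := by
  have hab : 0 < a * b := mul_pos ha hb
  -- `r ≤ a + b`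
  have hrab : r ≤ a + b := by
    calc r = Real.sqrt (r ^ 2) := (Real.sqrt_sq hr0).symm
      _ ≤ Real.sqrt ((a + b) ^ 2) := Real.sqrt_le_sqrt (by rw [hr2]; nlinarith)
      _ = a + b := Real.sqrt_sq (by linarith)
  have hrb : 0 < r + b := by linarith
  -- `(r³ − b³)(r + b) = a (a + 2bt)(r² + rb + b²)`
  have hid : (r ^ 3 - b ^ 3) * (r + b) = a * (a + 2 * b * t) * (r ^ 2 + r * b + b ^ 2) := by
    linear_combination (r ^ 2 + r * b + b ^ 2) * hr2
  -- monotonicity of `ρ ↦ (ρ² + ρb + b²)/(ρ + b)` up to `ρ = a + b`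
  have hmono : (r ^ 2 + r * b + b ^ 2) * (a + 2 * b) ≤ (a ^ 2 + 3 * a * b + 3 * b ^ 2) * (r + b) := by
    have e : (a ^ 2 + 3 * a * b + 3 * b ^ 2) * (r + b) - (r ^ 2 + r * b + b ^ 2) * (a + 2 * b) =
        (a + b - r) * ((r + b) * (a + 2 * b) - b ^ 2) := by ring
    have h1 : 0 ≤ (r + b) * (a + 2 * b) - b ^ 2 := by
      have e1 : (r + b) * (a + 2 * b) - b ^ 2 = r * a + 2 * (r * b) + a * b + b ^ 2 := by ring
      rw [e1]
      positivity
    have h2 := mul_nonneg (sub_nonneg.2 hrab) h1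
    rw [← e] at h2
    linarith
  -- `(r³ − b³)² (a + 2b)² ≤ a² (a + 2bt)² (a² + 3ab + 3b²)²`
  have hsq : (r ^ 3 - b ^ 3) ^ 2 * (a + 2 * b) ^ 2 ≤
      a ^ 2 * (a + 2 * b * t) ^ 2 * (a ^ 2 + 3 * a * b + 3 * b ^ 2) ^ 2 := by
    have hm0 : 0 ≤ (r ^ 2 + r * b + b ^ 2) * (a + 2 * b) := by positivity
    have h2 : ((r ^ 2 + r * b + b ^ 2) * (a + 2 * b)) ^ 2 ≤
        ((a ^ 2 + 3 * a * b + 3 * b ^ 2) * (r + b)) ^ 2 := pow_le_pow_left₀ hm0 hmono 2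
    have h1 : ((r ^ 3 - b ^ 3) * (a + 2 * b)) ^ 2 * (r + b) ^ 2 ≤
        (a * (a + 2 * b * t) * (a ^ 2 + 3 * a * b + 3 * b ^ 2)) ^ 2 * (r + b) ^ 2 := by
      calc ((r ^ 3 - b ^ 3) * (a + 2 * b)) ^ 2 * (r + b) ^ 2
          = ((r ^ 3 - b ^ 3) * (r + b)) ^ 2 * (a + 2 * b) ^ 2 := by ring
        _ = (a * (a + 2 * b * t)) ^ 2 * ((r ^ 2 + r * b + b ^ 2) * (a + 2 * b)) ^ 2 := by
            rw [hid]; ring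
        _ ≤ (a * (a + 2 * b * t)) ^ 2 * ((a ^ 2 + 3 * a * b + 3 * b ^ 2) * (r + b)) ^ 2 :=
            mul_le_mul_of_nonneg_left h2 (sq_nonneg _)
        _ = (a * (a + 2 * b * t) * (a ^ 2 + 3 * a * b + 3 * b ^ 2)) ^ 2 * (r + b) ^ 2 := by ring
    have h3 := le_of_mul_le_mul_right h1 (by positivity : (0 : ℝ) < (r + b) ^ 2)
    calc (r ^ 3 - b ^ 3) ^ 2 * (a + 2 * b) ^ 2 = ((r ^ 3 - b ^ 3) * (a + 2 * b)) ^ 2 := by ring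
      _ ≤ (a * (a + 2 * b * t) * (a ^ 2 + 3 * a * b + 3 * b ^ 2)) ^ 2 := h3
      _ = a ^ 2 * (a + 2 * b * t) ^ 2 * (a ^ 2 + 3 * a * b + 3 * b ^ 2) ^ 2 := by ring
  -- the bound on `F = (a + 2bt)²(1 − t²)` in the three cases, each `F (a²+3ab+3b²)² ≤ 12(a⁴+b⁴)(a+2b)²`
  have ht0 : 0 ≤ 1 - t ^ 2 := by nlinarith
  have hFmain : (a + 2 * b * t) ^ 2 * (1 - t ^ 2) * (a ^ 2 + 3 * a * b + 3 * b ^ 2) ^ 2 ≤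
      12 * (a ^ 4 + b ^ 4) * (a + 2 * b) ^ 2 := by
    have hS0 : 0 ≤ (a ^ 2 + 3 * a * b + 3 * b ^ 2) ^ 2 := sq_nonneg _
    rcases le_or_gt t 0 with htn | htp
    · -- `t ≤ 0`: `F ≤ a² + b²`
      have hF : (a + 2 * b * t) ^ 2 * (1 - t ^ 2) ≤ a ^ 2 + b ^ 2 := by
        have e : a ^ 2 + b ^ 2 - (a + 2 * b * t) ^ 2 * (1 - t ^ 2) =
            b ^ 2 * (1 - 2 * t ^ 2) ^ 2 + a ^ 2 * t ^ 2 + 4 * (a * b) * (-t) * (1 - t ^ 2) := by ring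
        have hnt : 0 ≤ -t := by linarith
        have hpos : 0 ≤ b ^ 2 * (1 - 2 * t ^ 2) ^ 2 + a ^ 2 * t ^ 2 + 4 * (a * b) * (-t) * (1 - t ^ 2) :=
          add_nonneg (add_nonneg (mul_nonneg (sq_nonneg _) (sq_nonneg _))
            (mul_nonneg (sq_nonneg _) (sq_nonneg _)))
            (mul_nonneg (mul_nonneg (mul_nonneg (by norm_num) hab.le) hnt) ht0)
        rw [← e] at hpos
        linarith
      have hQ : (a ^ 2 + b ^ 2) * (a ^ 2 + 3 * a * b + 3 * b ^ 2) ^ 2 ≤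
          12 * (a ^ 4 + b ^ 4) * (a + 2 * b) ^ 2 := by
        have e : 12 * (a ^ 4 + b ^ 4) * (a + 2 * b) ^ 2 -
            (a ^ 2 + b ^ 2) * (a ^ 2 + 3 * a * b + 3 * b ^ 2) ^ 2 =
            11 * a ^ 6 + 42 * (a ^ 5 * b) + 8 * (a ^ 4 * b ^ 2) + 30 * (a * b ^ 5) + 27 * b ^ 6 +
              12 * (a ^ 2 * b - a * b ^ 2) ^ 2 + 12 * (a ^ 2 * b - b ^ 3) ^ 2 := by ring
        have hpos : 0 ≤ 11 * a ^ 6 + 42 * (a ^ 5 * b) + 8 * (a ^ 4 * b ^ 2) + 30 * (a * b ^ 5) +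
            27 * b ^ 6 + 12 * (a ^ 2 * b - a * b ^ 2) ^ 2 + 12 * (a ^ 2 * b - b ^ 3) ^ 2 := by
          positivity
        rw [← e] at hpos
        linarith
      exact (mul_le_mul_of_nonneg_right hF hS0).trans hQ
    · rcases le_or_gt a (2 * b) with hale | hagt
      · -- `t > 0`, `a ≤ 2b`: `F ≤ (27/64)(a + 2b)²`
        have h1t : 0 ≤ 1 + t := by linarith
        have hlin : a + 2 * b * t ≤ (a + 2 * b) * (1 + t) / 2 := by
          have e1 : (a + 2 * b) * (1 + t) / 2 - (a + 2 * b * t) = (2 * b - a) * (1 - t) / 2 := by ring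
          have h1 : 0 ≤ (2 * b - a) * (1 - t) / 2 :=
            div_nonneg (mul_nonneg (by linarith) (by linarith)) zero_le_two
          rw [← e1] at h1
          linarith
        have hlin0 : 0 ≤ a + 2 * b * t := by positivity
        have hF : (a + 2 * b * t) ^ 2 * (1 - t ^ 2) ≤ 27 / 64 * (a + 2 * b) ^ 2 := by
          have h1 : (a + 2 * b * t) ^ 2 ≤ ((a + 2 * b) * (1 + t) / 2) ^ 2 :=
            pow_le_pow_left₀ hlin0 hlin 2
          have h2 := kp_cube_mul_le t
          calc (a + 2 * b * t) ^ 2 * (1 - t ^ 2) ≤ ((a + 2 * b) * (1 + t) / 2) ^ 2 * (1 - t ^ 2) :=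
                mul_le_mul_of_nonneg_right h1 ht0
            _ = (a + 2 * b) ^ 2 / 4 * ((1 + t) ^ 3 * (1 - t)) := by ring
            _ ≤ (a + 2 * b) ^ 2 / 4 * (27 / 16) :=
                mul_le_mul_of_nonneg_left h2 (by positivity)
            _ = 27 / 64 * (a + 2 * b) ^ 2 := by ring
        have hQ : 27 / 64 * (a + 2 * b) ^ 2 * (a ^ 2 + 3 * a * b + 3 * b ^ 2) ^ 2 ≤
            12 * (a ^ 4 + b ^ 4) * (a + 2 * b) ^ 2 := by
          -- `27(a²+3ab+3b²)² ≤ 768(a⁴+b⁴)`: an explicit (rational) sum of squares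
          have e : 768 * (a ^ 4 + b ^ 4) - 27 * (a ^ 2 + 3 * a * b + 3 * b ^ 2) ^ 2 =
              (1 / 525) * (525 * b ^ 2 - 243 * a * b - 350 * a ^ 2) ^ 2 +
                (1 / (175 * 31942)) * (31942 * a * b - 42525 * a ^ 2) ^ 2 +
                (17646941 / 95826) * a ^ 4 := by
            ring
          have hpos : 0 ≤ (1 / 525 : ℝ) * (525 * b ^ 2 - 243 * a * b - 350 * a ^ 2) ^ 2 +
              (1 / (175 * 31942)) * (31942 * a * b - 42525 * a ^ 2) ^ 2 +
              (17646941 / 95826) * a ^ 4 := by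
            positivity
          rw [← e] at hpos
          have hP : 27 * (a ^ 2 + 3 * a * b + 3 * b ^ 2) ^ 2 ≤ 768 * (a ^ 4 + b ^ 4) := by linarith
          calc 27 / 64 * (a + 2 * b) ^ 2 * (a ^ 2 + 3 * a * b + 3 * b ^ 2) ^ 2
              = 27 * (a ^ 2 + 3 * a * b + 3 * b ^ 2) ^ 2 * (a + 2 * b) ^ 2 / 64 := by ring
            _ ≤ 768 * (a ^ 4 + b ^ 4) * (a + 2 * b) ^ 2 / 64 := by gcongr
            _ = 12 * (a ^ 4 + b ^ 4) * (a + 2 * b) ^ 2 := by ring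
        exact (mul_le_mul_of_nonneg_right hF hS0).trans hQ
      · -- `t > 0`, `a > 2b`: `F ≤ (a + 2b)²`
        have hlin0 : 0 ≤ a + 2 * b * t := by positivity
        have hF : (a + 2 * b * t) ^ 2 * (1 - t ^ 2) ≤ (a + 2 * b) ^ 2 := by
          have h1 : (a + 2 * b * t) ^ 2 ≤ (a + 2 * b) ^ 2 :=
            pow_le_pow_left₀ hlin0 (by nlinarith [mul_le_mul_of_nonneg_left ht2 hb.le]) 2
          calc (a + 2 * b * t) ^ 2 * (1 - t ^ 2) ≤ (a + 2 * b) ^ 2 * (1 - t ^ 2) :=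
                mul_le_mul_of_nonneg_right h1 ht0
            _ ≤ (a + 2 * b) ^ 2 * 1 :=
                mul_le_mul_of_nonneg_left (by nlinarith [sq_nonneg t]) (sq_nonneg _)
            _ = (a + 2 * b) ^ 2 := mul_one _
        have hQ : (a + 2 * b) ^ 2 * (a ^ 2 + 3 * a * b + 3 * b ^ 2) ^ 2 ≤
            12 * (a ^ 4 + b ^ 4) * (a + 2 * b) ^ 2 := by
          -- `(a²+3ab+3b²)² ≤ 12(a⁴+b⁴)` for `a ≥ 2b`: with `e = a − 2b ≥ 0` all coefficients are positive
          set e : ℝ := a - 2 * b with he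
          have he0 : 0 ≤ e := by rw [he]; linarith
          have hae : a = e + 2 * b := by rw [he]; ring
          have hP : (a ^ 2 + 3 * a * b + 3 * b ^ 2) ^ 2 ≤ 12 * (a ^ 4 + b ^ 4) := by
            have e2 : 12 * (a ^ 4 + b ^ 4) - (a ^ 2 + 3 * a * b + 3 * b ^ 2) ^ 2 =
                11 * e ^ 4 + 82 * (e ^ 3 * b) + 213 * (e ^ 2 * b ^ 2) + 202 * (e * b ^ 3) +
                  35 * b ^ 4 := by
              rw [hae]; ring
            have hpos : 0 ≤ 11 * e ^ 4 + 82 * (e ^ 3 * b) + 213 * (e ^ 2 * b ^ 2) +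
                202 * (e * b ^ 3) + 35 * b ^ 4 := by positivity
            rw [← e2] at hpos
            linarith
          exact mul_le_mul_of_nonneg_left hP (sq_nonneg _) |>.trans (le_of_eq (by ring))
        exact (mul_le_mul_of_nonneg_right hF hS0).trans hQ
  -- assemble: multiply the goal by `(a + 2b)² > 0`
  have h2b : 0 < (a + 2 * b) ^ 2 := by positivity
  refine le_of_mul_le_mul_right ?_ h2b
  calc (1 - t ^ 2) * (r ^ 3 - b ^ 3) ^ 2 * (a + 2 * b) ^ 2
      = (1 - t ^ 2) * ((r ^ 3 - b ^ 3) ^ 2 * (a + 2 * b) ^ 2) := by ring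
    _ ≤ (1 - t ^ 2) * (a ^ 2 * (a + 2 * b * t) ^ 2 * (a ^ 2 + 3 * a * b + 3 * b ^ 2) ^ 2) :=
        mul_le_mul_of_nonneg_left hsq ht0
    _ = a ^ 2 * ((a + 2 * b * t) ^ 2 * (1 - t ^ 2) * (a ^ 2 + 3 * a * b + 3 * b ^ 2) ^ 2) := by ring
    _ ≤ a ^ 2 * (12 * (a ^ 4 + b ^ 4) * (a + 2 * b) ^ 2) :=
        mul_le_mul_of_nonneg_left hFmain (sq_nonneg _)
    _ = 12 * (a ^ 2 * b ^ 4 + a ^ 6) * (a + 2 * b) ^ 2 := by ring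

omit [DecidableEq d] in
/-- The termwise bound of `𝒢₃` with the hand constant `C₃/2 ≤ 12`:
`|h ∧ k|²(|k|³ − |k−h|³)²/(|h|⁸|k−h|⁶) ≤ 12 (|h|^{−4} + |k−h|^{−4})` (zero at `h = 0`, `h = k`).
[cite: MorosiPizzocchero2012Kato, Lemma 5.3 (ii), proof of Prop. 6.1 Step 3] -/
private theorem kp_gramKernel3_term_le (k h : d → ℤ) :
    (freqNormSq h * freqNormSq k - (∑ j, (h j : ℝ) * (k j : ℝ)) ^ 2) *
        (freqNormSq k ^ ((3 : ℝ) / 2) - freqNormSq (k - h) ^ ((3 : ℝ) / 2)) ^ 2 /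
        (freqNormSq h ^ ((3 : ℝ) + 1) * freqNormSq (k - h) ^ (3 : ℝ)) ≤
      12 * ((if h = 0 then (0 : ℝ) else freqNormSq h ^ (-((3 : ℝ) - 1))) +
          (if k - h = 0 then (0 : ℝ) else freqNormSq (k - h) ^ (-((3 : ℝ) - 1)))) := by
  have hR0 : 0 ≤ 12 * ((if h = 0 then (0 : ℝ) else freqNormSq h ^ (-((3 : ℝ) - 1))) +
      (if k - h = 0 then (0 : ℝ) else freqNormSq (k - h) ^ (-((3 : ℝ) - 1)))) := by
    refine mul_nonneg (by norm_num) (add_nonneg ?_ ?_)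
    · split_ifs
      · exact le_rfl
      · exact Real.rpow_nonneg (freqNormSq_nonneg _) _
    · split_ifs
      · exact le_rfl
      · exact Real.rpow_nonneg (freqNormSq_nonneg _) _
  by_cases hh : h = 0
  · have h0 : freqNormSq h * freqNormSq k - (∑ j, (h j : ℝ) * (k j : ℝ)) ^ 2 = 0 := by
      subst hh
      simp [freqNormSq_zero]
    rw [h0, zero_mul, zero_div]
    exact hR0
  by_cases hkh : k - h = 0
  · have h0 : freqNormSq h ^ ((3 : ℝ) + 1) * freqNormSq (k - h) ^ (3 : ℝ) = 0 := by
      rw [hkh, freqNormSq_zero, Real.zero_rpow (by norm_num : (3 : ℝ) ≠ 0), mul_zero]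
    rw [h0, div_zero]
    exact hR0
  rw [if_neg hh, if_neg hkh]
  have hH : 0 < freqNormSq h := lt_of_lt_of_le one_pos (one_le_freqNormSq_of_ne_zero hh)
  have hK : 0 < freqNormSq (k - h) := lt_of_lt_of_le one_pos (one_le_freqNormSq_of_ne_zero hkh)
  obtain ⟨hgram, hfk⟩ := kp_gram_eq k h
  set A : ℝ := freqNormSq h with hA
  set B : ℝ := freqNormSq (k - h) with hB
  set P : ℝ := ∑ j, (h j : ℝ) * (((k - h) j : ℤ) : ℝ) with hP
  -- Cauchy–Schwarz `P² ≤ AB`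
  have hPAB : P ^ 2 ≤ A * B := by
    have hCS := Real.sum_mul_le_sqrt_mul_sqrt Finset.univ (fun j => (h j : ℝ))
      (fun j => (((k - h) j : ℤ) : ℝ))
    have hCS' := Real.sum_mul_le_sqrt_mul_sqrt Finset.univ (fun j => -(h j : ℝ))
      (fun j => (((k - h) j : ℤ) : ℝ))
    have hfh' : A = ∑ j, (h j : ℝ) ^ 2 := by simp [hA, freqNormSq]
    have hfl' : B = ∑ j, (((k - h) j : ℤ) : ℝ) ^ 2 := by simp [hB, freqNormSq]
    have e : Real.sqrt (∑ j, (h j : ℝ) ^ 2) * Real.sqrt (∑ j, (((k - h) j : ℤ) : ℝ) ^ 2) =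
        Real.sqrt (A * B) := by
      rw [hfh', hfl', Real.sqrt_mul (Finset.sum_nonneg fun j _ => sq_nonneg _)]
    simp only [neg_sq, neg_mul, Finset.sum_neg_distrib] at hCS'
    rw [e] at hCS hCS'
    have hP0 : 0 ≤ A * B := mul_nonneg hH.le hK.le
    have hab : |P| ≤ Real.sqrt (A * B) := abs_le.2 ⟨by rw [hP]; linarith, by rw [hP]; exact hCS⟩
    have := Real.sq_sqrt hP0
    nlinarith [abs_nonneg P, sq_abs P]
  -- the square roots `a = |h|`, `b = |k − h|`, `r = |k|`, and `t = cos θ`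
  set a : ℝ := Real.sqrt A with ha
  set b : ℝ := Real.sqrt B with hb
  have ha0 : 0 < a := Real.sqrt_pos.2 hH
  have hb0 : 0 < b := Real.sqrt_pos.2 hK
  have ha2 : a ^ 2 = A := Real.sq_sqrt hH.le
  have hb2 : b ^ 2 = B := Real.sq_sqrt hK.le
  have hab : 0 < a * b := mul_pos ha0 hb0
  set t : ℝ := P / (a * b) with ht
  have hPt : P = a * b * t := by rw [ht]; field_simp
  have ht2 : t ^ 2 ≤ 1 := by
    have h1 : (a * b * t) ^ 2 ≤ (a * b) ^ 2 * 1 := by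
      rw [← hPt, mul_one, mul_pow, ha2, hb2]; exact hPAB
    rw [mul_pow] at h1
    exact le_of_mul_le_mul_left h1 (by positivity)
  have ht1 : -1 ≤ t := by nlinarith
  have ht1' : t ≤ 1 := by nlinarith
  have hfk0 : 0 ≤ freqNormSq k := freqNormSq_nonneg k
  set r : ℝ := Real.sqrt (freqNormSq k) with hr
  have hr0 : 0 ≤ r := Real.sqrt_nonneg _
  have hr2 : r ^ 2 = a ^ 2 + b ^ 2 + 2 * a * b * t := by
    rw [hr, Real.sq_sqrt hfk0, hfk, ha2, hb2, hPt]; ring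
  have hcore := one_sub_sq_mul_sq_cube_sub_cube_le ha0 hb0 ht1 ht1' hr0 hr2
  -- rewrite the kernel term in `a, b, t, r`
  have e32 : ∀ x : ℝ, 0 ≤ x → x ^ ((3 : ℝ) / 2) = Real.sqrt x ^ 3 := fun x hx => by
    rw [Real.sqrt_eq_rpow, ← Real.rpow_natCast, ← Real.rpow_mul hx]
    norm_num
  have eK : freqNormSq k ^ ((3 : ℝ) / 2) = r ^ 3 := e32 _ hfk0
  have eB : B ^ ((3 : ℝ) / 2) = b ^ 3 := e32 _ hK.le
  have eA4 : A ^ ((3 : ℝ) + 1) = a ^ 8 := by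
    rw [show ((3 : ℝ) + 1) = ((4 : ℕ) : ℝ) by norm_num, Real.rpow_natCast, ← ha2]; ring
  have eB3 : B ^ (3 : ℝ) = b ^ 6 := by
    rw [show (3 : ℝ) = ((3 : ℕ) : ℝ) by norm_num, Real.rpow_natCast, ← hb2]; ring
  have eA' : A ^ (-((3 : ℝ) - 1)) = (a ^ 4)⁻¹ := by
    rw [show (-((3 : ℝ) - 1)) = -((2 : ℕ) : ℝ) by norm_num, Real.rpow_neg hH.le, Real.rpow_natCast,
      ← ha2]; ring
  have eB' : B ^ (-((3 : ℝ) - 1)) = (b ^ 4)⁻¹ := by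
    rw [show (-((3 : ℝ) - 1)) = -((2 : ℕ) : ℝ) by norm_num, Real.rpow_neg hK.le, Real.rpow_natCast,
      ← hb2]; ring
  have hgram' : A * freqNormSq k - (∑ j, (h j : ℝ) * (k j : ℝ)) ^ 2 = a ^ 2 * b ^ 2 * (1 - t ^ 2) := by
    rw [hgram, hPt, ← ha2, ← hb2]; ring
  have hden : 0 < a ^ 8 * b ^ 6 := by positivity
  rw [hgram', eK, eB, eA4, eB3, eA', eB', div_le_iff₀ hden]
  calc a ^ 2 * b ^ 2 * (1 - t ^ 2) * (r ^ 3 - b ^ 3) ^ 2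
      = a ^ 2 * b ^ 2 * ((1 - t ^ 2) * (r ^ 3 - b ^ 3) ^ 2) := by ring
    _ ≤ a ^ 2 * b ^ 2 * (12 * (a ^ 2 * b ^ 4 + a ^ 6)) :=
        mul_le_mul_of_nonneg_left hcore (by positivity)
    _ = 12 * ((a ^ 4)⁻¹ + (b ^ 4)⁻¹) * (a ^ 8 * b ^ 6) := by
        field_simp

omit [DecidableEq d] in
/-- **`sup 𝒢₃ ≤ 24 ζ₄` by hand** (Morosi–Pizzocchero CPAA 2012, Prop. 6.1 Step 3: "`Δ𝒢_n(k) ≤ C_n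
∑_{h ∈ ℤ^d₀, |h| ≥ ρ} 1/|h|^{2n−2}`", here with no cutoff and the hand constant `C₃ ≤ 24` of
`NSSobolev.one_sub_sq_mul_sq_cube_sub_cube_le` in place of their numerically maximised
`C₃ = 14.81`): for `s = 3`, `card d ≤ 3`, every `k` and finite `H`,
`∑_{h∈H} |h ∧ k|²(|k|³ − |k−h|³)²/(|h|⁸|k−h|⁶) ≤ 24 ζ₄`, `ζ₄ = ∑_{m≠0}(freqNormSq m)^{−2}` — against
`s²2^{2s−2}ζ₄ = 144 ζ₄` of `NSSobolev.sum_gramKernel_le` (MP's certified `sup 𝒢₃` on `ℤ³` is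
`≈ 2.9 ζ₄`). [cite: MorosiPizzocchero2012Kato, Lemma 5.3, Prop. 6.1 (i) Step 3, Example after Prop. 3.7] -/
theorem sum_gramKernel_le_three {s : ℝ} (hs3 : s = 3) (hsd : (Fintype.card d : ℝ) < 2 * (s - 1))
    (k : d → ℤ) (H : Finset (d → ℤ)) :
    ∑ h ∈ H, (freqNormSq h * freqNormSq k - (∑ j, (h j : ℝ) * (k j : ℝ)) ^ 2) *
        (freqNormSq k ^ (s / 2) - freqNormSq (k - h) ^ (s / 2)) ^ 2 /
        (freqNormSq h ^ (s + 1) * freqNormSq (k - h) ^ s) ≤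
      24 * ∑' m : d → ℤ, (if m = 0 then (0 : ℝ) else freqNormSq m ^ (-(s - 1))) := by
  classical
  subst hs3
  set ζt : (d → ℤ) → ℝ := fun m => if m = 0 then (0 : ℝ) else freqNormSq m ^ (-((3 : ℝ) - 1)) with hζt
  have hζ0 : ∀ m, 0 ≤ ζt m := fun m => by
    simp only [hζt]
    split_ifs
    · exact le_rfl
    · exact Real.rpow_nonneg (freqNormSq_nonneg m) _
  have hζs : Summable ζt := kp_summable_ite_freqNormSq_rpow_neg (d := d) (by linarith)
  have hterm : ∀ h ∈ H, (freqNormSq h * freqNormSq k - (∑ j, (h j : ℝ) * (k j : ℝ)) ^ 2) *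
      (freqNormSq k ^ ((3 : ℝ) / 2) - freqNormSq (k - h) ^ ((3 : ℝ) / 2)) ^ 2 /
      (freqNormSq h ^ ((3 : ℝ) + 1) * freqNormSq (k - h) ^ (3 : ℝ)) ≤
      12 * (ζt h + ζt (k - h)) := fun h _ => by
    have h1 := kp_gramKernel3_term_le k h
    simpa only [hζt] using h1
  have h1 : ∑ h ∈ H, ζt h ≤ ∑' m, ζt m := hζs.sum_le_tsum H fun m _ => hζ0 m
  have h2 : ∑ h ∈ H, ζt (k - h) ≤ ∑' m, ζt m := by
    have hinj : Set.InjOn (fun h => k - h) ↑H := fun x _ y _ hxy => by simpa using hxy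
    rw [← Finset.sum_image (f := fun m => ζt m) hinj]
    exact hζs.sum_le_tsum _ fun m _ => hζ0 m
  calc ∑ h ∈ H, (freqNormSq h * freqNormSq k - (∑ j, (h j : ℝ) * (k j : ℝ)) ^ 2) *
        (freqNormSq k ^ ((3 : ℝ) / 2) - freqNormSq (k - h) ^ ((3 : ℝ) / 2)) ^ 2 /
        (freqNormSq h ^ ((3 : ℝ) + 1) * freqNormSq (k - h) ^ (3 : ℝ))
      ≤ ∑ h ∈ H, 12 * (ζt h + ζt (k - h)) := Finset.sum_le_sum hterm
    _ = 12 * (∑ h ∈ H, ζt h + ∑ h ∈ H, ζt (k - h)) := by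
        rw [← Finset.mul_sum, Finset.sum_add_distrib]
    _ ≤ 12 * (∑' m, ζt m + ∑' m, ζt m) :=
        mul_le_mul_of_nonneg_left (add_le_add h1 h2) (by norm_num)
    _ = 24 * ∑' m, ζt m := by ring

/-- **The Kato inequality on `T³` at `s = 3` with the hand constant**: for smooth real fields
`v, w` on `T^n`, `n ≤ 3`, with `div v = 0`,
`|∑_k |k|⁶ Re⟪𝓕((v·∇)w)(k), ŵ(k)⟫| ≤ 2π (24 ζ₄)^{1/2} ‖v‖_{Ḣ³} ‖w‖²_{Ḣ³}` — about `4π√6·C₁ ≈ 125`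
on `T³` (`C₁² = ζ₄ ≈ 16.5`), against `24π C₁ ≈ 307` of `…_pair_le_zeta` and MP's certified
`(2π)^{5/2}·0.438 ≈ 43`. [cite: MorosiPizzocchero2012Kato, Prop. 3.5, Lemma 5.3, Prop. 6.1] -/
theorem abs_tsum_rpow_mul_re_inner_convect_pair_le_zeta_three (hv : IsSmooth v)
    (hdiv : IsDivFree v) (hw : IsSmooth w) {s : ℝ} (hs3 : s = 3)
    (hsd : (Fintype.card d : ℝ) < 2 * (s - 1)) :
    |∑' k : d → ℤ, freqNormSq k ^ s *
        (inner ℂ (mFourierCoeff (EuclideanSpace.complexify ∘ Torus.convect v w) k)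
          (mFourierCoeff (EuclideanSpace.complexify ∘ w) k)).re| ≤
      2 * Real.pi * Real.sqrt (24 *
          ∑' k : d → ℤ, (if k = 0 then (0 : ℝ) else freqNormSq k ^ (-(s - 1)))) *
        Real.sqrt (∑' k : d → ℤ, freqNormSq k ^ s *
            ‖mFourierCoeff (EuclideanSpace.complexify ∘ v) k‖ ^ 2) *
        (∑' k : d → ℤ, freqNormSq k ^ s *
            ‖mFourierCoeff (EuclideanSpace.complexify ∘ w) k‖ ^ 2) :=
  abs_tsum_rpow_mul_re_inner_convect_pair_le_of_kernel_le hv hdiv hw (by rw [hs3]; norm_num)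
    (fun k H => sum_gramKernel_le_three hs3 hsd k H)

end NSSobolev

end Literature.Analysis.FluidPDE

end
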